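import Mathlib.Analysis.SpecialFunctions.PolarCoord
import Mathlib.Analysis.SpecialFunctions.Integrals.Basic
import Mathlib.Analysis.SpecialFunctions.Trigonometric.InverseDeriv
import Mathlib.Analysis.SpecialFunctions.Sqrt
import Mathlib.MeasureTheory.Integral.IntervalIntegral.IntegrationByParts
import Mathlib.MeasureTheory.Function.Jacobian
import Mathlib.MeasureTheory.Integral.Prod
import Mathlib.Analysis.SpecialFunctions.Log.Deriv
import Mathlib.Analysis.SpecialFunctions.Pow.Real
import Mathlib.Analysis.Calculus.Deriv.MeanValue
import Mathlib.MeasureTheory.Integral.IntervalIntegral.FundThmCalculus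
import Mathlib.Topology.Order.IntermediateValue
import Literature.Analysis.ODE.PeanoExistence
import Literature.Analysis.ODE.MaximalTime
import Literature.Analysis.ODE.OneSidedComparison
import Literature.Geometry.Lorentzian.StaticMasslessVlasovShell

/-!
# Existence of static massless Vlasov shells surrounding a Schwarzschild black hole (Andréasson 2021): proofs

Topic `Literature/Geometry/Lorentzian`; companion ("Proofs" file) of `StaticMasslessVlasovShell.lean`,
discharging its named fact `Andreasson2021_shellExistence`
(`theorem Andreasson2021_shellExistence_holds` at the end of this file):
for every black-hole mass `M₀ > 0` there is a `StaticMasslessVlasovShell M₀` with `k = 0`,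
`l = 1/2` and `M₀ < admMass` — H. Andréasson, *Existence of steady states of the massless
Einstein–Vlasov system surrounding a Schwarzschild black hole*, Ann. Henri Poincaré 22 (2021)
4271–4297, arXiv:2102.08170, Theorem 3.5 via Theorem 3.10, whose proof (§3–§4) is formalised here.

## The printed proof and this formalisation

Fix `E₀ = 1` (Remark 3.1). Instead of `L₀` we use the inner radius `R₀` as the free parameter
(§4: "we will instead use `R₀` as free parameter") and put `L₀ := R₀³/(R₀ - 2M₀) =: q²`, so that
`R₀` is a root of `(1 - 2M₀/r)L₀/r² = 1` (the defining equation of `R₀`, §3) and `q/R₀ → 1`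
(Lemma 3.2). With `γ := -μ - ½ log(L₀/r²) = -μ + log(r/q)` and `t := e^{γ}` (§3):

1. **Closed forms** (§3, the displays after Remark 3.4 = [AFT2, Lemma 3.3] for `k = 0`,
   `l = 1/2`): `ρ = π² q⁵ r⁻⁴ Q(t)`, `p = π² q⁵ r⁻⁴ P(t)` with `Q(t) = (3t⁵-5t³+2)/15
   = (t-1)²(3t³+6t²+4t+2)/15`, `P(t) = (3t⁵-10t³+15t-8)/60 = (t-1)³(3t²+9t+8)/60` for `t ≥ 1`
   and `ρ = p = 0` for `t ≤ 1`. PROVED from the definitions (2.5)–(2.6) of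
   `StaticMasslessVlasovShell.lean` (`energyDensity_zero_half`, `radialPressure_zero_half`) by the
   change of variables `(s, θ) ↦ (w, L) = (s cos θ, r²s² sin²θ)` of `(0,∞) × (0,π)` onto momentum
   space (Jacobian `2r²s² sin θ`, `ε = s`; Mathlib's `integral_image_eq_integral_abs_det_fderiv_smul`),
   Fubini, `∫₀^π sin θ F(cos θ) dθ = ∫_{-1}^{1} F`, and the elementary integrals
   `∫_{-1}^{1} √(1-x²) = π/2`, `∫_{-1}^{1} x²√(1-x²) = π/8`. [The paper's inner `L`-limit
   `r²(s²-1)` in the display before Lemma 3.3 is the massive-case expression; the massless one is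
   `r²s²`, which reproduces the printed closed forms.]
2. **The reduced system** (§2 (2.1)–(2.2) with `e^{2λ} = (1 - 2m/r)⁻¹`): `m' = 4πr² ρ̂(r, μ)`,
   `μ' = (m + 4πr³ p̂(r, μ))/(r(r - 2m))` on `[R₀, b]` with Schwarzschild data `m(R₀) = M₀`,
   `μ(R₀) = log(R₀/q) = ½ log(1 - 2M₀/R₀)` ("data given at `r = R₀`", Theorem 3.10), bundled as
   the structure `ReducedSolution M₀ R₀ b`. The paper takes global existence from [RR] and the
   bound `2m/r < 8/9` from [A2]; here existence on every slab `[R₀, R₀+T]` is PROVED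
   (`exists_reducedSolution`): Peano's theorem (tree: `Literature.Analysis.ODE.PeanoExistence`) for
   a clamped field, and a continuity argument (tree: `maximalTimeP`) based on the a priori bound
   `1 - 2m/r ≥ η₀ > 0` (`etaZero_le_w`: `(log(1-2m/r) + G(μ)/κ)' ≥ 0` with `G' = g`, `g(u)` a bound
   for `8πrρ̂(r,u)`, `κ = M₀/b²`; the matter switches itself off before a horizon forms).
   The Buchdahl-type bound of [A2] is NOT used anywhere: `2m/r < 1` suffices, at the price of
   slightly different numerical constants (below).
3. **The estimates of §4** along a reduced solution with `b = R₀ + 16δ`, `δ := (20π³)^{-1/3}`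
   (paper: `δ := (1/(20π³))^{1/3}`, same number), for `R₀ ≥ 10⁴δ`, `R₀ ≥ 10⁴M₀` (the paper's
   "`R₀` sufficiently large", made explicit): `γ ≤ log(r/R₀)`; the sandwich
   `(R₀/b)⁵π²rγ² ≤ ρ ≤ Λπ²rγ₊²`, `(R₀/b)⁵(π²/3)rγ³ ≤ p ≤ Λ(π²/3)rγ₊³`, `Λ = (q/R₀)⁵(b/R₀)⁵`
   (paper: `ρ = π²rγ²`, `p = (π²/3)rγ³` "for simplicity"); Lemma 4.1 (`γ' ≥ 1/(2r)` on
   `[R₀, R₀+δ]`, `L41`); Lemma 4.3 (first return `r₂ ≤ R₀ + 12δ` to the level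
   `γ_* = δ/(2(R₀+δ))`, paper `11δ` with the `8/9` bound, `L43`); Lemma 4.4 (`m(r₂)/r₂ ≥ 2/5`,
   `L44`) via the "fundamental equation" of [A0]: the functional
   `Z = e^{μ}(m + 4πr³p)/√(1-2m/r) + 2R₀e^{μ(R₀)}√(1-2m/r)` is non-decreasing (`hasDerivAt_Z`;
   this is where the TOV structure `tP'(t) = P(t) + Q(t)` of the closed forms enters,
   `hasDerivAt_p`), together with the exact identity `e^{μ(R₀)-μ(r₂)}R₀/r₂ = e^{γ_*}(R₀/r₂)²`
   (which replaces the paper's estimate of `μ(r₂) - μ(R₀)` through `e^{2λ} ≤ 9`); and the Makino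
   step (`u := rγ/m` has `u' ≤ -3/(4r)` once `m/r ≥ 3/8`, `γ ≤ 1/8`, so `γ` vanishes within
   `(4/3) b u(r₂)` of `r₂`, `makino`). Result: `R₁ ∈ (R₀, R₀ + 16δ]` with `γ(R₁) = 0`,
   `m(R₁) > M₀` (`exists_zero_of_large`).
4. **Gluing** (§2–§3: `f = 0` on `[2M₀, R₀]`, Schwarzschild attached at `R₁`): `gluedM`, `gluedμ`
   are Schwarzschild of mass `M₀` on the gap, the reduced solution on `[R₀, R₁]`, Schwarzschild of
   mass `m(R₁)` beyond; the one-sided derivatives match at `R₀`, `R₁` because `ρ = p = 0` there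
   (`γ = 0`), and the barrier conditions at `R₀`, `R₁` are `γ ≤ 0` (`toShell`).

## Contents (namespace `Literature.Geometry.Lorentzian.MasslessVlasov`)

profiles `rhoProfile`, `pProfile` and `rhoHat`, `pHat` · one-dimensional integrals · `momentumCoord`
and the change of variables · `energyDensity_zero_half`, `radialPressure_zero_half` · calculus
helpers (`exists_first_lt`, …) · `shellQ`, `ReducedSolution` (+ namespace API: `γ`, `w`, …,
`etaZero_le_w`) · `clampedField`, `exists_reducedSolution` · `shellDelta`, `gammaStar`, `Lam`, `lam`,
`L41`, `L43`, `Z`, `hasDerivAt_Z`, `L44`, `makino`, `exists_zero`, `exists_zero_of_large` ·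
`gluedM`, `gluedμ`, `toShell` · `Andreasson2021_shellExistence_holds` (root namespace
`Literature.Geometry.Lorentzian`).

## References

* H. Andréasson, Ann. Henri Poincaré 22 (2021) 4271–4297, arXiv:2102.08170, §2–§4 (key
  `Andreasson2021`); its references [A0] H. Andréasson, Commun. Math. Phys. 274 (2007) 399–408
  (the fundamental equation (10)), [AFT2] Andréasson–Fajman–Thaller, Ann. Henri Poincaré 18 (2017),
  Lemma 3.3 (key `AndreassonFajmanThaller2015`), [Ma] T. Makino, J. Math. Kyoto Univ. 38 (1998).
* P. Hartman, *Ordinary Differential Equations*, Thm II.2.1 (Peano), via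
  `Literature/Analysis/ODE/PeanoExistence.lean`.
-/

noncomputable section

open MeasureTheory Set Filter Real intervalIntegral
open scoped Topology Real

namespace Literature.Geometry.Lorentzian

namespace MasslessVlasov

/-! ### The profiles `Q`, `P` -/

/-- The energy-density profile `Q(t) = (3s⁵ - 5s³ + 2)/15 = (s-1)²(3s³+6s²+4s+2)/15`, `s = max t 1`
(so `Q(t) = 0` for `t ≤ 1`: "if `γ < 0` then all matter components vanish").
[cite: Andreasson2021, §3, display (ρ) after Remark 3.4] -/
def rhoProfile (t : ℝ) : ℝ := (3 * max t 1 ^ 5 - 5 * max t 1 ^ 3 + 2) / 15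

/-- The radial-pressure profile `P(t) = (3s⁵ - 10s³ + 15s - 8)/60 = (s-1)³(3s²+9s+8)/60`,
`s = max t 1`. [cite: Andreasson2021, §3, display (p) after Remark 3.4] -/
def pProfile (t : ℝ) : ℝ := (3 * max t 1 ^ 5 - 10 * max t 1 ^ 3 + 15 * max t 1 - 8) / 60

/-- `Q` is continuous. [folklore] -/
theorem continuous_rhoProfile : Continuous rhoProfile := by
  unfold rhoProfile; fun_prop

/-- `P` is continuous. [folklore] -/
theorem continuous_pProfile : Continuous pProfile := by
  unfold pProfile; fun_prop

/-- `Q(t)` is the polynomial for `t ≥ 1`. [folklore] -/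
theorem rhoProfile_eq_of_one_le {t : ℝ} (h : 1 ≤ t) :
    rhoProfile t = (3 * t ^ 5 - 5 * t ^ 3 + 2) / 15 := by
  rw [rhoProfile, max_eq_left h]

/-- `P(t)` is the polynomial for `t ≥ 1`. [folklore] -/
theorem pProfile_eq_of_one_le {t : ℝ} (h : 1 ≤ t) :
    pProfile t = (3 * t ^ 5 - 10 * t ^ 3 + 15 * t - 8) / 60 := by
  rw [pProfile, max_eq_left h]

/-- `Q(t) = 0` for `t ≤ 1` (no matter where `γ ≤ 0`). [cite: Andreasson2021, Lemma 3.3] -/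
theorem rhoProfile_eq_zero_of_le_one {t : ℝ} (h : t ≤ 1) : rhoProfile t = 0 := by
  rw [rhoProfile, max_eq_right h]; norm_num

/-- `P(t) = 0` for `t ≤ 1`. [cite: Andreasson2021, Lemma 3.3] -/
theorem pProfile_eq_zero_of_le_one {t : ℝ} (h : t ≤ 1) : pProfile t = 0 := by
  rw [pProfile, max_eq_right h]; norm_num

/-- Factorised form: `Q(t) = (s-1)²(3s³+6s²+4s+2)/15`. [folklore] -/
theorem rhoProfile_eq_factor (t : ℝ) :
    rhoProfile t = (max t 1 - 1) ^ 2 * (3 * max t 1 ^ 3 + 6 * max t 1 ^ 2 + 4 * max t 1 + 2) / 15 := by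
  rw [rhoProfile]; ring

/-- Factorised form: `P(t) = (s-1)³(3s²+9s+8)/60`. [folklore] -/
theorem pProfile_eq_factor (t : ℝ) :
    pProfile t = (max t 1 - 1) ^ 3 * (3 * max t 1 ^ 2 + 9 * max t 1 + 8) / 60 := by
  rw [pProfile]; ring

/-- `Q ≥ 0`. [folklore] -/
theorem rhoProfile_nonneg (t : ℝ) : 0 ≤ rhoProfile t := by
  rw [rhoProfile_eq_factor]
  have h1 : 1 ≤ max t 1 := le_max_right _ _
  positivity

/-- `P ≥ 0`. [folklore] -/
theorem pProfile_nonneg (t : ℝ) : 0 ≤ pProfile t := by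
  rw [pProfile_eq_factor]
  have h1 : 0 ≤ max t 1 - 1 := by linarith [le_max_right t 1]
  have h2 : 0 ≤ max t 1 := le_trans zero_le_one (le_max_right _ _)
  positivity

/-- Two-sided polynomial bounds: `(s-1)² ≤ Q ≤ (s-1)² s³`. [folklore] -/
theorem sq_le_rhoProfile (t : ℝ) : (max t 1 - 1) ^ 2 ≤ rhoProfile t := by
  rw [rhoProfile_eq_factor]
  have h1 : 1 ≤ max t 1 := le_max_right _ _
  nlinarith [sq_nonneg (max t 1 - 1), pow_le_pow_left₀ zero_le_one h1 2,
    pow_le_pow_left₀ zero_le_one h1 3]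

/-- `Q ≤ (s-1)² s³`. [folklore] -/
theorem rhoProfile_le (t : ℝ) : rhoProfile t ≤ (max t 1 - 1) ^ 2 * max t 1 ^ 3 := by
  rw [rhoProfile_eq_factor]
  have h1 : 1 ≤ max t 1 := le_max_right _ _
  have h3 : 3 * max t 1 ^ 3 + 6 * max t 1 ^ 2 + 4 * max t 1 + 2 ≤ 15 * max t 1 ^ 3 := by
    nlinarith [pow_le_pow_left₀ zero_le_one h1 2, pow_le_pow_left₀ zero_le_one h1 3,
      mul_le_mul_of_nonneg_left h1 (by positivity : (0:ℝ) ≤ max t 1 ^ 2)]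
  nlinarith [sq_nonneg (max t 1 - 1)]

/-- `(s-1)³/3 ≤ P ≤ (s-1)³ s²/3`. [folklore] -/
theorem cube_le_pProfile (t : ℝ) : (max t 1 - 1) ^ 3 / 3 ≤ pProfile t := by
  rw [pProfile_eq_factor]
  have h1 : 1 ≤ max t 1 := le_max_right _ _
  have h0 : 0 ≤ (max t 1 - 1) ^ 3 := by positivity
  nlinarith [pow_le_pow_left₀ zero_le_one h1 2]

/-- `P ≤ (s-1)³ s²/3`. [folklore] -/
theorem pProfile_le (t : ℝ) : pProfile t ≤ (max t 1 - 1) ^ 3 * max t 1 ^ 2 / 3 := by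
  rw [pProfile_eq_factor]
  have h1 : 1 ≤ max t 1 := le_max_right _ _
  have h0 : 0 ≤ (max t 1 - 1) ^ 3 := by positivity
  have h3 : 3 * max t 1 ^ 2 + 9 * max t 1 + 8 ≤ 20 * max t 1 ^ 2 := by
    nlinarith [pow_le_pow_left₀ zero_le_one h1 2]
  nlinarith

/-- `Q` is monotone. [folklore] -/
theorem monotone_rhoProfile : Monotone rhoProfile := by
  intro a b hab
  rw [rhoProfile_eq_factor, rhoProfile_eq_factor]
  have ha : 1 ≤ max a 1 := le_max_right _ _
  have hm : max a 1 ≤ max b 1 := max_le_max hab le_rfl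
  have e1 : (max a 1 - 1) ^ 2 ≤ (max b 1 - 1) ^ 2 := pow_le_pow_left₀ (by linarith) (by linarith) 2
  have e2 : 3 * max a 1 ^ 3 + 6 * max a 1 ^ 2 + 4 * max a 1 + 2 ≤
      3 * max b 1 ^ 3 + 6 * max b 1 ^ 2 + 4 * max b 1 + 2 := by
    nlinarith [pow_le_pow_left₀ (by linarith : (0:ℝ) ≤ max a 1) hm 2,
      pow_le_pow_left₀ (by linarith : (0:ℝ) ≤ max a 1) hm 3]
  have := mul_le_mul e1 e2 (by positivity) (by positivity)
  linarith

/-- `P` is monotone. [folklore] -/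
theorem monotone_pProfile : Monotone pProfile := by
  intro a b hab
  rw [pProfile_eq_factor, pProfile_eq_factor]
  have ha : 1 ≤ max a 1 := le_max_right _ _
  have hm : max a 1 ≤ max b 1 := max_le_max hab le_rfl
  have e1 : (max a 1 - 1) ^ 3 ≤ (max b 1 - 1) ^ 3 := pow_le_pow_left₀ (by linarith) (by linarith) 3
  have e2 : 3 * max a 1 ^ 2 + 9 * max a 1 + 8 ≤ 3 * max b 1 ^ 2 + 9 * max b 1 + 8 := by
    nlinarith [pow_le_pow_left₀ (by linarith : (0:ℝ) ≤ max a 1) hm 2]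
  have h0 : 0 ≤ (max a 1 - 1) ^ 3 := by positivity
  have hb0 : 0 ≤ (max b 1 - 1) ^ 3 := pow_nonneg (by linarith) 3
  have := mul_le_mul e1 e2 (by positivity) hb0
  linarith


/-! ### The closed-form matter functions `ρ̂(r, u)`, `p̂(r, u)` -/

/-- The closed-form energy density `ρ̂_q(r, u) = π² q⁵ r⁻⁴ Q(e^{-u} r / q)` as a function of the
radius `r` and the value `u = μ(r)` of the metric exponent (`q = √L₀`).
[cite: Andreasson2021, §3, display (ρ) after Remark 3.4] -/
def rhoHat (q r u : ℝ) : ℝ := π ^ 2 * q ^ 5 / r ^ 4 * rhoProfile (exp (-u) * r / q)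

/-- The closed-form radial pressure `p̂_q(r, u) = π² q⁵ r⁻⁴ P(e^{-u} r / q)`.
[cite: Andreasson2021, §3, display (p) after Remark 3.4] -/
def pHat (q r u : ℝ) : ℝ := π ^ 2 * q ^ 5 / r ^ 4 * pProfile (exp (-u) * r / q)

section Hat

variable {q : ℝ} (hq : 0 < q)
include hq

/-- `ρ̂ ≥ 0` (`q, r > 0`). [folklore] -/
theorem rhoHat_nonneg {r : ℝ} (hr : 0 < r) (u : ℝ) : 0 ≤ rhoHat q r u := by
  unfold rhoHat
  have := rhoProfile_nonneg (exp (-u) * r / q)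
  positivity

/-- `p̂ ≥ 0` (`q, r > 0`). [folklore] -/
theorem pHat_nonneg {r : ℝ} (hr : 0 < r) (u : ℝ) : 0 ≤ pHat q r u := by
  unfold pHat
  have := pProfile_nonneg (exp (-u) * r / q)
  positivity

/-- `ρ̂` is antitone in `u`. [folklore] -/
theorem rhoHat_antitone {r : ℝ} (hr : 0 < r) : Antitone (rhoHat q r) := by
  intro u v huv
  unfold rhoHat
  refine mul_le_mul_of_nonneg_left (monotone_rhoProfile ?_) (by positivity)
  have : exp (-v) ≤ exp (-u) := exp_le_exp.mpr (by linarith)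
  exact div_le_div_of_nonneg_right (mul_le_mul_of_nonneg_right this hr.le) hq.le

/-- `p̂` is antitone in `u`. [folklore] -/
theorem pHat_antitone {r : ℝ} (hr : 0 < r) : Antitone (pHat q r) := by
  intro u v huv
  unfold pHat
  refine mul_le_mul_of_nonneg_left (monotone_pProfile ?_) (by positivity)
  have : exp (-v) ≤ exp (-u) := exp_le_exp.mpr (by linarith)
  exact div_le_div_of_nonneg_right (mul_le_mul_of_nonneg_right this hr.le) hq.le

/-- Uniform bound on a slab: `ρ̂(r, u) ≤ π² q⁵ R₀⁻⁴ Q(e^{-u₀} R̄/q)` for `R₀ ≤ r ≤ R̄`, `u₀ ≤ u`. [folklore] -/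
theorem rhoHat_le_of_mem {R₀ Rb u₀ r u : ℝ} (hR₀ : 0 < R₀) (hr : r ∈ Icc R₀ Rb) (hu : u₀ ≤ u) :
    rhoHat q r u ≤ π ^ 2 * q ^ 5 / R₀ ^ 4 * rhoProfile (exp (-u₀) * Rb / q) := by
  have hr0 : 0 < r := hR₀.trans_le hr.1
  unfold rhoHat
  refine mul_le_mul ?_ (monotone_rhoProfile ?_) (rhoProfile_nonneg _) (by positivity)
  · gcongr
    exact hr.1
  · have : exp (-u) ≤ exp (-u₀) := exp_le_exp.mpr (by linarith)
    exact div_le_div_of_nonneg_right (mul_le_mul this hr.2 hr0.le (exp_pos _).le) hq.le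

/-- Uniform bound on a slab: `p̂(r, u) ≤ π² q⁵ R₀⁻⁴ P(e^{-u₀} R̄/q)` for `R₀ ≤ r ≤ R̄`, `u₀ ≤ u`.
[folklore] -/
theorem pHat_le_of_mem {R₀ Rb u₀ r u : ℝ} (hR₀ : 0 < R₀) (hr : r ∈ Icc R₀ Rb) (hu : u₀ ≤ u) :
    pHat q r u ≤ π ^ 2 * q ^ 5 / R₀ ^ 4 * pProfile (exp (-u₀) * Rb / q) := by
  have hr0 : 0 < r := hR₀.trans_le hr.1
  unfold pHat
  refine mul_le_mul ?_ (monotone_pProfile ?_) (pProfile_nonneg _) (by positivity)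
  · gcongr
    exact hr.1
  · have : exp (-u) ≤ exp (-u₀) := exp_le_exp.mpr (by linarith)
    exact div_le_div_of_nonneg_right (mul_le_mul this hr.2 hr0.le (exp_pos _).le) hq.le

omit hq in
/-- Joint continuity of `ρ̂` on `r > 0`. [folklore] -/
theorem continuousOn_rhoHat : ContinuousOn (fun p : ℝ × ℝ => rhoHat q p.1 p.2) (Ioi 0 ×ˢ univ) := by
  unfold rhoHat
  refine ContinuousOn.mul ?_ ?_
  · refine ContinuousOn.div continuousOn_const (by fun_prop) fun p hp => ?_
    exact pow_ne_zero 4 (ne_of_gt (show (0:ℝ) < p.1 from hp.1))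
  · exact (continuous_rhoProfile.comp (by fun_prop)).continuousOn

omit hq in
/-- Joint continuity of `p̂` on `r > 0`. [folklore] -/
theorem continuousOn_pHat : ContinuousOn (fun p : ℝ × ℝ => pHat q p.1 p.2) (Ioi 0 ×ˢ univ) := by
  unfold pHat
  refine ContinuousOn.mul ?_ ?_
  · refine ContinuousOn.div continuousOn_const (by fun_prop) fun p hp => ?_
    exact pow_ne_zero 4 (ne_of_gt (show (0:ℝ) < p.1 from hp.1))
  · exact (continuous_pProfile.comp (by fun_prop)).continuousOn

end Hat


/-! ### One-dimensional integrals -/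

/-- `∫_{-1}^{1} x²√(1-x²) dx = π/8`. [folklore] -/
theorem integral_sq_mul_sqrt_one_sub_sq :
    ∫ x in (-1 : ℝ)..1, x ^ 2 * √(1 - x ^ 2) = π / 8 := by
  have hderiv : ∀ y ∈ Ioo (-1 : ℝ) 1,
      HasDerivAt (fun y : ℝ => (y * (2 * y ^ 2 - 1) * √(1 - y ^ 2) + arcsin y) / 8)
        (y ^ 2 * √(1 - y ^ 2)) y := by
    intro y hy
    have hs : 0 < 1 - y ^ 2 := by nlinarith [hy.1, hy.2]
    have hd : HasDerivAt (fun y : ℝ => 1 - y ^ 2) (-(2 * y)) y := by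
      simpa using (hasDerivAt_pow 2 y).const_sub 1
    have hp : HasDerivAt (fun y : ℝ => y * (2 * y ^ 2 - 1)) (1 * (2 * y ^ 2 - 1) + y * (2 * (2 * y))) y := by
      have h2 : HasDerivAt (fun y : ℝ => 2 * y ^ 2 - 1) (2 * (2 * y)) y := by
        simpa using ((hasDerivAt_pow 2 y).const_mul 2).sub_const 1
      exact (hasDerivAt_id' y).mul h2
    have key := ((hp.mul (hd.sqrt hs.ne')).add
      (hasDerivAt_arcsin (by linarith [hy.1]) (by linarith [hy.2]))).div_const 8
    refine key.congr_deriv ?_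
    have hsq := sq_sqrt hs.le
    have hne : √(1 - y ^ 2) ≠ 0 := (sqrt_pos.mpr hs).ne'
    field_simp
    linear_combination (-2 * y ^ 2 - 1) * hsq
  have hcont : ContinuousOn
      (fun y : ℝ => (y * (2 * y ^ 2 - 1) * √(1 - y ^ 2) + arcsin y) / 8) (Icc (-1) 1) :=
    Continuous.continuousOn (by fun_prop)
  have hint : IntervalIntegrable (fun y : ℝ => y ^ 2 * √(1 - y ^ 2)) volume (-1) 1 :=
    Continuous.intervalIntegrable (by fun_prop) _ _
  rw [integral_eq_sub_of_hasDerivAt_of_le (by norm_num) hcont hderiv hint]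
  simp only [one_pow, sub_self, Real.sqrt_zero, mul_zero, zero_add, arcsin_one, even_two,
    Even.neg_pow, arcsin_neg]
  ring

/-- The support of `√(1 - y²)`-type functions. [folklore] -/
theorem sqrt_one_sub_sq_eq_zero {y : ℝ} (hy : y ∉ Ioc (-1 : ℝ) 1) : √(1 - y ^ 2) = 0 := by
  rw [mem_Ioc, not_and_or, not_lt, not_le] at hy
  apply Real.sqrt_eq_zero'.mpr
  rcases hy with h | h <;> nlinarith

/-- Scaling: `∫_{-1}^{1} √(B - k²x²) dx = π max B 0 / (2k)` for `0 < k`, `B ≤ k²`. [folklore] -/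
theorem integral_sqrt_sub_sq_mul_sq {B k : ℝ} (hk : 0 < k) (hB : B ≤ k ^ 2) :
    ∫ x in (-1 : ℝ)..1, √(B - k ^ 2 * x ^ 2) = π * max B 0 / (2 * k) := by
  rcases le_or_gt B 0 with hB0 | hB0
  · rw [max_eq_right hB0, mul_zero, zero_div]
    rw [intervalIntegral.integral_congr (g := fun _ => (0 : ℝ)) fun x _ => ?_]
    · simp
    · simp only
      exact Real.sqrt_eq_zero'.mpr (by nlinarith [sq_nonneg x])
  rw [max_eq_left hB0.le]
  set K : ℝ := k / √B with hK
  have hsB : 0 < √B := Real.sqrt_pos.mpr hB0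
  have hK0 : 0 < K := div_pos hk hsB
  have hK1 : 1 ≤ K := by
    rw [hK, le_div_iff₀ hsB, one_mul]
    calc √B ≤ √(k ^ 2) := Real.sqrt_le_sqrt hB
      _ = k := Real.sqrt_sq hk.le
  have hpt : ∀ x : ℝ, √(B - k ^ 2 * x ^ 2) = √B * √(1 - (K * x) ^ 2) := by
    intro x
    rw [← Real.sqrt_mul hB0.le]
    congr 1
    rw [hK]
    field_simp
    rw [sq_sqrt hB0.le]
    ring
  simp_rw [hpt]
  rw [intervalIntegral.integral_const_mul,
    intervalIntegral.integral_comp_mul_left (fun y => √(1 - y ^ 2)) hK0.ne']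
  have hsupp : Function.support (fun y : ℝ => √(1 - y ^ 2)) ⊆ Ioc (-1 : ℝ) 1 := by
    intro y hy
    by_contra h
    exact hy (sqrt_one_sub_sq_eq_zero h)
  have h1 : ∫ y in K * (-1 : ℝ)..K * 1, √(1 - y ^ 2) = ∫ y in (-1 : ℝ)..1, √(1 - y ^ 2) := by
    rw [integral_eq_integral_of_support_subset (hsupp.trans (Ioc_subset_Ioc (by linarith)
      (by linarith))), integral_eq_integral_of_support_subset hsupp]
  have hKi : K⁻¹ = √B / k := by rw [hK, inv_div]
  rw [h1, integral_sqrt_one_sub_sq, smul_eq_mul, hKi]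
  calc √B * (√B / k * (π / 2)) = (√B * √B) / k * (π / 2) := by ring
    _ = π * B / (2 * k) := by rw [Real.mul_self_sqrt hB0.le]; ring

/-- Scaling: `∫_{-1}^{1} x²√(B - k²x²) dx = π (max B 0)² / (8k³)` for `0 < k`, `B ≤ k²`. [folklore] -/
theorem integral_sq_mul_sqrt_sub_sq_mul_sq {B k : ℝ} (hk : 0 < k) (hB : B ≤ k ^ 2) :
    ∫ x in (-1 : ℝ)..1, x ^ 2 * √(B - k ^ 2 * x ^ 2) = π * (max B 0) ^ 2 / (8 * k ^ 3) := by
  rcases le_or_gt B 0 with hB0 | hB0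
  · rw [max_eq_right hB0]
    rw [intervalIntegral.integral_congr (g := fun _ => (0 : ℝ)) fun x _ => ?_]
    · simp
    · simp only
      rw [Real.sqrt_eq_zero'.mpr (by nlinarith [sq_nonneg x]), mul_zero]
  rw [max_eq_left hB0.le]
  set K : ℝ := k / √B with hK
  have hsB : 0 < √B := Real.sqrt_pos.mpr hB0
  have hK0 : 0 < K := div_pos hk hsB
  have hK1 : 1 ≤ K := by
    rw [hK, le_div_iff₀ hsB, one_mul]
    calc √B ≤ √(k ^ 2) := Real.sqrt_le_sqrt hB
      _ = k := Real.sqrt_sq hk.le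
  have hpt : ∀ x : ℝ, x ^ 2 * √(B - k ^ 2 * x ^ 2) =
      √B / K ^ 2 * ((K * x) ^ 2 * √(1 - (K * x) ^ 2)) := by
    intro x
    have : √(B - k ^ 2 * x ^ 2) = √B * √(1 - (K * x) ^ 2) := by
      rw [← Real.sqrt_mul hB0.le]
      congr 1
      rw [hK]
      field_simp
      rw [sq_sqrt hB0.le]
      ring
    rw [this]
    field_simp
  simp_rw [hpt]
  rw [intervalIntegral.integral_const_mul,
    intervalIntegral.integral_comp_mul_left (fun y => y ^ 2 * √(1 - y ^ 2)) hK0.ne']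
  have hsupp : Function.support (fun y : ℝ => y ^ 2 * √(1 - y ^ 2)) ⊆ Ioc (-1 : ℝ) 1 := by
    intro y hy
    by_contra h
    exact hy (by simp only [sqrt_one_sub_sq_eq_zero h, mul_zero])
  have h1 : ∫ y in K * (-1 : ℝ)..K * 1, y ^ 2 * √(1 - y ^ 2) =
      ∫ y in (-1 : ℝ)..1, y ^ 2 * √(1 - y ^ 2) := by
    rw [integral_eq_integral_of_support_subset (hsupp.trans (Ioc_subset_Ioc (by linarith)
      (by linarith))), integral_eq_integral_of_support_subset hsupp]
  rw [h1, integral_sq_mul_sqrt_one_sub_sq, smul_eq_mul, hK]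
  have hb : B = √B * √B := (Real.mul_self_sqrt hB0.le).symm
  generalize hs : √B = b at hb hsB ⊢
  have hb0 : b ≠ 0 := hsB.ne'
  rw [hb]
  field_simp

/-- The `θ`-integrals: `∫_{0}^{π} sin θ F(cos θ) dθ = ∫_{-1}^{1} F`. [folklore] -/
theorem integral_sin_mul_comp_cos {F : ℝ → ℝ} (hF : Continuous F) :
    ∫ θ in (0 : ℝ)..π, sin θ * F (cos θ) = ∫ x in (-1 : ℝ)..1, F x := by
  have h := integral_comp_mul_deriv (a := 0) (b := π) (f := cos) (f' := fun θ => -sin θ)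
    (g := F) (fun θ _ => hasDerivAt_cos θ) (by fun_prop) hF
  simp only [Function.comp, cos_zero, cos_pi] at h
  have h2 : ∫ x in (0 : ℝ)..π, F (cos x) * -sin x = -∫ θ in (0 : ℝ)..π, sin θ * F (cos θ) := by
    rw [← intervalIntegral.integral_neg]
    congr 1
    funext θ
    ring
  rw [integral_symm (-1) 1] at h
  linarith [h, h2]



/-! ### The momentum change of variables -/

/-- Momentum coordinates `(s, θ) ↦ (w, L) = (s cos θ, r² s² sin² θ)` (so that `ε = s`). [folklore] -/
def momentumCoord (r : ℝ) (p : ℝ × ℝ) : ℝ × ℝ := (p.1 * cos p.2, r ^ 2 * p.1 ^ 2 * sin p.2 ^ 2)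

/-- The derivative of `momentumCoord r` as a `2 × 2` matrix. [folklore] -/
def fderivMomentumCoord (r : ℝ) (p : ℝ × ℝ) : ℝ × ℝ →L[ℝ] ℝ × ℝ :=
  (Matrix.toLin (.finTwoProd ℝ) (.finTwoProd ℝ)
    !![cos p.2, -p.1 * sin p.2;
       2 * r ^ 2 * p.1 * sin p.2 ^ 2, 2 * r ^ 2 * p.1 ^ 2 * sin p.2 * cos p.2]).toContinuousLinearMap

/-- The Jacobian determinant `2 r² s² sin θ`. [folklore] -/
theorem det_fderivMomentumCoord (r : ℝ) (p : ℝ × ℝ) :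
    (fderivMomentumCoord r p).det = 2 * r ^ 2 * p.1 ^ 2 * sin p.2 := by
  conv_rhs => rw [← mul_one (2 * r ^ 2 * p.1 ^ 2 * sin p.2), ← cos_sq_add_sin_sq p.2]
  unfold fderivMomentumCoord
  simp only [LinearMap.det_toContinuousLinearMap, LinearMap.det_toLin, Matrix.det_fin_two_of]
  ring

/-- `momentumCoord r` has derivative `fderivMomentumCoord r p` at `p`. [folklore] -/
theorem hasFDerivAt_momentumCoord (r : ℝ) (p : ℝ × ℝ) :
    HasFDerivAt (momentumCoord r) (fderivMomentumCoord r p) p := by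
  have h1 := (hasFDerivAt_fst (𝕜 := ℝ) (p := p)).mul
    ((hasDerivAt_cos p.2).comp_hasFDerivAt p (hasFDerivAt_snd (𝕜 := ℝ)))
  have h2 := (((hasFDerivAt_fst (𝕜 := ℝ) (p := p)).pow 2).const_mul (r ^ 2)).mul
    (((hasDerivAt_sin p.2).comp_hasFDerivAt p (hasFDerivAt_snd (𝕜 := ℝ))).pow 2)
  refine (h1.prodMk h2).congr_fderiv ?_
  unfold fderivMomentumCoord
  rw [Matrix.toLin_finTwoProd_toContinuousLinearMap]
  refine ContinuousLinearMap.ext fun v => ?_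
  simp only [ContinuousLinearMap.prod_apply, Prod.mk.injEq]
  constructor
  · simp; ring
  · simp; ring

/-- `ε(r, s cos θ, r² s² sin² θ) = s` for `s ≥ 0`, `r ≠ 0`. [folklore] -/
theorem energy_momentumCoord {r : ℝ} (hr : r ≠ 0) {p : ℝ × ℝ} (hs : 0 ≤ p.1) :
    energy r (momentumCoord r p).1 (momentumCoord r p).2 = p.1 := by
  unfold energy momentumCoord
  simp only
  have : (p.1 * cos p.2) ^ 2 + r ^ 2 * p.1 ^ 2 * sin p.2 ^ 2 / r ^ 2 = p.1 ^ 2 := by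
    field_simp
    linear_combination p.1 ^ 2 * cos_sq_add_sin_sq p.2
  rw [this, Real.sqrt_sq hs]

/-- The coordinate domain `(0, ∞) × (0, π)`. [folklore] -/
theorem measurableSet_Ioi_prod_Ioo : MeasurableSet (Ioi (0 : ℝ) ×ˢ Ioo (0 : ℝ) π) :=
  measurableSet_Ioi.prod measurableSet_Ioo

/-- `momentumCoord r` is injective on `(0, ∞) × (0, π)` (`r ≠ 0`). [folklore] -/
theorem injOn_momentumCoord {r : ℝ} (hr : r ≠ 0) :
    InjOn (momentumCoord r) (Ioi (0 : ℝ) ×ˢ Ioo (0 : ℝ) π) := by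
  rintro ⟨s, θ⟩ ⟨hs, hθ⟩ ⟨s', θ'⟩ ⟨hs', hθ'⟩ h
  simp only [momentumCoord, Prod.mk.injEq, mem_Ioi, mem_Ioo] at h hs hs' hθ hθ'
  obtain ⟨h1, h2⟩ := h
  have h2' : s ^ 2 * sin θ ^ 2 = s' ^ 2 * sin θ' ^ 2 :=
    mul_left_cancel₀ (pow_ne_zero 2 hr)
      (by linear_combination h2 : r ^ 2 * (s ^ 2 * sin θ ^ 2) = r ^ 2 * (s' ^ 2 * sin θ' ^ 2))
  have hss : s ^ 2 = s' ^ 2 := by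
    have e1 : s ^ 2 = (s * cos θ) ^ 2 + s ^ 2 * sin θ ^ 2 := by
      linear_combination -(s ^ 2 * cos_sq_add_sin_sq θ)
    have e2 : s' ^ 2 = (s' * cos θ') ^ 2 + s' ^ 2 * sin θ' ^ 2 := by
      linear_combination -(s' ^ 2 * cos_sq_add_sin_sq θ')
    rw [e1, e2, h1, h2']
  have hs_eq : s = s' := by
    have := (sq_eq_sq₀ hs.le hs'.le).mp hss
    exact this
  subst hs_eq
  have hcos : cos θ = cos θ' := mul_left_cancel₀ hs.ne' h1
  have hθeq : θ = θ' := injOn_cos ⟨hθ.1.le, hθ.2.le⟩ ⟨hθ'.1.le, hθ'.2.le⟩ hcos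
  rw [hθeq]

/-- The image of `(0, ∞) × (0, π)` under `momentumCoord r` is momentum space `ℝ × (0, ∞)`. [folklore] -/
theorem image_momentumCoord {r : ℝ} (hr : r ≠ 0) :
    momentumCoord r '' (Ioi (0 : ℝ) ×ˢ Ioo (0 : ℝ) π) = momentumSpace := by
  ext ⟨w, L⟩
  simp only [mem_image, mem_prod, mem_Ioi, mem_Ioo, momentumSpace, mem_univ, true_and,
    Prod.exists, momentumCoord, Prod.mk.injEq]
  constructor
  · rintro ⟨s, θ, ⟨hs, hθ1, hθ2⟩, -, rfl⟩
    have hsin : 0 < sin θ := sin_pos_of_pos_of_lt_pi hθ1 hθ2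
    positivity
  · intro hL
    have hr2 : 0 < r ^ 2 := by positivity
    set s : ℝ := √(w ^ 2 + L / r ^ 2) with hs_def
    have hq : 0 < w ^ 2 + L / r ^ 2 := by positivity
    have hs : 0 < s := Real.sqrt_pos.mpr hq
    have hs2 : s ^ 2 = w ^ 2 + L / r ^ 2 := Real.sq_sqrt hq.le
    have hws : (w / s) ^ 2 < 1 := by
      rw [div_pow, div_lt_one (by positivity), hs2]
      linarith [div_pos hL hr2]
    have hw1 : -1 < w / s := by nlinarith [abs_lt.mp (sq_lt_one_iff_abs_lt_one _ |>.mp hws)]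
    have hw2 : w / s < 1 := (abs_lt.mp (sq_lt_one_iff_abs_lt_one _ |>.mp hws)).2
    refine ⟨s, arccos (w / s), ⟨hs, arccos_pos.mpr hw2, arccos_lt_pi.mpr hw1⟩, ?_, ?_⟩
    · rw [cos_arccos hw1.le hw2.le]; field_simp
    · rw [sin_arccos, Real.sq_sqrt (show (0 : ℝ) ≤ 1 - (w / s) ^ 2 by nlinarith)]
      have hs0 : s ≠ 0 := hs.ne'
      have e : r ^ 2 * s ^ 2 * (1 - (w / s) ^ 2) = r ^ 2 * s ^ 2 - r ^ 2 * w ^ 2 := by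
        field_simp
      rw [e, hs2]
      field_simp
      ring


/-! ### The change of variables and Fubini -/

section CoV

variable {r : ℝ}

/-- Change of variables to momentum coordinates for an arbitrary integrand. [folklore] -/
theorem setIntegral_momentumSpace_eq_momentumCoord (hr : r ≠ 0) (g : ℝ × ℝ → ℝ) :
    ∫ z in momentumSpace, g z =
      ∫ p in Ioi (0 : ℝ) ×ˢ Ioo (0 : ℝ) π, |2 * r ^ 2 * p.1 ^ 2 * sin p.2| * g (momentumCoord r p) := by
  rw [← image_momentumCoord hr, integral_image_eq_integral_abs_det_fderiv_smul volume
    measurableSet_Ioi_prod_Ioo (fun p _ => (hasFDerivAt_momentumCoord r p).hasFDerivWithinAt)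
    (injOn_momentumCoord hr)]
  refine setIntegral_congr_fun measurableSet_Ioi_prod_Ioo fun p _ => ?_
  rw [det_fderivMomentumCoord, smul_eq_mul]

/-- Transfer of integrability under the change of variables. [folklore] -/
theorem integrableOn_momentumCoord_of_integrableOn (hr : r ≠ 0) {g : ℝ × ℝ → ℝ}
    (hg : IntegrableOn g momentumSpace) :
    IntegrableOn (fun p : ℝ × ℝ => |2 * r ^ 2 * p.1 ^ 2 * sin p.2| * g (momentumCoord r p))
      (Ioi (0 : ℝ) ×ˢ Ioo (0 : ℝ) π) := by
  rw [← image_momentumCoord hr, integrableOn_image_iff_integrableOn_abs_det_fderiv_smul volume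
    measurableSet_Ioi_prod_Ioo (fun p _ => (hasFDerivAt_momentumCoord r p).hasFDerivWithinAt)
    (injOn_momentumCoord hr)] at hg
  refine hg.congr_fun (fun p _ => ?_) measurableSet_Ioi_prod_Ioo
  simp only [det_fderivMomentumCoord, smul_eq_mul]

/-- Fubini on the coordinate rectangle `(0, ∞) × (0, π)`. [folklore] -/
theorem setIntegral_Ioi_prod_Ioo {F : ℝ × ℝ → ℝ} (hF : IntegrableOn F (Ioi (0 : ℝ) ×ˢ Ioo (0 : ℝ) π)) :
    ∫ p in Ioi (0 : ℝ) ×ˢ Ioo (0 : ℝ) π, F p = ∫ s in Ioi (0 : ℝ), ∫ θ in Ioo (0 : ℝ) π, F (s, θ) := by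
  rw [IntegrableOn, Measure.volume_eq_prod, ← Measure.prod_restrict] at hF
  rw [Measure.volume_eq_prod, ← Measure.prod_restrict, integral_prod _ hF]

end CoV

/-! ### The closed forms for `k = 0`, `l = 1/2`, `E₀ = 1` -/

section ClosedForm

variable {L₀ r : ℝ}

/-- `x₊^{1/2} = √x`. [folklore] -/
theorem cutPow_half (x : ℝ) : cutPow (1 / 2) x = √x := by
  unfold cutPow
  split_ifs with h
  · rw [Real.sqrt_eq_rpow]
  · exact (Real.sqrt_eq_zero'.mpr (not_lt.mp h)).symm

/-- `x₊^0 = 𝟙(x > 0)`. [folklore] -/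
theorem cutPow_zero (x : ℝ) : cutPow 0 x = if 0 < x then 1 else 0 := by
  unfold cutPow
  split_ifs <;> simp

/-- The `θ`-integral of the energy density. [folklore] -/
theorem integral_sin_mul_sqrt (hr : 0 < r) {s : ℝ} (hs : 0 < s) (L₀ : ℝ) (hL₀ : 0 ≤ L₀) :
    ∫ θ in Ioo (0 : ℝ) π, sin θ * √(r ^ 2 * s ^ 2 * sin θ ^ 2 - L₀) =
      π * max (r ^ 2 * s ^ 2 - L₀) 0 / (2 * (r * s)) := by
  rw [← integral_Ioc_eq_integral_Ioo, ← intervalIntegral.integral_of_le Real.pi_pos.le]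
  have h := integral_sin_mul_comp_cos
    (F := fun x => √((r ^ 2 * s ^ 2 - L₀) - (r * s) ^ 2 * x ^ 2)) (by fun_prop)
  rw [integral_sqrt_sub_sq_mul_sq (mul_pos hr hs) (by nlinarith)] at h
  rw [← h]
  refine intervalIntegral.integral_congr fun θ _ => ?_
  congr 2
  rw [sin_sq]
  ring

/-- The `θ`-integral of the radial pressure. [folklore] -/
theorem integral_sin_mul_sq_mul_sqrt (hr : 0 < r) {s : ℝ} (hs : 0 < s) (L₀ : ℝ) (hL₀ : 0 ≤ L₀) :
    ∫ θ in Ioo (0 : ℝ) π, sin θ * (cos θ ^ 2 * √(r ^ 2 * s ^ 2 * sin θ ^ 2 - L₀)) =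
      π * (max (r ^ 2 * s ^ 2 - L₀) 0) ^ 2 / (8 * (r * s) ^ 3) := by
  rw [← integral_Ioc_eq_integral_Ioo, ← intervalIntegral.integral_of_le Real.pi_pos.le]
  have h := integral_sin_mul_comp_cos
    (F := fun x => x ^ 2 * √((r ^ 2 * s ^ 2 - L₀) - (r * s) ^ 2 * x ^ 2)) (by fun_prop)
  rw [integral_sq_mul_sqrt_sub_sq_mul_sq (mul_pos hr hs) (by nlinarith)] at h
  rw [← h]
  refine intervalIntegral.integral_congr fun θ _ => ?_
  congr 3
  rw [sin_sq]
  ring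


/-- `e^{c} s < 1 ↔ s < e^{-c}`. [folklore] -/
theorem exp_mul_lt_one_iff (c s : ℝ) : exp c * s < 1 ↔ s < exp (-c) := by
  rw [Real.exp_neg, inv_eq_one_div, lt_div_iff₀ (exp_pos _), mul_comm]

/-- `√L₀ / r < s ↔ L₀ < r² s²` for `r, s > 0`. [folklore] -/
theorem sqrt_div_lt_iff (hr : 0 < r) {s : ℝ} (hs : 0 < s) (hL₀ : 0 ≤ L₀) :
    √L₀ / r < s ↔ L₀ < r ^ 2 * s ^ 2 := by
  rw [div_lt_iff₀ hr, show r ^ 2 * s ^ 2 = (s * r) ^ 2 by ring]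
  constructor
  · intro h
    calc L₀ = √L₀ ^ 2 := (Real.sq_sqrt hL₀).symm
      _ < (s * r) ^ 2 := by gcongr
  · intro h
    calc √L₀ < √((s * r) ^ 2) := Real.sqrt_lt_sqrt hL₀ h
      _ = s * r := Real.sqrt_sq (by positivity)

/-- `Ioo v (max v a) = Ioo v a`. [folklore] -/
theorem Ioo_max_eq (v a : ℝ) : Ioo v (max v a) = Ioo v a := by
  rcases le_total a v with h | h
  · rw [max_eq_left h, Ioo_self, Ioo_eq_empty (not_lt.mpr h)]
  · rw [max_eq_right h]

/-- The radial reduction: the outer integral over `s > 0` of the cut-off radial integrand is an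
interval integral over `(√L₀/r, e^{-μ})`. [folklore] -/
theorem setIntegral_Ioi_radial (hr : 0 < r) (hL₀ : 0 ≤ L₀) (c : ℝ) (h : ℝ → ℝ) :
    ∫ s in Ioi (0 : ℝ), (if exp c * s < 1 then (1 : ℝ) else 0) * (max (r ^ 2 * s ^ 2 - L₀) 0 * h s) =
      ∫ s in √L₀ / r..max (√L₀ / r) (exp (-c)), (r ^ 2 * s ^ 2 - L₀) * h s := by
  have hv0 : 0 ≤ √L₀ / r := div_nonneg (Real.sqrt_nonneg _) hr.le
  have hpt : EqOn (fun s => (if exp c * s < 1 then (1 : ℝ) else 0) * (max (r ^ 2 * s ^ 2 - L₀) 0 * h s))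
      ((Ioo (√L₀ / r) (exp (-c))).indicator fun s => (r ^ 2 * s ^ 2 - L₀) * h s) (Ioi 0) := by
    intro s hs
    simp only [mem_Ioi] at hs
    by_cases h1 : √L₀ / r < s
    · have hB : 0 < r ^ 2 * s ^ 2 - L₀ := by linarith [(sqrt_div_lt_iff hr hs hL₀).mp h1]
      by_cases h2 : exp c * s < 1
      · have hs2 : s < exp (-c) := (exp_mul_lt_one_iff c s).mp h2
        simp only [h2, if_true, one_mul, max_eq_left hB.le, indicator_of_mem (mem_Ioo.mpr ⟨h1, hs2⟩)]
      · have hs2 : ¬ s < exp (-c) := fun h' => h2 ((exp_mul_lt_one_iff c s).mpr h')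
        simp only [h2, if_false, zero_mul, indicator_of_notMem (fun h' : s ∈ Ioo _ _ => hs2 h'.2)]
    · have hB : r ^ 2 * s ^ 2 - L₀ ≤ 0 := by
        have := (sqrt_div_lt_iff hr hs hL₀).not.mp h1
        linarith [not_lt.mp this]
      simp only [max_eq_right hB, zero_mul, mul_zero,
        indicator_of_notMem (fun h' : s ∈ Ioo _ _ => h1 h'.1)]
  rw [setIntegral_congr_fun measurableSet_Ioi hpt, setIntegral_indicator measurableSet_Ioo,
    inter_eq_right.mpr (Ioo_subset_Ioi_self.trans (Ioi_subset_Ioi hv0)), ← Ioo_max_eq,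
    ← integral_Ioc_eq_integral_Ioo, ← intervalIntegral.integral_of_le (le_max_left _ _)]

/-- **The energy-density integral in closed form** (radial reduction). [folklore] -/
theorem setIntegral_energy_mul_phaseDensity_zero_half (hL₀ : 0 < L₀) (hr : 0 < r) (μ : ℝ → ℝ) :
    ∫ z in momentumSpace, energy r z.1 z.2 *
        phaseDensity (polytropicAnsatz 1 L₀ 0 (1 / 2)) μ r z.1 z.2 =
      π * r * ∫ s in √L₀ / r..max (√L₀ / r) (exp (-μ r)), s ^ 2 * (r ^ 2 * s ^ 2 - L₀) := by
  rw [setIntegral_momentumSpace_eq_momentumCoord hr.ne']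
  set G : ℝ × ℝ → ℝ := fun p => (2 * r ^ 2 * p.1 ^ 3 * (if exp (μ r) * p.1 < 1 then (1 : ℝ) else 0)) *
    (sin p.2 * √(r ^ 2 * p.1 ^ 2 * sin p.2 ^ 2 - L₀)) with hG
  have hpt : EqOn (fun p : ℝ × ℝ => |2 * r ^ 2 * p.1 ^ 2 * sin p.2| *
      (fun z : ℝ × ℝ => energy r z.1 z.2 * phaseDensity (polytropicAnsatz 1 L₀ 0 (1 / 2)) μ r z.1 z.2)
        (momentumCoord r p)) G (Ioi (0 : ℝ) ×ˢ Ioo (0 : ℝ) π) := by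
    rintro ⟨s, θ⟩ ⟨hs, hθ⟩
    simp only [mem_Ioi, mem_Ioo] at hs hθ
    have hsin : 0 < sin θ := sin_pos_of_pos_of_lt_pi hθ.1 hθ.2
    simp only [hG, phaseDensity, polytropicAnsatz]
    rw [energy_momentumCoord hr.ne' (p := (s, θ)) hs.le, abs_of_pos (by positivity)]
    simp only [momentumCoord, cutPow_zero, cutPow_half, sub_pos]
    ring
  have hint : IntegrableOn G (Ioi (0 : ℝ) ×ˢ Ioo (0 : ℝ) π) :=
    (integrableOn_momentumCoord_of_integrableOn hr.ne'
      (integrableOn_energy_mul_phaseDensity one_pos hL₀ le_rfl (by norm_num) μ hr)).congr_fun hpt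
      measurableSet_Ioi_prod_Ioo
  rw [setIntegral_congr_fun measurableSet_Ioi_prod_Ioo hpt, setIntegral_Ioi_prod_Ioo hint]
  have hinner : EqOn (fun s => ∫ θ in Ioo (0 : ℝ) π, G (s, θ))
      (fun s => (if exp (μ r) * s < 1 then (1 : ℝ) else 0) *
        (max (r ^ 2 * s ^ 2 - L₀) 0 * (π * r * s ^ 2))) (Ioi 0) := by
    intro s hs
    simp only [mem_Ioi] at hs
    show ∫ θ in Ioo (0 : ℝ) π, (2 * r ^ 2 * s ^ 3 * (if exp (μ r) * s < 1 then (1 : ℝ) else 0)) *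
        (sin θ * √(r ^ 2 * s ^ 2 * sin θ ^ 2 - L₀)) = _
    rw [MeasureTheory.integral_const_mul, integral_sin_mul_sqrt hr hs L₀ hL₀.le]
    field_simp
  rw [setIntegral_congr_fun measurableSet_Ioi hinner, setIntegral_Ioi_radial hr hL₀.le,
    ← intervalIntegral.integral_const_mul]
  refine intervalIntegral.integral_congr fun s _ => ?_
  ring

/-- **The radial-pressure integral in closed form** (radial reduction). [folklore] -/
theorem setIntegral_sq_div_energy_mul_phaseDensity_zero_half (hL₀ : 0 < L₀) (hr : 0 < r)
    (μ : ℝ → ℝ) :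
    ∫ z in momentumSpace, z.1 ^ 2 / energy r z.1 z.2 *
        phaseDensity (polytropicAnsatz 1 L₀ 0 (1 / 2)) μ r z.1 z.2 =
      π / (4 * r) * ∫ s in √L₀ / r..max (√L₀ / r) (exp (-μ r)), (r ^ 2 * s ^ 2 - L₀) ^ 2 := by
  rw [setIntegral_momentumSpace_eq_momentumCoord hr.ne']
  set G : ℝ × ℝ → ℝ := fun p => (2 * r ^ 2 * p.1 ^ 3 * (if exp (μ r) * p.1 < 1 then (1 : ℝ) else 0)) *
    (sin p.2 * (cos p.2 ^ 2 * √(r ^ 2 * p.1 ^ 2 * sin p.2 ^ 2 - L₀))) with hG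
  have hpt : EqOn (fun p : ℝ × ℝ => |2 * r ^ 2 * p.1 ^ 2 * sin p.2| *
      (fun z : ℝ × ℝ => z.1 ^ 2 / energy r z.1 z.2 *
        phaseDensity (polytropicAnsatz 1 L₀ 0 (1 / 2)) μ r z.1 z.2) (momentumCoord r p)) G
      (Ioi (0 : ℝ) ×ˢ Ioo (0 : ℝ) π) := by
    rintro ⟨s, θ⟩ ⟨hs, hθ⟩
    simp only [mem_Ioi, mem_Ioo] at hs hθ
    have hsin : 0 < sin θ := sin_pos_of_pos_of_lt_pi hθ.1 hθ.2
    simp only [hG, phaseDensity, polytropicAnsatz]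
    rw [energy_momentumCoord hr.ne' (p := (s, θ)) hs.le, abs_of_pos (by positivity)]
    simp only [momentumCoord, cutPow_zero, cutPow_half, sub_pos]
    field_simp
  have hint : IntegrableOn G (Ioi (0 : ℝ) ×ˢ Ioo (0 : ℝ) π) :=
    (integrableOn_momentumCoord_of_integrableOn hr.ne'
      (integrableOn_sq_div_mul_phaseDensity one_pos hL₀ le_rfl (by norm_num) μ hr)).congr_fun hpt
      measurableSet_Ioi_prod_Ioo
  rw [setIntegral_congr_fun measurableSet_Ioi_prod_Ioo hpt, setIntegral_Ioi_prod_Ioo hint]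
  have hinner : EqOn (fun s => ∫ θ in Ioo (0 : ℝ) π, G (s, θ))
      (fun s => (if exp (μ r) * s < 1 then (1 : ℝ) else 0) *
        (max (r ^ 2 * s ^ 2 - L₀) 0 * (π / (4 * r) * max (r ^ 2 * s ^ 2 - L₀) 0))) (Ioi 0) := by
    intro s hs
    simp only [mem_Ioi] at hs
    show ∫ θ in Ioo (0 : ℝ) π, (2 * r ^ 2 * s ^ 3 * (if exp (μ r) * s < 1 then (1 : ℝ) else 0)) *
        (sin θ * (cos θ ^ 2 * √(r ^ 2 * s ^ 2 * sin θ ^ 2 - L₀))) = _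
    rw [MeasureTheory.integral_const_mul, integral_sin_mul_sq_mul_sqrt hr hs L₀ hL₀.le]
    field_simp
    ring
  rw [setIntegral_congr_fun measurableSet_Ioi hinner, setIntegral_Ioi_radial hr hL₀.le,
    ← intervalIntegral.integral_const_mul]
  refine intervalIntegral.integral_congr fun s hs => ?_
  have hs' : √L₀ / r ≤ s := by
    rw [uIcc_of_le (le_max_left _ _)] at hs
    exact hs.1
  have hB : 0 ≤ r ^ 2 * s ^ 2 - L₀ := by
    rcases hs'.eq_or_lt with h | h
    · rw [← h, div_pow, mul_div_cancel₀ _ (pow_ne_zero 2 hr.ne'), Real.sq_sqrt hL₀.le, sub_self]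
    · linarith [(sqrt_div_lt_iff hr (lt_of_le_of_lt (div_nonneg (Real.sqrt_nonneg _) hr.le) h)
        hL₀.le).mp h]
  simp only [max_eq_left hB]
  ring

/-! ### The profiles and the final closed forms -/

/-- The polynomial integral of the energy density. [folklore] -/
theorem integral_sq_mul_sub (r L₀ a b : ℝ) :
    ∫ s in a..b, s ^ 2 * (r ^ 2 * s ^ 2 - L₀) =
      (r ^ 2 * b ^ 5 / 5 - L₀ * b ^ 3 / 3) - (r ^ 2 * a ^ 5 / 5 - L₀ * a ^ 3 / 3) := by
  have hderiv : ∀ x : ℝ, HasDerivAt (fun s : ℝ => r ^ 2 * s ^ 5 / 5 - L₀ * s ^ 3 / 3)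
      (x ^ 2 * (r ^ 2 * x ^ 2 - L₀)) x := by
    intro x
    have h := (((hasDerivAt_pow 5 x).const_mul (r ^ 2)).div_const 5).sub
      (((hasDerivAt_pow 3 x).const_mul L₀).div_const 3)
    refine h.congr_deriv ?_
    push_cast
    ring
  rw [integral_eq_sub_of_hasDerivAt (fun x _ => hderiv x)
    ((by fun_prop : Continuous fun s : ℝ => s ^ 2 * (r ^ 2 * s ^ 2 - L₀)).intervalIntegrable _ _)]

/-- The polynomial integral of the radial pressure. [folklore] -/
theorem integral_sub_sq (r L₀ a b : ℝ) :
    ∫ s in a..b, (r ^ 2 * s ^ 2 - L₀) ^ 2 =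
      (r ^ 4 * b ^ 5 / 5 - 2 * r ^ 2 * L₀ * b ^ 3 / 3 + L₀ ^ 2 * b) -
        (r ^ 4 * a ^ 5 / 5 - 2 * r ^ 2 * L₀ * a ^ 3 / 3 + L₀ ^ 2 * a) := by
  have hderiv : ∀ x : ℝ, HasDerivAt
      (fun s : ℝ => r ^ 4 * s ^ 5 / 5 - 2 * r ^ 2 * L₀ * s ^ 3 / 3 + L₀ ^ 2 * s)
      ((r ^ 2 * x ^ 2 - L₀) ^ 2) x := by
    intro x
    have h := ((((hasDerivAt_pow 5 x).const_mul (r ^ 4)).div_const 5).sub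
      (((hasDerivAt_pow 3 x).const_mul (2 * r ^ 2 * L₀)).div_const 3)).add
      ((hasDerivAt_id' x).const_mul (L₀ ^ 2))
    refine h.congr_deriv ?_
    push_cast
    ring
  rw [integral_eq_sub_of_hasDerivAt (fun x _ => hderiv x)
    ((by fun_prop : Continuous fun s : ℝ => (r ^ 2 * s ^ 2 - L₀) ^ 2).intervalIntegrable _ _)]


/-- **Closed form of the energy density for `k = 0`, `l = 1/2`, `E₀ = 1`**:
`ρ(r) = π² L₀^{5/2} r⁻⁴ Q(e^{-μ(r)} r/√L₀) = rhoHat (√L₀) r (μ r)` for `L₀, r > 0` and every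
potential `μ`. [cite: Andreasson2021, §3, display (ρ) after Remark 3.4 (from [AFT2] Lemma 3.3)] -/
theorem energyDensity_zero_half (hL₀ : 0 < L₀) (hr : 0 < r) (μ : ℝ → ℝ) :
    energyDensity (polytropicAnsatz 1 L₀ 0 (1 / 2)) μ r = rhoHat (√L₀) r (μ r) := by
  unfold energyDensity rhoHat
  rw [setIntegral_energy_mul_phaseDensity_zero_half hL₀ hr μ, integral_sq_mul_sub]
  set q : ℝ := √L₀ with hq
  have hq0 : 0 < q := Real.sqrt_pos.mpr hL₀
  have hqq : L₀ = q ^ 2 := (Real.sq_sqrt hL₀.le).symm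
  set t : ℝ := exp (-μ r) * r / q with ht
  have ha : exp (-μ r) = t * q / r := by rw [ht]; field_simp
  rw [ha, hqq]
  rcases le_or_gt 1 t with h1 | h1
  · have hmax : max (q / r) (t * q / r) = t * q / r := by
      refine max_eq_right ?_
      rw [div_le_div_iff_of_pos_right hr]
      nlinarith
    rw [hmax, rhoProfile_eq_of_one_le h1]
    field_simp
    ring
  · have hmax : max (q / r) (t * q / r) = q / r := by
      refine max_eq_left ?_
      rw [div_le_div_iff_of_pos_right hr]
      nlinarith
    rw [hmax, rhoProfile_eq_zero_of_le_one h1.le]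
    ring

/-- **Closed form of the radial pressure for `k = 0`, `l = 1/2`, `E₀ = 1`**:
`p(r) = π² L₀^{5/2} r⁻⁴ P(e^{-μ(r)} r/√L₀) = pHat (√L₀) r (μ r)`.
[cite: Andreasson2021, §3, display (p) after Remark 3.4 (from [AFT2] Lemma 3.3)] -/
theorem radialPressure_zero_half (hL₀ : 0 < L₀) (hr : 0 < r) (μ : ℝ → ℝ) :
    radialPressure (polytropicAnsatz 1 L₀ 0 (1 / 2)) μ r = pHat (√L₀) r (μ r) := by
  unfold radialPressure pHat
  rw [setIntegral_sq_div_energy_mul_phaseDensity_zero_half hL₀ hr μ, integral_sub_sq]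
  set q : ℝ := √L₀ with hq
  have hq0 : 0 < q := Real.sqrt_pos.mpr hL₀
  have hqq : L₀ = q ^ 2 := (Real.sq_sqrt hL₀.le).symm
  set t : ℝ := exp (-μ r) * r / q with ht
  have ha : exp (-μ r) = t * q / r := by rw [ht]; field_simp
  rw [ha, hqq]
  rcases le_or_gt 1 t with h1 | h1
  · have hmax : max (q / r) (t * q / r) = t * q / r := by
      refine max_eq_right ?_
      rw [div_le_div_iff_of_pos_right hr]
      nlinarith
    rw [hmax, pProfile_eq_of_one_le h1]
    field_simp
    ring
  · have hmax : max (q / r) (t * q / r) = q / r := by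
      refine max_eq_left ?_
      rw [div_le_div_iff_of_pos_right hr]
      nlinarith
    rw [hmax, pProfile_eq_zero_of_le_one h1.le]
    ring

end ClosedForm

/-! ### Generic calculus helpers on a closed interval -/

section Calculus

variable {f f' : ℝ → ℝ} {a b : ℝ}

/-- A function with a derivative within `[a, b]` at every point is continuous on `[a, b]`. [folklore] -/
theorem continuousOn_of_hasDerivWithinAt_Icc
    (h : ∀ x ∈ Icc a b, HasDerivWithinAt f (f' x) (Icc a b) x) : ContinuousOn f (Icc a b) :=
  fun x hx => (h x hx).continuousWithinAt

/-- Right-derivative form on `[a, b)` of a derivative within `[a, b]` (the form consumed by the fencing / one-sided comparison lemmas). [folklore] -/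
theorem hasDerivWithinAt_Ici_of_Icc
    (h : ∀ x ∈ Icc a b, HasDerivWithinAt f (f' x) (Icc a b) x) :
    ∀ x ∈ Ico a b, HasDerivWithinAt f (f' x) (Ici x) x := fun x hx =>
  (h x (Ico_subset_Icc_self hx)).mono_of_mem_nhdsWithin
    (mem_of_superset (Icc_mem_nhdsGE hx.2) (Icc_subset_Icc hx.1 le_rfl))

/-- In the interior a derivative within `[a, b]` is a two-sided derivative. [folklore] -/
theorem hasDerivAt_of_Icc (h : ∀ x ∈ Icc a b, HasDerivWithinAt f (f' x) (Icc a b) x) {x : ℝ}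
    (hx : x ∈ Ioo a b) : HasDerivAt f (f' x) x :=
  (h x (Ioo_subset_Icc_self hx)).hasDerivAt (Icc_mem_nhds hx.1 hx.2)

/-- Non-negative derivative within `[a, b]` at every point ⇒ monotone on `[a, b]`. [folklore] -/
theorem monotoneOn_of_hasDerivWithinAt_Icc_nonneg
    (h : ∀ x ∈ Icc a b, HasDerivWithinAt f (f' x) (Icc a b) x) (hpos : ∀ x ∈ Icc a b, 0 ≤ f' x) :
    MonotoneOn f (Icc a b) := by
  refine monotoneOn_of_hasDerivWithinAt_nonneg (f' := f') (convex_Icc a b)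
    (continuousOn_of_hasDerivWithinAt_Icc h) (fun x hx => ?_) (fun x hx => ?_)
  · rw [interior_Icc] at hx ⊢
    exact (hasDerivAt_of_Icc h hx).hasDerivWithinAt
  · rw [interior_Icc] at hx
    exact hpos x (Ioo_subset_Icc_self hx)

/-- Non-positive derivative within `[a, b]` at every point ⇒ antitone on `[a, b]`. [folklore] -/
theorem antitoneOn_of_hasDerivWithinAt_Icc_nonpos
    (h : ∀ x ∈ Icc a b, HasDerivWithinAt f (f' x) (Icc a b) x) (hneg : ∀ x ∈ Icc a b, f' x ≤ 0) :
    AntitoneOn f (Icc a b) := by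
  have hm := monotoneOn_of_hasDerivWithinAt_Icc_nonneg (f := fun x => -f x) (f' := fun x => -f' x)
    (fun x hx => (h x hx).neg) (fun x hx => by simpa using hneg x hx)
  intro x hx y hy hxy
  have := hm hx hy hxy
  simpa using this

/-- If `f` has a derivative `f'` within `[a, b]` at `r` and takes values `< f r` at points of
`[a, b]` to the right of `r` arbitrarily close to `r`, then `f' ≤ 0`. [folklore] -/
theorem deriv_nonpos_of_frequently_lt {d r : ℝ} (h : HasDerivWithinAt f d (Icc a b) r)
    (hfreq : ∀ ε > 0, ∃ x ∈ Icc a b, r < x ∧ x < r + ε ∧ f x < f r) : d ≤ 0 := by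
  by_contra hpos
  push Not at hpos
  have hev : ∀ᶠ z in 𝓝[Icc a b \ {r}] r, 0 < slope f r z :=
    (hasDerivWithinAt_iff_tendsto_slope.mp h).eventually (lt_mem_nhds hpos)
  rw [eventually_nhdsWithin_iff, Metric.eventually_nhds_iff] at hev
  obtain ⟨ε, hε, hεP⟩ := hev
  obtain ⟨x, hx, hrx, hxε, hfx⟩ := hfreq ε hε
  have hdist : dist x r < ε := by
    rw [Real.dist_eq, abs_of_pos (by linarith)]; linarith
  have := hεP hdist ⟨hx, by simp [hrx.ne']⟩
  rw [slope_def_field] at this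
  have : f x - f r < 0 := by linarith
  have : 0 < x - r := by linarith
  have := div_neg_of_neg_of_pos ‹f x - f r < 0› ‹0 < x - r›
  linarith

/-- **First passage below a level.** For `f` continuous on `[a, b]` with `c ≤ f a`, if `f` takes a
value `< c` on `[a, b]`, then the infimum `r` of such points satisfies `f r = c`, `c ≤ f` on
`[a, r]`, and `f < c` at points to the right of `r` arbitrarily close to `r`. [folklore] -/
theorem exists_first_lt (hf : ContinuousOn f (Icc a b)) {c : ℝ} (ha : c ≤ f a)
    (hex : ∃ x ∈ Icc a b, f x < c) :
    ∃ r ∈ Icc a b, f r = c ∧ (∀ x ∈ Icc a r, c ≤ f x) ∧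
      (∀ ε > 0, ∃ x ∈ Icc a b, r < x ∧ x < r + ε ∧ f x < c) ∧
      ∀ x₀ ∈ Icc a b, f x₀ < c → r ≤ x₀ := by
  set T : Set ℝ := {x | x ∈ Icc a b ∧ f x < c} with hT
  obtain ⟨x₀, hx₀, hfx₀⟩ := hex
  have hTne : T.Nonempty := ⟨x₀, hx₀, hfx₀⟩
  have hTbdd : BddBelow T := ⟨a, fun x hx => hx.1.1⟩
  set r := sInf T with hr
  have har : a ≤ r := le_csInf hTne fun x hx => hx.1.1
  have hrx₀ : r ≤ x₀ := csInf_le hTbdd ⟨hx₀, hfx₀⟩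
  have hrb : r ≤ b := hrx₀.trans hx₀.2
  have hrmem : r ∈ Icc a b := ⟨har, hrb⟩
  -- points of `T` just to the right of `r`
  have hnot : ∀ x ∈ Icc a b, x < r → c ≤ f x := by
    intro x hx hxr
    by_contra hlt
    push Not at hlt
    have := csInf_le hTbdd ⟨hx, hlt⟩
    linarith
  have hfr_ge : c ≤ f r := by
    by_contra hlt
    push Not at hlt
    -- `f < c` near `r` within `Icc a b`; if `r = a` contradiction with `ha`, else points `< r`
    rcases eq_or_lt_of_le har with h | h
    · rw [← h] at hlt; linarith
    · have hev : ∀ᶠ x in 𝓝[Icc a b] r, f x < c := (hf r hrmem).eventually_lt_const hlt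
      rw [eventually_nhdsWithin_iff, Metric.eventually_nhds_iff] at hev
      obtain ⟨ε, hε, hεP⟩ := hev
      set x := max a (r - ε / 2) with hx
      have hxr : x < r := max_lt h (by linarith)
      have hxmem : x ∈ Icc a b := ⟨le_max_left _ _, hxr.le.trans hrb⟩
      have hdist : dist x r < ε := by
        rw [Real.dist_eq, abs_of_neg (by linarith)]
        have : r - ε / 2 ≤ x := le_max_right _ _
        linarith
      have := hεP hdist hxmem
      linarith [hnot x hxmem hxr]
  have hrT : r ∉ T := fun h => by linarith [h.2]
  have hfreq : ∀ ε > 0, ∃ x ∈ Icc a b, r < x ∧ x < r + ε ∧ f x < c := by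
    intro ε hε
    obtain ⟨x, hxT, hxε⟩ := exists_lt_of_csInf_lt hTne (show sInf T < r + ε by linarith)
    have hrx : r ≤ x := csInf_le hTbdd hxT
    have hne : x ≠ r := fun h => hrT (h ▸ hxT)
    exact ⟨x, hxT.1, lt_of_le_of_ne hrx hne.symm, hxε, hxT.2⟩
  have hfr_le : f r ≤ c := by
    by_contra hgt
    push Not at hgt
    have hev : ∀ᶠ x in 𝓝[Icc a b] r, c < f x := (hf r hrmem).eventually_const_lt hgt
    rw [eventually_nhdsWithin_iff, Metric.eventually_nhds_iff] at hev
    obtain ⟨ε, hε, hεP⟩ := hev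
    obtain ⟨x, hx, hrx, hxε, hfx⟩ := hfreq ε hε
    have hdist : dist x r < ε := by
      rw [Real.dist_eq, abs_of_pos (by linarith)]; linarith
    have := hεP hdist hx
    linarith
  refine ⟨r, hrmem, le_antisymm hfr_le hfr_ge, fun x hx => ?_, hfreq, fun x hx hfx =>
    csInf_le hTbdd ⟨hx, hfx⟩⟩
  rcases hx.2.eq_or_lt with h | h
  · rw [h]; exact hfr_ge
  · exact hnot x ⟨hx.1, h.le.trans hrb⟩ h

end Calculus

/-! ### The reduced system -/

/-- `q = √L₀` with `L₀ = R₀³/(R₀ - 2M₀)`. [folklore] -/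
def shellQ (M₀ R₀ : ℝ) : ℝ := √(R₀ ^ 3 / (R₀ - 2 * M₀))

/-- `q > 0` (`2M₀ < R₀`, `R₀ > 0`). [folklore] -/
theorem shellQ_pos {M₀ R₀ : ℝ} (h : 2 * M₀ < R₀) (hR₀ : 0 < R₀) : 0 < shellQ M₀ R₀ :=
  Real.sqrt_pos.mpr (div_pos (pow_pos hR₀ 3) (by linarith))

/-- `q² = R₀³/(R₀ - 2M₀) = L₀`. [folklore] -/
theorem shellQ_sq {M₀ R₀ : ℝ} (h : 2 * M₀ < R₀) (hR₀ : 0 < R₀) :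
    shellQ M₀ R₀ ^ 2 = R₀ ^ 3 / (R₀ - 2 * M₀) :=
  Real.sq_sqrt (div_pos (pow_pos hR₀ 3) (by linarith)).le

/-- The defining property of `R₀`: `e^{2 log(R₀/q)} = R₀²/q² = 1 - 2M₀/R₀`. [folklore] -/
theorem sq_div_shellQ_sq {M₀ R₀ : ℝ} (h : 2 * M₀ < R₀) (hR₀ : 0 < R₀) :
    R₀ ^ 2 / shellQ M₀ R₀ ^ 2 = 1 - 2 * M₀ / R₀ := by
  rw [shellQ_sq h hR₀]
  have : R₀ - 2 * M₀ ≠ 0 := by linarith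
  field_simp

/-- A solution of the reduced static massless Einstein–Vlasov system (`k = 0`, `l = 1/2`,
`E₀ = 1`) on `[R₀, b]` launched from Schwarzschild data of mass `M₀` at `r = R₀`.
[cite: Andreasson2021, §2 (2.1)–(2.2), §3 (data at r = R₀), Theorem 3.10] -/
structure ReducedSolution (M₀ R₀ b : ℝ) where
  /-- the metric exponent `μ` -/
  μ : ℝ → ℝ
  /-- the Hawking mass `m` -/
  m : ℝ → ℝ
  m_R₀ : m R₀ = M₀
  μ_R₀ : μ R₀ = log (R₀ / shellQ M₀ R₀)
  two_mul_m_lt : ∀ r ∈ Icc R₀ b, 2 * m r < r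
  hasDerivWithinAt_m : ∀ r ∈ Icc R₀ b,
    HasDerivWithinAt m (4 * π * r ^ 2 * rhoHat (shellQ M₀ R₀) r (μ r)) (Icc R₀ b) r
  hasDerivWithinAt_μ : ∀ r ∈ Icc R₀ b, HasDerivWithinAt μ
    ((m r + 4 * π * r ^ 3 * pHat (shellQ M₀ R₀) r (μ r)) / (r * (r - 2 * m r))) (Icc R₀ b) r

namespace ReducedSolution

variable {M₀ R₀ b : ℝ} (S : ReducedSolution M₀ R₀ b)

/-- the angular cut-off `q` of the solution [folklore] -/
def q (_ : ReducedSolution M₀ R₀ b) : ℝ := shellQ M₀ R₀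

/-- energy density along the solution [folklore] -/
def ρ (r : ℝ) : ℝ := rhoHat S.q r (S.μ r)

/-- radial pressure along the solution [folklore] -/
def p (r : ℝ) : ℝ := pHat S.q r (S.μ r)

/-- `γ = -μ + log(r/q)` [folklore] -/
def γ (r : ℝ) : ℝ := -S.μ r + log (r / S.q)

/-- `w = 1 - 2m/r = e^{-2λ}` [folklore] -/
def w (r : ℝ) : ℝ := 1 - 2 * S.m r / r

/-- (2.1) along the solution: `m' = 4πr²ρ`. [folklore] -/
theorem hasDerivWithinAt_m' {r : ℝ} (hr : r ∈ Icc R₀ b) :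
    HasDerivWithinAt S.m (4 * π * r ^ 2 * S.ρ r) (Icc R₀ b) r := S.hasDerivWithinAt_m r hr

/-- (2.2) along the solution: `μ' = (m + 4πr³p)/(r(r - 2m))`. [folklore] -/
theorem hasDerivWithinAt_μ' {r : ℝ} (hr : r ∈ Icc R₀ b) :
    HasDerivWithinAt S.μ ((S.m r + 4 * π * r ^ 3 * S.p r) / (r * (r - 2 * S.m r))) (Icc R₀ b) r :=
  S.hasDerivWithinAt_μ r hr

/-- `m` is continuous on `[R₀, b]`. [folklore] -/
theorem continuousOn_m : ContinuousOn S.m (Icc R₀ b) :=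
  continuousOn_of_hasDerivWithinAt_Icc S.hasDerivWithinAt_m

/-- `μ` is continuous on `[R₀, b]`. [folklore] -/
theorem continuousOn_μ : ContinuousOn S.μ (Icc R₀ b) :=
  continuousOn_of_hasDerivWithinAt_Icc S.hasDerivWithinAt_μ

/-- `γ(R₀) = 0` (by the choice `μ(R₀) = log(R₀/q)`, i.e. `R₀` is a root of the defining equation). [folklore] -/
theorem γ_R₀ : S.γ R₀ = 0 := by
  simp [γ, S.μ_R₀, q]

section Basic

variable (hM₀ : 0 < M₀) (hM : 2 * M₀ < R₀)
include hM₀ hM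

/-- `R₀ > 0`. [folklore] -/
theorem R₀_pos : 0 < R₀ := by linarith

/-- Points of `[R₀, b]` are positive. [folklore] -/
theorem pos_of_mem {r : ℝ} (hr : r ∈ Icc R₀ b) : 0 < r := by linarith [hr.1]

/-- `q > 0`. [folklore] -/
theorem q_pos : 0 < S.q := shellQ_pos hM (by linarith)

/-- `ρ ≥ 0`. [folklore] -/
theorem ρ_nonneg {r : ℝ} (hr : r ∈ Icc R₀ b) : 0 ≤ S.ρ r :=
  rhoHat_nonneg (S.q_pos hM₀ hM) (pos_of_mem hM₀ hM hr) _

/-- `p ≥ 0`. [folklore] -/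
theorem p_nonneg {r : ℝ} (hr : r ∈ Icc R₀ b) : 0 ≤ S.p r :=
  pHat_nonneg (S.q_pos hM₀ hM) (pos_of_mem hM₀ hM hr) _

/-- `m` is non-decreasing. [folklore] -/
theorem monotoneOn_m : MonotoneOn S.m (Icc R₀ b) :=
  monotoneOn_of_hasDerivWithinAt_Icc_nonneg S.hasDerivWithinAt_m fun r hr =>
    mul_nonneg (by positivity) (S.ρ_nonneg hM₀ hM hr)

/-- `M₀ ≤ m`. [folklore] -/
theorem le_m {r : ℝ} (hr : r ∈ Icc R₀ b) : M₀ ≤ S.m r :=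
  calc M₀ = S.m R₀ := S.m_R₀.symm
    _ ≤ S.m r := S.monotoneOn_m hM₀ hM (left_mem_Icc.mpr (hr.1.trans hr.2)) hr hr.1

/-- `m > 0`. [folklore] -/
theorem m_pos {r : ℝ} (hr : r ∈ Icc R₀ b) : 0 < S.m r := hM₀.trans_le (S.le_m hM₀ hM hr)

/-- `w = 1 - 2m/r > 0`. [folklore] -/
theorem w_pos {r : ℝ} (hr : r ∈ Icc R₀ b) : 0 < S.w r := by
  have hr0 := pos_of_mem hM₀ hM hr
  have := S.two_mul_m_lt r hr
  unfold w
  rw [sub_pos, div_lt_one hr0]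
  exact this

/-- `w < 1`. [folklore] -/
theorem w_lt_one {r : ℝ} (hr : r ∈ Icc R₀ b) : S.w r < 1 := by
  have hr0 := pos_of_mem hM₀ hM hr
  have := S.m_pos hM₀ hM hr
  unfold w
  have : 0 < 2 * S.m r / r := by positivity
  linarith

omit hM₀ hM in
/-- `r - 2m > 0`. [folklore] -/
theorem sub_two_mul_m_pos {r : ℝ} (hr : r ∈ Icc R₀ b) : 0 < r - 2 * S.m r := by
  linarith [S.two_mul_m_lt r hr]

/-- `r - 2m = r w`. [folklore] -/
theorem sub_two_mul_m_eq {r : ℝ} (hr : r ∈ Icc R₀ b) : r - 2 * S.m r = r * S.w r := by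
  have hr0 := pos_of_mem hM₀ hM hr
  unfold w
  field_simp

/-- `μ' > 0`. [folklore] -/
theorem μ_deriv_pos {r : ℝ} (hr : r ∈ Icc R₀ b) :
    0 < (S.m r + 4 * π * r ^ 3 * S.p r) / (r * (r - 2 * S.m r)) := by
  have hr0 := pos_of_mem hM₀ hM hr
  have h1 := S.m_pos hM₀ hM hr
  have h2 := S.p_nonneg hM₀ hM hr
  have h3 := S.sub_two_mul_m_pos hr
  positivity

/-- `μ` is non-decreasing. [folklore] -/
theorem monotoneOn_μ : MonotoneOn S.μ (Icc R₀ b) :=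
  monotoneOn_of_hasDerivWithinAt_Icc_nonneg S.hasDerivWithinAt_μ fun _ hr =>
    (S.μ_deriv_pos hM₀ hM hr).le

/-- `μ(R₀) ≤ μ`. [folklore] -/
theorem μ_R₀_le {r : ℝ} (hr : r ∈ Icc R₀ b) : S.μ R₀ ≤ S.μ r :=
  S.monotoneOn_μ hM₀ hM (left_mem_Icc.mpr (hr.1.trans hr.2)) hr hr.1

/-- `e^{γ} = e^{-μ} r / q`. [folklore] -/
theorem exp_γ {r : ℝ} (hr : r ∈ Icc R₀ b) : exp (S.γ r) = exp (-S.μ r) * r / S.q := by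
  have hr0 := pos_of_mem hM₀ hM hr
  have hq := S.q_pos hM₀ hM
  rw [γ, exp_add, exp_log (div_pos hr0 hq), mul_div_assoc]

/-- `ρ = π² q⁵ r⁻⁴ Q(e^{γ})`. [folklore] -/
theorem ρ_eq {r : ℝ} (hr : r ∈ Icc R₀ b) :
    S.ρ r = π ^ 2 * S.q ^ 5 / r ^ 4 * rhoProfile (exp (S.γ r)) := by
  rw [S.exp_γ hM₀ hM hr]; rfl

/-- `p = π² q⁵ r⁻⁴ P(e^{γ})`. [folklore] -/
theorem p_eq {r : ℝ} (hr : r ∈ Icc R₀ b) :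
    S.p r = π ^ 2 * S.q ^ 5 / r ^ 4 * pProfile (exp (S.γ r)) := by
  rw [S.exp_γ hM₀ hM hr]; rfl

/-- `γ' = 1/r - μ'`. [folklore] -/
theorem hasDerivWithinAt_γ {r : ℝ} (hr : r ∈ Icc R₀ b) :
    HasDerivWithinAt S.γ
      (1 / r - (S.m r + 4 * π * r ^ 3 * S.p r) / (r * (r - 2 * S.m r))) (Icc R₀ b) r := by
  have hr0 := pos_of_mem hM₀ hM hr
  have hq := S.q_pos hM₀ hM
  have h1 : HasDerivWithinAt (fun x => log (x / S.q)) (1 / r) (Icc R₀ b) r := by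
    have h := ((hasDerivAt_id r).div_const S.q).log (div_pos hr0 hq).ne'
    refine (h.hasDerivWithinAt).congr_deriv ?_
    simp only [id]
    field_simp
  have := (S.hasDerivWithinAt_μ' hr).neg.add h1
  refine this.congr_deriv ?_
  ring

/-- `w' = -8πrρ + 2m/r²`. [folklore] -/
theorem hasDerivWithinAt_w {r : ℝ} (hr : r ∈ Icc R₀ b) :
    HasDerivWithinAt S.w (-(8 * π * r * S.ρ r) + 2 * S.m r / r ^ 2) (Icc R₀ b) r := by
  have hr0 := pos_of_mem hM₀ hM hr
  have h := ((S.hasDerivWithinAt_m' hr).div (hasDerivAt_id r).hasDerivWithinAt hr0.ne').const_mul 2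
  have h2 := h.const_sub 1
  have hw : S.w = fun x => 1 - 2 * (S.m x / id x) := by
    funext x; simp only [w, id]; ring
  rw [hw]
  refine h2.congr_deriv ?_
  simp only [id]
  field_simp
  ring

end Basic

/-! ### The a priori lower bound on `w = 1 - 2m/r` -/

section Apriori

/-- The comparison rate `g(u) = 8π R̄ · π² q⁵ R₀⁻⁴ Q(e^{-u} R̄ / q)`. [folklore] -/
def gRate (M₀ R₀ Rb u : ℝ) : ℝ :=
  8 * π * Rb * (π ^ 2 * shellQ M₀ R₀ ^ 5 / R₀ ^ 4 * rhoProfile (exp (-u) * Rb / shellQ M₀ R₀))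

/-- The explicit lower bound `η₀ = (1 - 2M₀/R₀) exp(-R̄² log(R̄/R₀) g(u₀)/M₀)`. [folklore] -/
def etaZero (M₀ R₀ Rb : ℝ) : ℝ :=
  (1 - 2 * M₀ / R₀) * exp (-(Rb ^ 2 * (log (Rb / R₀) * gRate M₀ R₀ Rb (log (R₀ / shellQ M₀ R₀))) / M₀))

/-- `η₀ > 0`. [folklore] -/
theorem etaZero_pos {M₀ R₀ Rb : ℝ} (hM₀ : 0 < M₀) (hM : 2 * M₀ < R₀) : 0 < etaZero M₀ R₀ Rb := by
  unfold etaZero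
  have hR₀ : 0 < R₀ := by linarith
  have : 0 < 1 - 2 * M₀ / R₀ := by
    rw [sub_pos, div_lt_one hR₀]; exact hM
  positivity

/-- `η₀ ≤ 1 - 2M₀/R₀ = w(R₀)`. [folklore] -/
theorem etaZero_le {M₀ R₀ Rb : ℝ} (hM₀ : 0 < M₀) (hM : 2 * M₀ < R₀) (hRb : R₀ ≤ Rb) :
    etaZero M₀ R₀ Rb ≤ 1 - 2 * M₀ / R₀ := by
  unfold etaZero
  have hR₀ : 0 < R₀ := by linarith
  have h1 : 0 < 1 - 2 * M₀ / R₀ := by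
    rw [sub_pos, div_lt_one hR₀]; exact hM
  refine mul_le_of_le_one_right h1.le (exp_le_one_iff.mpr ?_)
  rw [neg_nonpos]
  refine div_nonneg (mul_nonneg (sq_nonneg _) (mul_nonneg (log_nonneg ?_) ?_)) hM₀.le
  · rwa [le_div_iff₀ hR₀, one_mul]
  · unfold gRate
    have := rhoProfile_nonneg (exp (-log (R₀ / shellQ M₀ R₀)) * Rb / shellQ M₀ R₀)
    have := (shellQ_pos hM hR₀).le
    have : 0 ≤ Rb := hR₀.le.trans hRb
    positivity

/-- `g` is continuous. [folklore] -/
theorem continuous_gRate {M₀ R₀ Rb : ℝ} : Continuous (gRate M₀ R₀ Rb) := by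
  unfold gRate
  exact continuous_const.mul (continuous_const.mul (continuous_rhoProfile.comp (by fun_prop)))

/-- `g ≥ 0`. [folklore] -/
theorem gRate_nonneg {M₀ R₀ Rb : ℝ} (hM : 2 * M₀ < R₀) (hR₀ : 0 < R₀) (hRb : R₀ ≤ Rb) (u : ℝ) :
    0 ≤ gRate M₀ R₀ Rb u := by
  unfold gRate
  have := rhoProfile_nonneg (exp (-u) * Rb / shellQ M₀ R₀)
  have := (shellQ_pos hM hR₀).le
  have : 0 ≤ Rb := hR₀.le.trans hRb
  positivity

/-- `g` is antitone. [folklore] -/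
theorem gRate_antitone {M₀ R₀ Rb : ℝ} (hM : 2 * M₀ < R₀) (hR₀ : 0 < R₀) (hRb : R₀ ≤ Rb) :
    Antitone (gRate M₀ R₀ Rb) := by
  intro u v huv
  unfold gRate
  have hq := (shellQ_pos hM hR₀).le
  have : 0 ≤ Rb := hR₀.le.trans hRb
  refine mul_le_mul_of_nonneg_left (mul_le_mul_of_nonneg_left (monotone_rhoProfile ?_)
    (by positivity)) (by positivity)
  have : exp (-v) ≤ exp (-u) := exp_le_exp.mpr (by linarith)
  exact div_le_div_of_nonneg_right (mul_le_mul_of_nonneg_right this (by positivity)) hq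

/-- `g(u) = 0` for `u ≥ log(R̄/q)`. [folklore] -/
theorem gRate_eq_zero {M₀ R₀ Rb : ℝ} (hM : 2 * M₀ < R₀) (hR₀ : 0 < R₀) (hRb : R₀ ≤ Rb) {u : ℝ}
    (hu : log (Rb / shellQ M₀ R₀) ≤ u) : gRate M₀ R₀ Rb u = 0 := by
  unfold gRate
  have hq := shellQ_pos hM hR₀
  have hRb0 : 0 < Rb := hR₀.trans_le hRb
  rw [rhoProfile_eq_zero_of_le_one, mul_zero, mul_zero]
  rw [div_le_one hq, ← le_div_iff₀ hRb0, Real.exp_neg, inv_le_comm₀ (exp_pos _) (div_pos hq hRb0),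
    inv_div, ← exp_log (div_pos hRb0 hq)]
  exact exp_le_exp.mpr hu

variable (hM₀ : 0 < M₀) (hM : 2 * M₀ < R₀)
include hM₀ hM

/-- **A priori bound.** Along any reduced solution on `[R₀, b] ⊆ [R₀, R̄]`, `w = 1 - 2m/r ≥ η₀(R̄) > 0`
(the matter switches itself off before a horizon can form: `(log w + G∘μ/κ)' ≥ 0`).
[folklore] -/
theorem etaZero_le_w {Rb : ℝ} (hb : b ≤ Rb) {r : ℝ} (hr : r ∈ Icc R₀ b) :
    etaZero M₀ R₀ Rb ≤ S.w r := by
  have hR₀ : 0 < R₀ := by linarith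
  have hRb : R₀ ≤ Rb := hr.1.trans (hr.2.trans hb)
  have hRb0 : 0 < Rb := hR₀.trans_le hRb
  have hq : 0 < shellQ M₀ R₀ := shellQ_pos hM hR₀
  set u₀ := log (R₀ / shellQ M₀ R₀) with hu₀
  set g := gRate M₀ R₀ Rb with hg
  set G : ℝ → ℝ := fun u => ∫ x in u₀..u, g x with hG
  set κ : ℝ := M₀ / Rb ^ 2 with hκ
  have hκ0 : 0 < κ := by positivity
  set Ψ : ℝ → ℝ := fun x => log (S.w x) + G (S.μ x) / κ with hΨ
  have hΨ' : ∀ x ∈ Icc R₀ b, HasDerivWithinAt Ψ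
      ((-(8 * π * x * S.ρ x) + 2 * S.m x / x ^ 2) / S.w x +
        g (S.μ x) * ((S.m x + 4 * π * x ^ 3 * S.p x) / (x * (x - 2 * S.m x))) / κ)
      (Icc R₀ b) x := by
    intro x hx
    have h1 := (S.hasDerivWithinAt_w hM₀ hM hx).log (S.w_pos hM₀ hM hx).ne'
    have hGd : HasDerivAt G (g (S.μ x)) (S.μ x) :=
      (continuous_gRate.integral_hasStrictDerivAt u₀ (S.μ x)).hasDerivAt
    have h2 := (hGd.comp_hasDerivWithinAt x (S.hasDerivWithinAt_μ' hx)).div_const κ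
    exact h1.add h2
  have hΨ'pos : ∀ x ∈ Icc R₀ b, 0 ≤ (-(8 * π * x * S.ρ x) + 2 * S.m x / x ^ 2) / S.w x +
      g (S.μ x) * ((S.m x + 4 * π * x ^ 3 * S.p x) / (x * (x - 2 * S.m x))) / κ := by
    intro x hx
    have hx0 : 0 < x := pos_of_mem hM₀ hM hx
    have hw := S.w_pos hM₀ hM hx
    have hm := S.le_m hM₀ hM hx
    have hmp := S.m_pos hM₀ hM hx
    have hp := S.p_nonneg hM₀ hM hx
    have hρ := S.ρ_nonneg hM₀ hM hx
    have hgx : 0 ≤ g (S.μ x) := gRate_nonneg hM hR₀ hRb _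
    have hxRb : x ≤ Rb := hx.2.trans hb
    have hρg : 8 * π * x * S.ρ x ≤ g (S.μ x) := by
      have h1 : S.ρ x ≤ π ^ 2 * shellQ M₀ R₀ ^ 5 / R₀ ^ 4 *
          rhoProfile (exp (-S.μ x) * Rb / shellQ M₀ R₀) :=
        rhoHat_le_of_mem hq hR₀ ⟨hx.1, hxRb⟩ le_rfl
      calc 8 * π * x * S.ρ x
          ≤ 8 * π * Rb * (π ^ 2 * shellQ M₀ R₀ ^ 5 / R₀ ^ 4 *
              rhoProfile (exp (-S.μ x) * Rb / shellQ M₀ R₀)) :=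
            mul_le_mul (by nlinarith [pi_pos]) h1 hρ (by positivity)
        _ = g (S.μ x) := rfl
    have key : κ * (8 * π * x * S.ρ x) ≤ g (S.μ x) * S.m x / x ^ 2 := by
      calc κ * (8 * π * x * S.ρ x) ≤ κ * g (S.μ x) := mul_le_mul_of_nonneg_left hρg hκ0.le
        _ = g (S.μ x) * (M₀ / Rb ^ 2) := by rw [hκ]; ring
        _ ≤ g (S.μ x) * (S.m x / x ^ 2) := by
            refine mul_le_mul_of_nonneg_left ?_ hgx
            exact div_le_div₀ hmp.le hm (by positivity) (by gcongr)
        _ = g (S.μ x) * S.m x / x ^ 2 := by ring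
    have hA : 0 ≤ -(8 * π * x * S.ρ x) + 2 * S.m x / x ^ 2 +
        g (S.μ x) * (S.m x + 4 * π * x ^ 3 * S.p x) / (x ^ 2 * κ) := by
      have e1 : g (S.μ x) * (S.m x + 4 * π * x ^ 3 * S.p x) / (x ^ 2 * κ) =
          (g (S.μ x) * S.m x / x ^ 2) / κ + g (S.μ x) * (4 * π * x ^ 3 * S.p x) / (x ^ 2 * κ) := by
        field_simp
      have e2 : 8 * π * x * S.ρ x ≤ (g (S.μ x) * S.m x / x ^ 2) / κ := by
        rw [le_div_iff₀ hκ0]; linarith [key]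
      have e3 : 0 ≤ g (S.μ x) * (4 * π * x ^ 3 * S.p x) / (x ^ 2 * κ) := by positivity
      have e4 : 0 ≤ 2 * S.m x / x ^ 2 := by positivity
      rw [e1]; linarith
    rw [S.sub_two_mul_m_eq hM₀ hM hx]
    have e5 : (-(8 * π * x * S.ρ x) + 2 * S.m x / x ^ 2) / S.w x +
        g (S.μ x) * ((S.m x + 4 * π * x ^ 3 * S.p x) / (x * (x * S.w x))) / κ =
        (-(8 * π * x * S.ρ x) + 2 * S.m x / x ^ 2 +
          g (S.μ x) * (S.m x + 4 * π * x ^ 3 * S.p x) / (x ^ 2 * κ)) / S.w x := by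
      field_simp
    rw [e5]
    exact div_nonneg hA hw.le
  -- `Ψ` is monotone, so `Ψ r ≥ Ψ R₀ = log (1 - 2M₀/R₀)`
  have hmono := monotoneOn_of_hasDerivWithinAt_Icc_nonneg hΨ' hΨ'pos
  have hR₀mem : R₀ ∈ Icc R₀ b := left_mem_Icc.mpr (hr.1.trans hr.2)
  have h1 : Ψ R₀ ≤ Ψ r := hmono hR₀mem hr hr.1
  have hw0 : S.w R₀ = 1 - 2 * M₀ / R₀ := by simp [w, S.m_R₀]
  have hΨ0 : Ψ R₀ = log (1 - 2 * M₀ / R₀) := by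
    simp only [hΨ, hG, S.μ_R₀, hw0, ← hu₀, intervalIntegral.integral_same, zero_div, add_zero]
  -- the bound on `G (μ r)`
  have hGle : G (S.μ r) ≤ log (Rb / R₀) * g u₀ := by
    have hu : u₀ ≤ S.μ r := by rw [hu₀, ← S.μ_R₀]; exact S.μ_R₀_le hM₀ hM hr
    have hū : u₀ ≤ log (Rb / shellQ M₀ R₀) :=
      log_le_log (div_pos hR₀ hq) (div_le_div_of_nonneg_right hRb hq.le)
    have hlogeq : log (Rb / shellQ M₀ R₀) - u₀ = log (Rb / R₀) := by
      rw [hu₀, ← log_div (div_pos hRb0 hq).ne' (div_pos hR₀ hq).ne']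
      congr 1
      field_simp
    have hg0 : 0 ≤ g u₀ := gRate_nonneg hM hR₀ hRb _
    have hbound : ∀ v, u₀ ≤ v → ∫ x in u₀..v, g x ≤ (v - u₀) * g u₀ := fun v hv => by
      calc ∫ x in u₀..v, g x ≤ ∫ _ in u₀..v, g u₀ :=
            intervalIntegral.integral_mono_on hv (continuous_gRate.intervalIntegrable _ _)
              intervalIntegrable_const (fun x hx => gRate_antitone hM hR₀ hRb hx.1)
        _ = (v - u₀) * g u₀ := by rw [intervalIntegral.integral_const, smul_eq_mul]
    rcases le_or_gt (S.μ r) (log (Rb / shellQ M₀ R₀)) with hcase | hcase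
    · calc G (S.μ r) ≤ (S.μ r - u₀) * g u₀ := hbound _ hu
        _ ≤ (log (Rb / shellQ M₀ R₀) - u₀) * g u₀ :=
            mul_le_mul_of_nonneg_right (by linarith) hg0
        _ = log (Rb / R₀) * g u₀ := by rw [hlogeq]
    · have hsplit : G (S.μ r) =
          (∫ x in u₀..log (Rb / shellQ M₀ R₀), g x) + ∫ x in log (Rb / shellQ M₀ R₀)..S.μ r, g x :=
        (intervalIntegral.integral_add_adjacent_intervals
          (continuous_gRate.intervalIntegrable _ _) (continuous_gRate.intervalIntegrable _ _)).symm
      have hzero : ∫ x in log (Rb / shellQ M₀ R₀)..S.μ r, g x = 0 := by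
        rw [intervalIntegral.integral_congr (g := fun _ => (0 : ℝ)) (fun x hx => ?_)]
        · simp
        · rw [uIcc_of_le hcase.le] at hx
          exact gRate_eq_zero hM hR₀ hRb hx.1
      rw [hsplit, hzero, add_zero]
      calc ∫ x in u₀..log (Rb / shellQ M₀ R₀), g x ≤ (log (Rb / shellQ M₀ R₀) - u₀) * g u₀ :=
            hbound _ hū
        _ = log (Rb / R₀) * g u₀ := by rw [hlogeq]
  -- conclude
  have hwr := S.w_pos hM₀ hM hr
  have hlog : log (1 - 2 * M₀ / R₀) - log (Rb / R₀) * g u₀ / κ ≤ log (S.w r) := by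
    have e : Ψ r = log (S.w r) + G (S.μ r) / κ := rfl
    have := div_le_div_of_nonneg_right hGle hκ0.le
    linarith
  have h10 : 0 < 1 - 2 * M₀ / R₀ := by rw [sub_pos, div_lt_one hR₀]; exact hM
  have hexp : etaZero M₀ R₀ Rb = exp (log (1 - 2 * M₀ / R₀) - log (Rb / R₀) * g u₀ / κ) := by
    have e : Rb ^ 2 * (log (Rb / R₀) * gRate M₀ R₀ Rb (log (R₀ / shellQ M₀ R₀))) / M₀ =
        log (Rb / R₀) * g u₀ / κ := by
      rw [hg, hu₀, hκ]
      field_simp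
    rw [etaZero, e, exp_sub, exp_log h10, exp_neg, div_eq_mul_inv (1 - 2 * M₀ / R₀)]
  calc etaZero M₀ R₀ Rb = exp (log (1 - 2 * M₀ / R₀) - log (Rb / R₀) * g u₀ / κ) := hexp
    _ ≤ exp (log (S.w r)) := exp_le_exp.mpr hlog
    _ = S.w r := exp_log hwr

end Apriori

end ReducedSolution

/-! ### Existence on `[R₀, R₀ + T]`: Peano's theorem for a clamped field and a continuity argument -/

section Existence

open Literature.Analysis.ODE

variable {M₀ R₀ : ℝ}

/-- The clamped vector field: all arguments are retracted onto the a-priori region. [folklore] -/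
def clampedField (M₀ R₀ Rb θ : ℝ) (r : ℝ) (y : ℝ × ℝ) : ℝ × ℝ :=
  ((max M₀ (min y.2 (Rb / 2)) +
      4 * π * max R₀ (min r Rb) ^ 3 *
        pHat (shellQ M₀ R₀) (max R₀ (min r Rb)) (max y.1 (log (R₀ / shellQ M₀ R₀)))) /
    (max R₀ (min r Rb) * max (max R₀ (min r Rb) - 2 * max M₀ (min y.2 (Rb / 2))) θ),
   4 * π * max R₀ (min r Rb) ^ 2 *
     rhoHat (shellQ M₀ R₀) (max R₀ (min r Rb)) (max y.1 (log (R₀ / shellQ M₀ R₀))))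

/-- The clamped field is jointly continuous (denominators are bounded below by `R₀θ > 0`). [folklore] -/
theorem continuous_clampedField {Rb θ : ℝ} (hM : 2 * M₀ < R₀) (hR₀ : 0 < R₀) (hθ : 0 < θ) :
    Continuous (Function.uncurry (clampedField M₀ R₀ Rb θ)) := by
  have hq := shellQ_pos hM hR₀
  have hr' : Continuous fun p : ℝ × (ℝ × ℝ) => max R₀ (min p.1 Rb) := by fun_prop
  have hr'pos : ∀ p : ℝ × (ℝ × ℝ), 0 < max R₀ (min p.1 Rb) := fun p => hR₀.trans_le (le_max_left _ _)
  have hu : Continuous fun p : ℝ × (ℝ × ℝ) => max p.2.1 (log (R₀ / shellQ M₀ R₀)) := by fun_prop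
  have hm : Continuous fun p : ℝ × (ℝ × ℝ) => max M₀ (min p.2.2 (Rb / 2)) := by fun_prop
  have hρ : Continuous fun p : ℝ × (ℝ × ℝ) =>
      rhoHat (shellQ M₀ R₀) (max R₀ (min p.1 Rb)) (max p.2.1 (log (R₀ / shellQ M₀ R₀))) :=
    (continuousOn_rhoHat (q := shellQ M₀ R₀)).comp_continuous (hr'.prodMk hu)
      fun p => ⟨hr'pos p, mem_univ _⟩
  have hp : Continuous fun p : ℝ × (ℝ × ℝ) =>
      pHat (shellQ M₀ R₀) (max R₀ (min p.1 Rb)) (max p.2.1 (log (R₀ / shellQ M₀ R₀))) :=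
    (continuousOn_pHat (q := shellQ M₀ R₀)).comp_continuous (hr'.prodMk hu)
      fun p => ⟨hr'pos p, mem_univ _⟩
  refine Continuous.prodMk ?_ (by fun_prop)
  refine Continuous.div (by fun_prop) (by fun_prop) fun p => ?_
  exact (mul_pos (hr'pos p) (hθ.trans_le (le_max_right _ _))).ne'

/-- The sup-norm bound of the clamped field. [folklore] -/
theorem norm_clampedField_le {Rb θ : ℝ} (hM₀ : 0 < M₀) (hM : 2 * M₀ < R₀) (hRb : R₀ ≤ Rb)
    (hθ : 0 < θ) (r : ℝ) (y : ℝ × ℝ) :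
    ‖clampedField M₀ R₀ Rb θ r y‖ ≤
      max ((Rb / 2 + 4 * π * Rb ^ 3 * (π ^ 2 * shellQ M₀ R₀ ^ 5 / R₀ ^ 4 *
              pProfile (exp (-log (R₀ / shellQ M₀ R₀)) * Rb / shellQ M₀ R₀))) / (R₀ * θ))
        (4 * π * Rb ^ 2 * (π ^ 2 * shellQ M₀ R₀ ^ 5 / R₀ ^ 4 *
              rhoProfile (exp (-log (R₀ / shellQ M₀ R₀)) * Rb / shellQ M₀ R₀))) := by
  have hR₀ : 0 < R₀ := by linarith
  have hRb0 : 0 < Rb := hR₀.trans_le hRb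
  have hq := shellQ_pos hM hR₀
  set r' := max R₀ (min r Rb) with hr'
  set u := max y.1 (log (R₀ / shellQ M₀ R₀)) with hu
  set m := max M₀ (min y.2 (Rb / 2)) with hm
  have hr'mem : r' ∈ Icc R₀ Rb := ⟨le_max_left _ _, max_le hRb (min_le_right _ _)⟩
  have hr'0 : 0 < r' := hR₀.trans_le hr'mem.1
  have hu0 : log (R₀ / shellQ M₀ R₀) ≤ u := le_max_right _ _
  have hm0 : M₀ ≤ m := le_max_left _ _
  have hm1 : m ≤ Rb / 2 := max_le (by linarith) (min_le_right _ _)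
  have hρ := rhoHat_le_of_mem hq hR₀ hr'mem hu0
  have hp := pHat_le_of_mem hq hR₀ hr'mem hu0
  have hρ0 := rhoHat_nonneg hq hr'0 u
  have hp0 := pHat_nonneg hq hr'0 u
  have hP0 := pProfile_nonneg (exp (-log (R₀ / shellQ M₀ R₀)) * Rb / shellQ M₀ R₀)
  have hQ0 := rhoProfile_nonneg (exp (-log (R₀ / shellQ M₀ R₀)) * Rb / shellQ M₀ R₀)
  rw [clampedField, Prod.norm_mk]
  refine max_le_max ?_ ?_
  · rw [Real.norm_eq_abs, abs_of_nonneg]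
    · refine div_le_div₀ (by positivity) ?_ (by positivity) ?_
      · have : r' ^ 3 ≤ Rb ^ 3 := pow_le_pow_left₀ hr'0.le hr'mem.2 3
        nlinarith [mul_le_mul this hp hp0 (by positivity), pi_pos]
      · exact mul_le_mul hr'mem.1 (le_max_right _ _) hθ.le hr'0.le
    · have : 0 < max (r' - 2 * m) θ := hθ.trans_le (le_max_right _ _)
      positivity
  · rw [Real.norm_eq_abs, abs_of_nonneg (by positivity)]
    have : r' ^ 2 ≤ Rb ^ 2 := pow_le_pow_left₀ hr'0.le hr'mem.2 2
    nlinarith [mul_le_mul this hρ hρ0 (by positivity), pi_pos]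

/-- **Existence of the reduced solution on any slab `[R₀, R₀ + T]`.**
[cite: Andreasson2021, §3 ("there exists a solution … on [R₀,∞[", from [RR]); proved here on slabs] -/
theorem exists_reducedSolution (hM₀ : 0 < M₀) (hM : 2 * M₀ < R₀) {T : ℝ} (hT : 0 ≤ T) :
    Nonempty (ReducedSolution M₀ R₀ (R₀ + T)) := by
  have hR₀ : 0 < R₀ := by linarith
  set Rb := R₀ + T with hRb
  have hRb' : R₀ ≤ Rb := by linarith
  have hq := shellQ_pos hM hR₀
  set q := shellQ M₀ R₀ with hqdef
  set u₀ := log (R₀ / q) with hu₀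
  set η := ReducedSolution.etaZero M₀ R₀ Rb with hη
  have hη0 : 0 < η := ReducedSolution.etaZero_pos hM₀ hM
  have hη1 : η ≤ 1 - 2 * M₀ / R₀ := ReducedSolution.etaZero_le hM₀ hM hRb'
  set θ := η * R₀ / 4 with hθ
  have hθ0 : 0 < θ := by positivity
  -- Peano
  obtain ⟨y, hy0, -, hyd⟩ := exists_hasDerivWithinAt_of_continuous_of_norm_le
    (continuous_clampedField (Rb := Rb) hM hR₀ hθ0)
    (norm_clampedField_le hM₀ hM hRb' hθ0) R₀ ((u₀, M₀) : ℝ × ℝ) T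
  set μ : ℝ → ℝ := fun t => (y t).1 with hμdef
  set m : ℝ → ℝ := fun t => (y t).2 with hmdef
  have hμd : ∀ t ∈ Icc R₀ Rb,
      HasDerivWithinAt μ (clampedField M₀ R₀ Rb θ t (y t)).1 (Icc R₀ Rb) t := fun t ht =>
    ((ContinuousLinearMap.fst ℝ ℝ ℝ).hasFDerivAt.comp_hasDerivWithinAt t (hyd t ht))
  have hmd : ∀ t ∈ Icc R₀ Rb,
      HasDerivWithinAt m (clampedField M₀ R₀ Rb θ t (y t)).2 (Icc R₀ Rb) t := fun t ht =>
    ((ContinuousLinearMap.snd ℝ ℝ ℝ).hasFDerivAt.comp_hasDerivWithinAt t (hyd t ht))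
  have hμ0 : μ R₀ = u₀ := by simp [hμdef, hy0]
  have hm0 : m R₀ = M₀ := by simp [hmdef, hy0]
  -- monotonicity of `m` and `μ` for the clamped system
  have hmono_m : MonotoneOn m (Icc R₀ Rb) := by
    refine monotoneOn_of_hasDerivWithinAt_Icc_nonneg hmd fun t ht => ?_
    simp only [clampedField]
    have : 0 < max R₀ (min t Rb) := hR₀.trans_le (le_max_left _ _)
    have := rhoHat_nonneg hq this (max (y t).1 (log (R₀ / shellQ M₀ R₀)))
    positivity
  have hmono_μ : MonotoneOn μ (Icc R₀ Rb) := by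
    refine monotoneOn_of_hasDerivWithinAt_Icc_nonneg hμd fun t ht => ?_
    simp only [clampedField]
    have h1 : 0 < max R₀ (min t Rb) := hR₀.trans_le (le_max_left _ _)
    have h2 := pHat_nonneg hq h1 (max (y t).1 (log (R₀ / shellQ M₀ R₀)))
    have h3 : 0 < max M₀ (min (y t).2 (Rb / 2)) := hM₀.trans_le (le_max_left _ _)
    have h4 : 0 < max (max R₀ (min t Rb) - 2 * max M₀ (min (y t).2 (Rb / 2))) θ :=
      hθ0.trans_le (le_max_right _ _)
    positivity
  have hm_ge : ∀ t ∈ Icc R₀ Rb, M₀ ≤ m t := fun t ht => by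
    rw [← hm0]; exact hmono_m (left_mem_Icc.mpr hRb') ht ht.1
  have hμ_ge : ∀ t ∈ Icc R₀ Rb, u₀ ≤ μ t := fun t ht => by
    rw [← hμ0]; exact hmono_μ (left_mem_Icc.mpr hRb') ht ht.1
  -- the continuity argument on `g t := 2 m t - t ≤ -2θ`
  set g : ℝ → ℝ := fun t => 2 * m t - t with hg
  have hgc : ContinuousOn g (Icc R₀ Rb) := fun t ht =>
    (((hmd t ht).continuousWithinAt).const_smul (2:ℝ)).sub continuousWithinAt_id
  have hga : g R₀ ≤ -(2 * θ) := by
    simp only [hg, hm0, hθ]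
    have : η * R₀ ≤ R₀ - 2 * M₀ := by
      have := mul_le_mul_of_nonneg_right hη1 hR₀.le
      rwa [sub_mul, one_mul, div_mul_cancel₀ _ hR₀.ne'] at this
    linarith
  -- build a reduced solution on `[R₀, c]` whenever the condition holds on `[R₀, c]`
  have build : ∀ c, c ≤ Rb → (∀ t ∈ Icc R₀ c, g t ≤ -(2 * θ)) →
      ∃ S : ReducedSolution M₀ R₀ c, S.m = m := by
    intro c hc hP
    have key : ∀ t ∈ Icc R₀ c, clampedField M₀ R₀ Rb θ t (y t) =
        ((m t + 4 * π * t ^ 3 * pHat q t (μ t)) / (t * (t - 2 * m t)),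
          4 * π * t ^ 2 * rhoHat q t (μ t)) := by
      intro t ht
      have ht' : t ∈ Icc R₀ Rb := ⟨ht.1, ht.2.trans hc⟩
      have e1 : max R₀ (min t Rb) = t := by
        rw [min_eq_left ht'.2, max_eq_right ht'.1]
      have e2 : max (y t).1 (log (R₀ / shellQ M₀ R₀)) = μ t := max_eq_left (hμ_ge t ht')
      have hgt := hP t ht
      simp only [hg] at hgt
      have e3 : max M₀ (min (y t).2 (Rb / 2)) = m t := by
        rw [min_eq_left (show (y t).2 ≤ Rb / 2 by change m t ≤ Rb / 2; linarith [ht'.2]),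
          max_eq_right (hm_ge t ht')]
      have e4 : max (t - 2 * m t) θ = t - 2 * m t := max_eq_left (by linarith)
      simp only [clampedField, e1, e2, e3, e4]
      rfl
    refine ⟨
      { μ := μ
        m := m
        m_R₀ := hm0
        μ_R₀ := hμ0
        two_mul_m_lt := fun t ht => by have := hP t ht; simp only [hg] at this; linarith
        hasDerivWithinAt_m := fun t ht => ?_
        hasDerivWithinAt_μ := fun t ht => ?_ }, rfl⟩
    · have := (hmd t ⟨ht.1, ht.2.trans hc⟩).mono (Icc_subset_Icc le_rfl hc)
      rw [key t ht] at this
      exact this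
    · have := (hμd t ⟨ht.1, ht.2.trans hc⟩).mono (Icc_subset_Icc le_rfl hc)
      rw [key t ht] at this
      exact this
  -- the maximal time is `Rb`
  set c := maximalTimeP (fun s => g s ≤ -(2 * θ)) R₀ Rb with hcdef
  have hcmem : c ∈ Icc R₀ Rb := maximalTimeP_le_const_mem hRb' hga
  have hPc : ∀ t ∈ Icc R₀ c, g t ≤ -(2 * θ) := fun t ht =>
    maximalTimeP_le_const_spec hRb' hgc hga ht
  have hc : c = Rb := by
    by_contra hne
    have hlt : c < Rb := lt_of_le_of_ne hcmem.2 hne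
    have hexit := eq_of_maximalTimeP_le_const_lt hRb' hgc hga hlt
    -- a priori bound on `[R₀, c]`
    obtain ⟨Sc, hSc⟩ := build c hcmem.2 hPc
    have hw : η ≤ 1 - 2 * m c / c := by
      have := Sc.etaZero_le_w hM₀ hM hcmem.2 (right_mem_Icc.mpr hcmem.1)
      simpa only [ReducedSolution.w, hSc] using this
    have hc0 : 0 < c := hR₀.trans_le hcmem.1
    have : g c ≤ -(4 * θ) := by
      simp only [hg, hθ]
      have h1 : η * c ≤ c - 2 * m c := by
        have := mul_le_mul_of_nonneg_right hw hc0.le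
        rwa [sub_mul, one_mul, div_mul_cancel₀ _ hc0.ne'] at this
      have h2 : η * R₀ ≤ η * c := mul_le_mul_of_nonneg_left hcmem.1 hη0.le
      linarith
    rw [← hcdef] at hexit
    linarith
  rw [hc] at hPc
  obtain ⟨S, -⟩ := build Rb le_rfl hPc
  exact ⟨S⟩

end Existence

/-! ## Part III: a priori estimates along a reduced solution (Andréasson 2021, §4) -/

/-- `δ := (20π³)^{-1/3}`, the length unit of the estimates (`4π³δ³ = 1/5`).
[cite: Andreasson2021, §3, the display defining δ before Theorem 3.5] -/
def shellDelta : ℝ := (1 / (20 * π ^ 3)) ^ (1 / 3 : ℝ)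

/-- `δ > 0`. [folklore] -/
theorem shellDelta_pos : 0 < shellDelta := by
  unfold shellDelta; positivity

/-- `δ³ = 1/(20π³)`. [folklore] -/
theorem shellDelta_pow_three : shellDelta ^ 3 = 1 / (20 * π ^ 3) := by
  unfold shellDelta
  rw [← Real.rpow_natCast, ← Real.rpow_mul (by positivity)]
  norm_num

/-- `π³δ³ = 1/20` (so `4π³δ³ = 1/5`, as used in Lemma 4.1 of the paper). [folklore] -/
theorem pi_pow_three_mul_shellDelta_pow_three : π ^ 3 * shellDelta ^ 3 = 1 / 20 := by
  rw [shellDelta_pow_three]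
  field_simp

namespace ReducedSolution

variable {M₀ R₀ b : ℝ} (S : ReducedSolution M₀ R₀ b) (hM₀ : 0 < M₀) (hM : 2 * M₀ < R₀)
include hM₀ hM

/-! ### Layer 0: pointwise matter bounds -/

/-- `q ≥ R₀`. [folklore] -/
theorem R₀_le_q : R₀ ≤ S.q := by
  have hR₀ : 0 < R₀ := by linarith
  have hq := S.q_pos hM₀ hM
  have h2 : R₀ ^ 2 ≤ S.q ^ 2 := by
    rw [q, shellQ_sq hM hR₀, le_div_iff₀ (by linarith)]
    nlinarith
  exact (pow_le_pow_iff_left₀ hR₀.le hq.le two_ne_zero).mp h2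

/-- `γ ≤ log(r/R₀)`: the function `γ - log r` is non-increasing (`(γ - log r)' = -μ' ≤ 0`).
[cite: Andreasson2021, §4, display after (4.2) (γ ≤ log(r/R₀))] -/
theorem γ_le_log {r : ℝ} (hr : r ∈ Icc R₀ b) : S.γ r ≤ log (r / R₀) := by
  have hR₀ : 0 < R₀ := by linarith
  have hanti : AntitoneOn (fun x => S.γ x - log x) (Icc R₀ b) := by
    refine antitoneOn_of_hasDerivWithinAt_Icc_nonpos (f' := fun x =>
      -((S.m x + 4 * π * x ^ 3 * S.p x) / (x * (x - 2 * S.m x)))) (fun x hx => ?_) (fun x hx => ?_)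
    · have hx0 := pos_of_mem hM₀ hM hx
      have := (S.hasDerivWithinAt_γ hM₀ hM hx).sub ((hasDerivAt_log hx0.ne').hasDerivWithinAt)
      refine this.congr_deriv ?_
      field_simp
      ring
    · simp only [neg_nonpos]
      exact (S.μ_deriv_pos hM₀ hM hx).le
  have hR₀mem : R₀ ∈ Icc R₀ b := left_mem_Icc.mpr (hr.1.trans hr.2)
  have := hanti hR₀mem hr hr.1
  simp only [S.γ_R₀, zero_sub] at this
  rw [log_div (pos_of_mem hM₀ hM hr).ne' hR₀.ne']
  linarith

/-- Lower bound `ρ ≥ (R₀/b)⁵ π² r γ²` where `γ ≥ 0`. [folklore] -/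
theorem ρ_ge {r : ℝ} (hr : r ∈ Icc R₀ b) (hγ : 0 ≤ S.γ r) :
    (R₀ / b) ^ 5 * (π ^ 2 * r * S.γ r ^ 2) ≤ S.ρ r := by
  have hR₀ : 0 < R₀ := by linarith
  have hr0 := pos_of_mem hM₀ hM hr
  have hb0 : 0 < b := hR₀.trans_le (hr.1.trans hr.2)
  have hq := S.q_pos hM₀ hM
  have hRq := S.R₀_le_q hM₀ hM
  rw [S.ρ_eq hM₀ hM hr]
  have ht : 1 ≤ exp (S.γ r) := one_le_exp hγ
  have hQ : S.γ r ^ 2 ≤ rhoProfile (exp (S.γ r)) := by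
    refine le_trans ?_ (sq_le_rhoProfile _)
    rw [max_eq_left ht]
    have := add_one_le_exp (S.γ r)
    exact pow_le_pow_left₀ hγ (by linarith) 2
  have hcoef : (R₀ / b) ^ 5 * (π ^ 2 * r) ≤ π ^ 2 * S.q ^ 5 / r ^ 4 := by
    rw [div_pow, div_mul_eq_mul_div, div_le_div_iff₀ (by positivity) (by positivity)]
    have h1 : R₀ ^ 5 ≤ S.q ^ 5 := pow_le_pow_left₀ hR₀.le hRq 5
    have h2 : r ^ 5 ≤ b ^ 5 := pow_le_pow_left₀ hr0.le hr.2 5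
    calc R₀ ^ 5 * (π ^ 2 * r) * r ^ 4 = π ^ 2 * (R₀ ^ 5 * r ^ 5) := by ring
      _ ≤ π ^ 2 * (S.q ^ 5 * b ^ 5) := by gcongr
      _ = π ^ 2 * S.q ^ 5 * b ^ 5 := by ring
  calc (R₀ / b) ^ 5 * (π ^ 2 * r * S.γ r ^ 2) = (R₀ / b) ^ 5 * (π ^ 2 * r) * S.γ r ^ 2 := by ring
    _ ≤ π ^ 2 * S.q ^ 5 / r ^ 4 * rhoProfile (exp (S.γ r)) :=
        mul_le_mul hcoef hQ (sq_nonneg _) (by positivity)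

/-- Lower bound `p ≥ (R₀/b)⁵ (π²/3) r γ³` where `γ ≥ 0`. [folklore] -/
theorem p_ge {r : ℝ} (hr : r ∈ Icc R₀ b) (hγ : 0 ≤ S.γ r) :
    (R₀ / b) ^ 5 * (π ^ 2 / 3 * r * S.γ r ^ 3) ≤ S.p r := by
  have hR₀ : 0 < R₀ := by linarith
  have hr0 := pos_of_mem hM₀ hM hr
  have hb0 : 0 < b := hR₀.trans_le (hr.1.trans hr.2)
  have hq := S.q_pos hM₀ hM
  have hRq := S.R₀_le_q hM₀ hM
  rw [S.p_eq hM₀ hM hr]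
  have ht : 1 ≤ exp (S.γ r) := one_le_exp hγ
  have hP : S.γ r ^ 3 / 3 ≤ pProfile (exp (S.γ r)) := by
    refine le_trans ?_ (cube_le_pProfile _)
    rw [max_eq_left ht]
    have := add_one_le_exp (S.γ r)
    have := pow_le_pow_left₀ hγ (by linarith : S.γ r ≤ exp (S.γ r) - 1) 3
    linarith
  have hcoef : (R₀ / b) ^ 5 * (π ^ 2 * r) ≤ π ^ 2 * S.q ^ 5 / r ^ 4 := by
    rw [div_pow, div_mul_eq_mul_div, div_le_div_iff₀ (by positivity) (by positivity)]
    have h1 : R₀ ^ 5 ≤ S.q ^ 5 := pow_le_pow_left₀ hR₀.le hRq 5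
    have h2 : r ^ 5 ≤ b ^ 5 := pow_le_pow_left₀ hr0.le hr.2 5
    calc R₀ ^ 5 * (π ^ 2 * r) * r ^ 4 = π ^ 2 * (R₀ ^ 5 * r ^ 5) := by ring
      _ ≤ π ^ 2 * (S.q ^ 5 * b ^ 5) := by gcongr
      _ = π ^ 2 * S.q ^ 5 * b ^ 5 := by ring
  calc (R₀ / b) ^ 5 * (π ^ 2 / 3 * r * S.γ r ^ 3)
      = (R₀ / b) ^ 5 * (π ^ 2 * r) * (S.γ r ^ 3 / 3) := by ring
    _ ≤ π ^ 2 * S.q ^ 5 / r ^ 4 * pProfile (exp (S.γ r)) :=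
        mul_le_mul hcoef hP (by positivity) (by positivity)

/-- Upper bound `ρ ≤ (q/R₀)⁵ (b/R₀)⁵ π² r γ₊²`, `γ₊ = max γ 0`. [folklore] -/
theorem ρ_le {r : ℝ} (hr : r ∈ Icc R₀ b) :
    S.ρ r ≤ (S.q / R₀) ^ 5 * (b / R₀) ^ 5 * (π ^ 2 * r * max (S.γ r) 0 ^ 2) := by
  have hR₀ : 0 < R₀ := by linarith
  have hr0 := pos_of_mem hM₀ hM hr
  have hb0 : 0 < b := hR₀.trans_le (hr.1.trans hr.2)
  have hq := S.q_pos hM₀ hM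
  rw [S.ρ_eq hM₀ hM hr]
  set g := max (S.γ r) 0 with hg
  have hg0 : 0 ≤ g := le_max_right _ _
  have hgb : g ≤ log (b / R₀) := max_le ((S.γ_le_log hM₀ hM hr).trans
    (log_le_log (div_pos hr0 hR₀) (div_le_div_of_nonneg_right hr.2 hR₀.le))) (log_nonneg
      (by rw [le_div_iff₀ hR₀, one_mul]; exact hr.1.trans hr.2))
  -- `Q(e^γ) ≤ g² e^{5g} ≤ g² (b/R₀)⁵`
  have hmax : max (exp (S.γ r)) 1 = exp g := by
    rcases le_or_gt (S.γ r) 0 with h | h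
    · rw [hg, max_eq_right h, exp_zero, max_eq_right (exp_le_one_iff.mpr h)]
    · rw [hg, max_eq_left h.le, max_eq_left (one_le_exp h.le)]
  have hQ : rhoProfile (exp (S.γ r)) ≤ g ^ 2 * (b / R₀) ^ 5 := by
    refine (rhoProfile_le _).trans ?_
    rw [hmax]
    have h1 : exp g - 1 ≤ g * exp g := by nlinarith [Literature.Analysis.ODE.exp_sub_one_le_mul_exp g]
    have h2 : 0 ≤ exp g - 1 := by linarith [one_le_exp hg0]
    have h3 : exp g ≤ b / R₀ := by
      calc exp g ≤ exp (log (b / R₀)) := exp_le_exp.mpr hgb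
        _ = b / R₀ := exp_log (div_pos hb0 hR₀)
    calc (exp g - 1) ^ 2 * exp g ^ 3 ≤ (g * exp g) ^ 2 * exp g ^ 3 := by gcongr
      _ = g ^ 2 * exp g ^ 5 := by ring
      _ ≤ g ^ 2 * (b / R₀) ^ 5 := by gcongr
  have hcoef : π ^ 2 * S.q ^ 5 / r ^ 4 ≤ (S.q / R₀) ^ 5 * (π ^ 2 * r) := by
    rw [div_pow, div_mul_eq_mul_div, div_le_div_iff₀ (by positivity) (by positivity)]
    have h2 : R₀ ^ 5 ≤ r ^ 4 * r := by
      calc R₀ ^ 5 ≤ r ^ 5 := pow_le_pow_left₀ hR₀.le hr.1 5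
        _ = r ^ 4 * r := by ring
    calc π ^ 2 * S.q ^ 5 * R₀ ^ 5 ≤ π ^ 2 * S.q ^ 5 * (r ^ 4 * r) := by gcongr
      _ = S.q ^ 5 * (π ^ 2 * r) * r ^ 4 := by ring
  calc π ^ 2 * S.q ^ 5 / r ^ 4 * rhoProfile (exp (S.γ r))
      ≤ (S.q / R₀) ^ 5 * (π ^ 2 * r) * (g ^ 2 * (b / R₀) ^ 5) :=
        mul_le_mul hcoef hQ (rhoProfile_nonneg _) (by positivity)
    _ = (S.q / R₀) ^ 5 * (b / R₀) ^ 5 * (π ^ 2 * r * g ^ 2) := by ring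

/-- Upper bound `p ≤ (q/R₀)⁵ (b/R₀)⁵ (π²/3) r γ₊³`. [folklore] -/
theorem p_le {r : ℝ} (hr : r ∈ Icc R₀ b) :
    S.p r ≤ (S.q / R₀) ^ 5 * (b / R₀) ^ 5 * (π ^ 2 / 3 * r * max (S.γ r) 0 ^ 3) := by
  have hR₀ : 0 < R₀ := by linarith
  have hr0 := pos_of_mem hM₀ hM hr
  have hb0 : 0 < b := hR₀.trans_le (hr.1.trans hr.2)
  have hq := S.q_pos hM₀ hM
  rw [S.p_eq hM₀ hM hr]
  set g := max (S.γ r) 0 with hg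
  have hg0 : 0 ≤ g := le_max_right _ _
  have hgb : g ≤ log (b / R₀) := max_le ((S.γ_le_log hM₀ hM hr).trans
    (log_le_log (div_pos hr0 hR₀) (div_le_div_of_nonneg_right hr.2 hR₀.le))) (log_nonneg
      (by rw [le_div_iff₀ hR₀, one_mul]; exact hr.1.trans hr.2))
  have hmax : max (exp (S.γ r)) 1 = exp g := by
    rcases le_or_gt (S.γ r) 0 with h | h
    · rw [hg, max_eq_right h, exp_zero, max_eq_right (exp_le_one_iff.mpr h)]
    · rw [hg, max_eq_left h.le, max_eq_left (one_le_exp h.le)]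
  have hP : pProfile (exp (S.γ r)) ≤ g ^ 3 * (b / R₀) ^ 5 / 3 := by
    refine (pProfile_le _).trans ?_
    rw [hmax]
    have h1 : exp g - 1 ≤ g * exp g := by nlinarith [Literature.Analysis.ODE.exp_sub_one_le_mul_exp g]
    have h2 : 0 ≤ exp g - 1 := by linarith [one_le_exp hg0]
    have h3 : exp g ≤ b / R₀ := by
      calc exp g ≤ exp (log (b / R₀)) := exp_le_exp.mpr hgb
        _ = b / R₀ := exp_log (div_pos hb0 hR₀)
    have : (exp g - 1) ^ 3 * exp g ^ 2 ≤ g ^ 3 * (b / R₀) ^ 5 := by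
      calc (exp g - 1) ^ 3 * exp g ^ 2 ≤ (g * exp g) ^ 3 * exp g ^ 2 := by gcongr
        _ = g ^ 3 * exp g ^ 5 := by ring
        _ ≤ g ^ 3 * (b / R₀) ^ 5 := by gcongr
    linarith
  have hcoef : π ^ 2 * S.q ^ 5 / r ^ 4 ≤ (S.q / R₀) ^ 5 * (π ^ 2 * r) := by
    rw [div_pow, div_mul_eq_mul_div, div_le_div_iff₀ (by positivity) (by positivity)]
    have h2 : R₀ ^ 5 ≤ r ^ 4 * r := by
      calc R₀ ^ 5 ≤ r ^ 5 := pow_le_pow_left₀ hR₀.le hr.1 5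
        _ = r ^ 4 * r := by ring
    calc π ^ 2 * S.q ^ 5 * R₀ ^ 5 ≤ π ^ 2 * S.q ^ 5 * (r ^ 4 * r) := by gcongr
      _ = S.q ^ 5 * (π ^ 2 * r) * r ^ 4 := by ring
  calc π ^ 2 * S.q ^ 5 / r ^ 4 * pProfile (exp (S.γ r))
      ≤ (S.q / R₀) ^ 5 * (π ^ 2 * r) * (g ^ 3 * (b / R₀) ^ 5 / 3) :=
        mul_le_mul hcoef hP (pProfile_nonneg _) (by positivity)
    _ = (S.q / R₀) ^ 5 * (b / R₀) ^ 5 * (π ^ 2 / 3 * r * g ^ 3) := by ring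

/-! ### Layer 1: the amplification factors and `γ₊ ≤ (r - R₀)/R₀` -/

/-- `Λ = (q/R₀)⁵ (b/R₀)⁵ ≥ 1`, the upper amplification factor. [folklore] -/
def Lam (_ : ReducedSolution M₀ R₀ b) : ℝ := (shellQ M₀ R₀ / R₀) ^ 5 * (b / R₀) ^ 5

/-- `λ = (R₀/b)⁵ ≤ 1`, the lower amplification factor. [folklore] -/
def lam (_ : ReducedSolution M₀ R₀ b) : ℝ := (R₀ / b) ^ 5

omit hM₀ hM in
/-- Unfolding of `Λ`. [folklore] -/
theorem Lam_def : S.Lam = (S.q / R₀) ^ 5 * (b / R₀) ^ 5 := rfl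

omit hM₀ hM in
/-- Unfolding of `λ`. [folklore] -/
theorem lam_def : S.lam = (R₀ / b) ^ 5 := rfl

/-- `Λ > 0`. [folklore] -/
theorem Lam_pos (hb : R₀ ≤ b) : 0 < S.Lam := by
  have hR₀ : 0 < R₀ := by linarith
  have := S.q_pos hM₀ hM
  have : 0 < b := hR₀.trans_le hb
  rw [Lam_def]; positivity

/-- `λ > 0`. [folklore] -/
theorem lam_pos (hb : R₀ ≤ b) : 0 < S.lam := by
  have hR₀ : 0 < R₀ := by linarith
  have : 0 < b := hR₀.trans_le hb
  rw [lam_def]; positivity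

/-- `γ₊ ≤ (r - R₀)/R₀` (from `γ ≤ log(r/R₀) ≤ r/R₀ - 1`). [folklore] -/
theorem γpos_le {r : ℝ} (hr : r ∈ Icc R₀ b) : max (S.γ r) 0 ≤ (r - R₀) / R₀ := by
  have hR₀ : 0 < R₀ := by linarith
  have hr0 := pos_of_mem hM₀ hM hr
  refine max_le ((S.γ_le_log hM₀ hM hr).trans ?_) (div_nonneg (by linarith [hr.1]) hR₀.le)
  have := log_le_sub_one_of_pos (div_pos hr0 hR₀)
  rw [div_sub_one hR₀.ne'] at this
  exact this

/-- `ρ ≤ Λ π² r ((r-R₀)/R₀)²` (crude bound used on thin slabs). [folklore] -/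
theorem ρ_le' {r : ℝ} (hr : r ∈ Icc R₀ b) :
    S.ρ r ≤ S.Lam * (π ^ 2 * r * ((r - R₀) / R₀) ^ 2) := by
  have hr0 := pos_of_mem hM₀ hM hr
  refine (S.ρ_le hM₀ hM hr).trans ?_
  rw [Lam_def]
  have h := S.γpos_le hM₀ hM hr
  have h0 : 0 ≤ max (S.γ r) 0 := le_max_right _ _
  have hR₀ : 0 < R₀ := by linarith
  have : 0 < b := hR₀.trans_le (hr.1.trans hr.2)
  have := S.q_pos hM₀ hM
  gcongr

/-- `p ≤ Λ (π²/3) r ((r-R₀)/R₀)³`. [folklore] -/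
theorem p_le' {r : ℝ} (hr : r ∈ Icc R₀ b) :
    S.p r ≤ S.Lam * (π ^ 2 / 3 * r * ((r - R₀) / R₀) ^ 3) := by
  have hr0 := pos_of_mem hM₀ hM hr
  refine (S.p_le hM₀ hM hr).trans ?_
  rw [Lam_def]
  have h := S.γpos_le hM₀ hM hr
  have h0 : 0 ≤ max (S.γ r) 0 := le_max_right _ _
  have hR₀ : 0 < R₀ := by linarith
  have : 0 < b := hR₀.trans_le (hr.1.trans hr.2)
  have := S.q_pos hM₀ hM
  gcongr

/-! ### Layer 2: Lemma 4.1 — `γ' ≥ 1/(2r)` on `[R₀, R₀ + δ]` -/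

/-- Mass bound on the first slab: `m(r) ≤ M₀ + (Λ/5) b³/R₀²` for `r ∈ [R₀, R₀ + δ]`. [folklore] -/
theorem m_le_on_I₁ (hb : R₀ + shellDelta ≤ b) {r : ℝ} (hr : r ∈ Icc R₀ (R₀ + shellDelta)) :
    S.m r ≤ M₀ + S.Lam / 5 * b ^ 3 / R₀ ^ 2 := by
  have hR₀ : 0 < R₀ := by linarith
  have hδ := shellDelta_pos
  have hb0 : 0 < b := by linarith
  have hΛ := S.Lam_pos hM₀ hM (by linarith)
  set K : ℝ := 4 * π ^ 3 * S.Lam * b ^ 3 * shellDelta ^ 2 / R₀ ^ 2 with hK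
  have hsub : Icc R₀ (R₀ + shellDelta) ⊆ Icc R₀ b := Icc_subset_Icc le_rfl hb
  have hderiv : ∀ x ∈ Ico R₀ (R₀ + shellDelta),
      HasDerivWithinAt S.m (4 * π * x ^ 2 * S.ρ x) (Ici x) x := fun x hx =>
    hasDerivWithinAt_Ici_of_Icc S.hasDerivWithinAt_m x ⟨hx.1, hx.2.trans_le hb⟩
  have hbound : ∀ x ∈ Ico R₀ (R₀ + shellDelta), 4 * π * x ^ 2 * S.ρ x ≤ K := by
    intro x hx
    have hx' : x ∈ Icc R₀ b := ⟨hx.1, (hx.2.trans_le hb).le⟩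
    have hx0 := pos_of_mem hM₀ hM hx'
    have h1 := S.ρ_le' hM₀ hM hx'
    have h2 : (x - R₀) / R₀ ≤ shellDelta / R₀ :=
      div_le_div_of_nonneg_right (by linarith [hx.2]) hR₀.le
    have h3 : 0 ≤ (x - R₀) / R₀ := div_nonneg (by linarith [hx.1]) hR₀.le
    have hxb : x ≤ b := hx'.2
    calc 4 * π * x ^ 2 * S.ρ x ≤ 4 * π * x ^ 2 * (S.Lam * (π ^ 2 * x * (shellDelta / R₀) ^ 2)) := by
          gcongr
          calc S.ρ x ≤ S.Lam * (π ^ 2 * x * ((x - R₀) / R₀) ^ 2) := h1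
            _ ≤ S.Lam * (π ^ 2 * x * (shellDelta / R₀) ^ 2) := by gcongr
      _ = 4 * π ^ 3 * S.Lam * x ^ 3 * shellDelta ^ 2 / R₀ ^ 2 := by ring
      _ ≤ K := by rw [hK]; gcongr
  have h := Literature.Analysis.ODE.sub_le_mul_of_deriv_right_le
    ((S.continuousOn_m).mono hsub) hderiv hbound r hr
  rw [S.m_R₀] at h
  have hKδ : K * (r - R₀) ≤ S.Lam / 5 * b ^ 3 / R₀ ^ 2 := by
    calc K * (r - R₀) ≤ K * shellDelta :=
          mul_le_mul_of_nonneg_left (by linarith [hr.2]) (by positivity)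
      _ = S.Lam / 5 * b ^ 3 / R₀ ^ 2 * (20 * (π ^ 3 * shellDelta ^ 3)) := by rw [hK]; ring
      _ = S.Lam / 5 * b ^ 3 / R₀ ^ 2 := by rw [pi_pow_three_mul_shellDelta_pow_three]; ring
  linarith

/-- **Lemma 4.1** (Andréasson 2021): under the smallness condition
`4M₀/R₀ + (14/15) Λ (b/R₀)³ ≤ 1`, `γ' ≥ 1/(2r)` on `[R₀, R₀ + δ]`.
[cite: Andreasson2021, Lemma 4.1] -/
theorem L41 (hb : R₀ + shellDelta ≤ b)
    (hA : 4 * M₀ / R₀ + 14 / 15 * S.Lam * (b / R₀) ^ 3 ≤ 1) {r : ℝ}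
    (hr : r ∈ Icc R₀ (R₀ + shellDelta)) :
    1 / (2 * r) ≤ 1 / r - (S.m r + 4 * π * r ^ 3 * S.p r) / (r * (r - 2 * S.m r)) := by
  have hR₀ : 0 < R₀ := by linarith
  have hδ := shellDelta_pos
  have hb0 : 0 < b := by linarith
  have hr' : r ∈ Icc R₀ b := ⟨hr.1, hr.2.trans hb⟩
  have hr0 := pos_of_mem hM₀ hM hr'
  have hΛ := S.Lam_pos hM₀ hM (by linarith)
  have hm := S.m_le_on_I₁ hM₀ hM hb hr
  have hmpos := S.m_pos hM₀ hM hr'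
  have hp0 := S.p_nonneg hM₀ hM hr'
  have hden := S.sub_two_mul_m_pos hr'
  -- `Π = 4π r² p ≤ (Λ/15)(b/R₀)³`
  have hPi : 4 * π * r ^ 2 * S.p r ≤ S.Lam / 15 * (b / R₀) ^ 3 := by
    have h1 := S.p_le' hM₀ hM hr'
    have h2 : (r - R₀) / R₀ ≤ shellDelta / R₀ :=
      div_le_div_of_nonneg_right (by linarith [hr.2]) hR₀.le
    have h3 : 0 ≤ (r - R₀) / R₀ := div_nonneg (by linarith [hr.1]) hR₀.le
    calc 4 * π * r ^ 2 * S.p r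
        ≤ 4 * π * r ^ 2 * (S.Lam * (π ^ 2 / 3 * r * (shellDelta / R₀) ^ 3)) := by
          gcongr
          exact h1.trans (by gcongr)
      _ = S.Lam / 15 * (r / R₀) ^ 3 * (20 * (π ^ 3 * shellDelta ^ 3)) := by
          field_simp
          ring
      _ = S.Lam / 15 * (r / R₀) ^ 3 := by rw [pi_pow_three_mul_shellDelta_pow_three]; ring
      _ ≤ S.Lam / 15 * (b / R₀) ^ 3 := by gcongr; exact hr'.2
  -- `4 m + 8 π r³ p ≤ r`
  have hY : 4 * S.m r / r ≤ 4 * M₀ / R₀ + 4 / 5 * S.Lam * (b / R₀) ^ 3 := by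
    calc 4 * S.m r / r ≤ 4 * S.m r / R₀ := by
          exact div_le_div_of_nonneg_left (by positivity) hR₀ hr.1
      _ ≤ 4 * (M₀ + S.Lam / 5 * b ^ 3 / R₀ ^ 2) / R₀ := by gcongr
      _ = 4 * M₀ / R₀ + 4 / 5 * S.Lam * (b / R₀) ^ 3 := by
          field_simp
  have hkey : 4 * S.m r + 8 * π * r ^ 3 * S.p r ≤ r := by
    have e1 : 4 * S.m r / r + 2 * (4 * π * r ^ 2 * S.p r) ≤ 1 := by linarith
    have e2 : (4 * S.m r + 8 * π * r ^ 3 * S.p r) / r = 4 * S.m r / r + 2 * (4 * π * r ^ 2 * S.p r) := by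
      field_simp
      ring
    rw [← e2, div_le_one hr0] at e1
    exact e1
  -- conclude
  have : (S.m r + 4 * π * r ^ 3 * S.p r) / (r * (r - 2 * S.m r)) ≤ 1 / (2 * r) := by
    rw [div_le_div_iff₀ (by positivity) (by positivity)]
    nlinarith
  have e : 1 / r - 1 / (2 * r) = 1 / (2 * r) := by field_simp; ring
  linarith

/-- Consequence of Lemma 4.1: `γ(r) ≥ (r - R₀)/(2(R₀+δ))` on `[R₀, R₀ + δ]`.
[cite: Andreasson2021, display after Lemma 4.1 (γ(R₀+σ) ≥ σ/(2(R₀+σ)))] -/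
theorem γ_ge_on_I₁ (hb : R₀ + shellDelta ≤ b)
    (hA : 4 * M₀ / R₀ + 14 / 15 * S.Lam * (b / R₀) ^ 3 ≤ 1) {r : ℝ}
    (hr : r ∈ Icc R₀ (R₀ + shellDelta)) :
    (r - R₀) / (2 * (R₀ + shellDelta)) ≤ S.γ r := by
  have hR₀ : 0 < R₀ := by linarith
  have hδ := shellDelta_pos
  have hsub : Icc R₀ (R₀ + shellDelta) ⊆ Icc R₀ b := Icc_subset_Icc le_rfl hb
  have hderiv : ∀ x ∈ Ico R₀ (R₀ + shellDelta), HasDerivWithinAt S.γ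
      (1 / x - (S.m x + 4 * π * x ^ 3 * S.p x) / (x * (x - 2 * S.m x))) (Ici x) x := fun x hx =>
    hasDerivWithinAt_Ici_of_Icc (fun y hy => S.hasDerivWithinAt_γ hM₀ hM hy) x
      ⟨hx.1, hx.2.trans_le hb⟩
  have hbound : ∀ x ∈ Ico R₀ (R₀ + shellDelta), 1 / (2 * (R₀ + shellDelta)) ≤
      1 / x - (S.m x + 4 * π * x ^ 3 * S.p x) / (x * (x - 2 * S.m x)) := by
    intro x hx
    have hx0 : 0 < x := by linarith [hx.1]
    refine le_trans ?_ (S.L41 hM₀ hM hb hA (Ico_subset_Icc_self hx))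
    gcongr
    exact hx.2.le
  have hcont : ContinuousOn S.γ (Icc R₀ (R₀ + shellDelta)) := fun x hx =>
    ((S.hasDerivWithinAt_γ hM₀ hM (hsub hx)).continuousWithinAt).mono hsub
  have h := Literature.Analysis.ODE.mul_le_sub_of_le_deriv_right hcont hderiv hbound r hr
  rw [S.γ_R₀, sub_zero] at h
  calc (r - R₀) / (2 * (R₀ + shellDelta)) = 1 / (2 * (R₀ + shellDelta)) * (r - R₀) := by ring
    _ ≤ S.γ r := h

/-! ### Layer 3: Lemma 4.3 — first return to the level `γ_*` -/

/-- `γ_* = δ/(2(R₀+δ))`.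
[cite: Andreasson2021, §4, definition of γ_* (σ_* = δ)] -/
def gammaStar (R₀ : ℝ) : ℝ := shellDelta / (2 * (R₀ + shellDelta))

omit hM₀ hM in
/-- `γ_* > 0`. [folklore] -/
theorem gammaStar_pos (hR₀ : 0 < R₀) : 0 < gammaStar R₀ := by
  unfold gammaStar; have := shellDelta_pos; positivity

/-- **Lemma 4.3** (Andréasson 2021, with `2m/r < 1` in place of the Buchdahl bound `8/9`):
`γ` returns to the level `γ_*` at a radius `r₂ ≤ R₀ + 12δ`, approaching it from above, so that
`γ'(r₂) ≤ 0`, i.e. `1 ≤ 3m(r₂)/r₂ + 4π r₂² p(r₂)`.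
[cite: Andreasson2021, Lemma 4.3] -/
theorem L43 (hb : R₀ + 12 * shellDelta ≤ b)
    (hA : 4 * M₀ / R₀ + 14 / 15 * S.Lam * (b / R₀) ^ 3 ≤ 1)
    (hB : R₀ + 12 * shellDelta ≤ 11 / 10 * S.lam * (R₀ + shellDelta)) :
    ∃ r₂ ∈ Icc (R₀ + shellDelta) (R₀ + 12 * shellDelta), S.γ r₂ = gammaStar R₀ ∧
      (∀ r ∈ Icc (R₀ + shellDelta) r₂, gammaStar R₀ ≤ S.γ r) ∧
      1 ≤ 3 * S.m r₂ / r₂ + 4 * π * r₂ ^ 2 * S.p r₂ := by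
  have hR₀ : 0 < R₀ := by linarith
  have hδ := shellDelta_pos
  have hb1 : R₀ + shellDelta ≤ b := by linarith
  have hlam := S.lam_pos hM₀ hM (by linarith)
  have hγs := gammaStar_pos hR₀
  -- Step 1
  have hγδ : gammaStar R₀ ≤ S.γ (R₀ + shellDelta) := by
    have := S.γ_ge_on_I₁ hM₀ hM hb1 hA (right_mem_Icc.mpr (by linarith))
    rw [gammaStar]
    convert this using 2
    ring
  -- Step 2: `γ` must dip below `γ_*` before `R₀ + 12δ`
  have hex : ∃ x ∈ Icc (R₀ + shellDelta) (R₀ + 12 * shellDelta), S.γ x < gammaStar R₀ := by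
    by_contra hall
    push Not at hall
    set K : ℝ := 4 * π ^ 3 * S.lam * (R₀ + shellDelta) ^ 3 * gammaStar R₀ ^ 2 with hK
    have hsub : Icc (R₀ + shellDelta) (R₀ + 12 * shellDelta) ⊆ Icc R₀ b :=
      Icc_subset_Icc (by linarith) hb
    have hderiv : ∀ x ∈ Ico (R₀ + shellDelta) (R₀ + 12 * shellDelta),
        HasDerivWithinAt S.m (4 * π * x ^ 2 * S.ρ x) (Ici x) x := fun x hx =>
      hasDerivWithinAt_Ici_of_Icc S.hasDerivWithinAt_m x ⟨by linarith [hx.1], hx.2.trans_le hb⟩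
    have hbound : ∀ x ∈ Ico (R₀ + shellDelta) (R₀ + 12 * shellDelta), K ≤ 4 * π * x ^ 2 * S.ρ x := by
      intro x hx
      have hx' : x ∈ Icc R₀ b := hsub (Ico_subset_Icc_self hx)
      have hx0 := pos_of_mem hM₀ hM hx'
      have hγx : gammaStar R₀ ≤ S.γ x := hall x (Ico_subset_Icc_self hx)
      have hγ0 : 0 ≤ S.γ x := hγs.le.trans hγx
      have h1 := S.ρ_ge hM₀ hM hx' hγ0
      rw [← lam_def] at h1
      have h2 : S.lam * (π ^ 2 * (R₀ + shellDelta) * gammaStar R₀ ^ 2) ≤ S.ρ x := by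
        refine le_trans ?_ h1
        gcongr
        · exact hx.1
      calc K = 4 * π * (R₀ + shellDelta) ^ 2 * (S.lam * (π ^ 2 * (R₀ + shellDelta) * gammaStar R₀ ^ 2)) := by
            rw [hK]; ring
        _ ≤ 4 * π * x ^ 2 * S.ρ x := by gcongr; exact hx.1
    have h := Literature.Analysis.ODE.mul_le_sub_of_le_deriv_right
      ((S.continuousOn_m).mono hsub) hderiv hbound (R₀ + 12 * shellDelta)
      (right_mem_Icc.mpr (by linarith))
    have hm1 : M₀ ≤ S.m (R₀ + shellDelta) := S.le_m hM₀ hM (hsub (left_mem_Icc.mpr (by linarith)))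
    have hKδ : K * (R₀ + 12 * shellDelta - (R₀ + shellDelta)) = 11 / 20 * S.lam * (R₀ + shellDelta) := by
      have hne : R₀ + shellDelta ≠ 0 := by positivity
      have e1 : K * (R₀ + 12 * shellDelta - (R₀ + shellDelta)) =
          11 * (π ^ 3 * shellDelta ^ 3) * S.lam * (R₀ + shellDelta) := by
        rw [hK, gammaStar]
        field_simp
        ring
      rw [e1, pi_pow_three_mul_shellDelta_pow_three]
      ring
    have hlt := S.two_mul_m_lt (R₀ + 12 * shellDelta) (hsub (right_mem_Icc.mpr (by linarith)))
    rw [hKδ] at h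
    linarith
  -- Step 3: the first passage below `γ_*` on `[R₀ + δ, b]`
  have hsub' : Icc (R₀ + shellDelta) b ⊆ Icc R₀ b := Icc_subset_Icc (by linarith) le_rfl
  have hcont : ContinuousOn S.γ (Icc (R₀ + shellDelta) b) := fun x hx =>
    ((S.hasDerivWithinAt_γ hM₀ hM (hsub' hx)).continuousWithinAt).mono hsub'
  obtain ⟨x₀, hx₀, hγx₀⟩ := hex
  obtain ⟨r₂, hr₂, hγr₂, hge, hfreq, hmin⟩ := exists_first_lt hcont hγδ
    ⟨x₀, ⟨hx₀.1, hx₀.2.trans hb⟩, hγx₀⟩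
  have hr₂' : r₂ ≤ R₀ + 12 * shellDelta := (hmin x₀ ⟨hx₀.1, hx₀.2.trans hb⟩ hγx₀).trans hx₀.2
  refine ⟨r₂, ⟨hr₂.1, hr₂'⟩, hγr₂, hge, ?_⟩
  -- Step 4: `γ'(r₂) ≤ 0`
  have hr₂b : r₂ ∈ Icc R₀ b := hsub' hr₂
  have hr0 := pos_of_mem hM₀ hM hr₂b
  have hd := (S.hasDerivWithinAt_γ hM₀ hM hr₂b).mono hsub'
  have hneg := deriv_nonpos_of_frequently_lt hd (fun ε hε => by
    obtain ⟨x, hx, h1, h2, h3⟩ := hfreq ε hε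
    exact ⟨x, hx, h1, h2, by rw [hγr₂]; exact h3⟩)
  have hden := S.sub_two_mul_m_pos hr₂b
  have hp := S.p_nonneg hM₀ hM hr₂b
  have key : r₂ - 2 * S.m r₂ ≤ S.m r₂ + 4 * π * r₂ ^ 3 * S.p r₂ := by
    have h1 : 1 / r₂ ≤ (S.m r₂ + 4 * π * r₂ ^ 3 * S.p r₂) / (r₂ * (r₂ - 2 * S.m r₂)) := by linarith
    rw [div_le_div_iff₀ hr0 (by positivity)] at h1
    nlinarith
  have e : 3 * S.m r₂ / r₂ + 4 * π * r₂ ^ 2 * S.p r₂ = (3 * S.m r₂ + 4 * π * r₂ ^ 3 * S.p r₂) / r₂ := by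
    field_simp
  rw [e, le_div_iff₀ hr0]
  linarith

/-! ### Layer 4a: the TOV structure of the closed forms (`t P'(t) = P(t) + Q(t)`) -/

omit hM₀ hM in
/-- The polynomial `P` has derivative `(t²-1)²/4`. [folklore] -/
theorem hasDerivAt_pPoly (t : ℝ) :
    HasDerivAt (fun t : ℝ => (3 * t ^ 5 - 10 * t ^ 3 + 15 * t - 8) / 60) ((t ^ 2 - 1) ^ 2 / 4) t := by
  have h := ((((hasDerivAt_pow 5 t).const_mul 3).sub ((hasDerivAt_pow 3 t).const_mul 10)).add
    ((hasDerivAt_id' t).const_mul 15)).sub_const 8 |>.div_const 60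
  refine h.congr_deriv ?_
  push_cast
  ring

/-- `p` is continuous on `[R₀, b]`. [folklore] -/
theorem continuousOn_p : ContinuousOn S.p (Icc R₀ b) := by
  have hq := S.q_pos hM₀ hM
  have h1 : ContinuousOn (fun r => (r, S.μ r)) (Icc R₀ b) :=
    continuousOn_id.prodMk S.continuousOn_μ
  have := (continuousOn_pHat (q := S.q)).comp h1 (fun r hr => ⟨pos_of_mem hM₀ hM hr, mem_univ _⟩)
  exact this

/-- `ρ` is continuous on `[R₀, b]`. [folklore] -/
theorem continuousOn_ρ : ContinuousOn S.ρ (Icc R₀ b) := by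
  have hq := S.q_pos hM₀ hM
  have h1 : ContinuousOn (fun r => (r, S.μ r)) (Icc R₀ b) :=
    continuousOn_id.prodMk S.continuousOn_μ
  have := (continuousOn_rhoHat (q := S.q)).comp h1 (fun r hr => ⟨pos_of_mem hM₀ hM hr, mem_univ _⟩)
  exact this

/-- **The massless TOV equation for the closed forms**: at an interior point where `γ > 0`,
`p' = -4p/r + (p + ρ) γ'` (`= -μ'(ρ + p) - (3p - ρ)/r`).
[cite: Andreasson2021, §4 (generalized Oppenheimer–Tolman–Volkov equation, massless case p + 2p_T = ρ)] -/
theorem hasDerivAt_p {x : ℝ} (hx : x ∈ Ioo R₀ b) (hγ : 0 < S.γ x) :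
    HasDerivAt S.p (-(4 * S.p x) / x + (S.p x + S.ρ x) *
      (1 / x - (S.m x + 4 * π * x ^ 3 * S.p x) / (x * (x - 2 * S.m x)))) x := by
  have hx' : x ∈ Icc R₀ b := Ioo_subset_Icc_self hx
  have hx0 := pos_of_mem hM₀ hM hx'
  have hq := S.q_pos hM₀ hM
  set μ' := (S.m x + 4 * π * x ^ 3 * S.p x) / (x * (x - 2 * S.m x)) with hμ'
  have hγd : HasDerivAt S.γ (1 / x - μ') x :=
    (S.hasDerivWithinAt_γ hM₀ hM hx').hasDerivAt (Icc_mem_nhds hx.1 hx.2)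
  set t := exp (S.γ x) with ht
  have ht1 : 1 < t := by rw [ht]; exact one_lt_exp_iff.mpr hγ
  have hexp : HasDerivAt (fun r => exp (S.γ r)) (t * (1 / x - μ')) x := by
    simpa [ht] using hγd.exp
  have hP := (hasDerivAt_pPoly t).comp x hexp
  have hC : HasDerivAt (fun r : ℝ => π ^ 2 * S.q ^ 5 / r ^ 4) (-(4 * (π ^ 2 * S.q ^ 5)) / x ^ 5) x := by
    have h := (hasDerivAt_const x (π ^ 2 * S.q ^ 5)).div (hasDerivAt_pow 4 x) (pow_ne_zero 4 hx0.ne')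
    refine h.congr_deriv ?_
    field_simp
    push_cast
    ring
  have hprod := hC.mul hP
  -- `S.p` agrees with the smooth expression near `x`
  have hev : ∀ᶠ r in 𝓝 x, 0 < S.γ r ∧ r ∈ Ioo R₀ b :=
    (hγd.continuousAt.eventually (lt_mem_nhds hγ)).and (Ioo_mem_nhds hx.1 hx.2)
  have heq : (fun r => π ^ 2 * S.q ^ 5 / r ^ 4 *
      ((fun t : ℝ => (3 * t ^ 5 - 10 * t ^ 3 + 15 * t - 8) / 60) ∘ fun r => exp (S.γ r)) r) =ᶠ[𝓝 x]
      S.p := by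
    filter_upwards [hev] with r hr
    rw [S.p_eq hM₀ hM (Ioo_subset_Icc_self hr.2), Function.comp,
      pProfile_eq_of_one_le (one_le_exp hr.1.le)]
  have hfinal := hprod.congr_of_eventuallyEq heq.symm
  refine hfinal.congr_deriv ?_
  -- algebra: use `t P'(t) = P(t) + Q(t)`
  have hpx : S.p x = π ^ 2 * S.q ^ 5 / x ^ 4 * ((3 * t ^ 5 - 10 * t ^ 3 + 15 * t - 8) / 60) := by
    rw [S.p_eq hM₀ hM hx', pProfile_eq_of_one_le ht1.le]
  have hρx : S.ρ x = π ^ 2 * S.q ^ 5 / x ^ 4 * ((3 * t ^ 5 - 5 * t ^ 3 + 2) / 15) := by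
    rw [S.ρ_eq hM₀ hM hx', rhoProfile_eq_of_one_le ht1.le]
  rw [hpx, hρx]
  simp only [Function.comp]
  field_simp
  ring

/-! ### Layer 4b: the monotone quantity `Z = e^{μ}(m + 4πr³p)/√w + 2R₀e^{μ(R₀)}√w` -/

/-- The Buchdahl-type functional of [A0]/[A1]: `Z(r) = e^{μ}(m + 4πr³p)/√w + 2R₀ e^{μ(R₀)} √w`.
[cite: Andreasson2021, §4, proof of Lemma 4.4, the "fundamental equation" display (from [A0], eq. (10))] -/
def Z (r : ℝ) : ℝ :=
  exp (S.μ r) * (S.m r + 4 * π * r ^ 3 * S.p r) / √(S.w r) + 2 * R₀ * exp (S.μ R₀) * √(S.w r)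

/-- `w` is continuous on `[R₀, b]`. [folklore] -/
theorem continuousOn_w : ContinuousOn S.w (Icc R₀ b) := by
  refine ContinuousOn.sub continuousOn_const (ContinuousOn.div ?_ continuousOn_id fun r hr => ?_)
  · exact continuousOn_const.mul S.continuousOn_m
  · exact (pos_of_mem hM₀ hM hr).ne'

/-- `Z` is continuous on `[R₀, b]`. [folklore] -/
theorem continuousOn_Z : ContinuousOn S.Z (Icc R₀ b) := by
  have hsq : ContinuousOn (fun r => √(S.w r)) (Icc R₀ b) :=
    (S.continuousOn_w hM₀ hM).sqrt
  refine ContinuousOn.add (ContinuousOn.div (ContinuousOn.mul ?_ ?_) hsq fun r hr => ?_) ?_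
  · exact S.continuousOn_μ.rexp
  · exact S.continuousOn_m.add ((continuousOn_const.mul (continuousOn_id.pow 3)).mul
      (S.continuousOn_p hM₀ hM))
  · exact (Real.sqrt_pos.mpr (S.w_pos hM₀ hM hr)).ne'
  · exact continuousOn_const.mul hsq

/-- `Z' = [8πxρ (x e^{μ} - R₀ e^{μ(R₀)}) + 2R₀ e^{μ(R₀)} m/x²]/√w ≥ 0` at interior points with
`γ > 0` (the integrated form of the TOV equation, Andréasson 2021, proof of Lemma 4.4, "fundamental
equation").
[cite: Andreasson2021, §4, proof of Lemma 4.4, the "fundamental equation" display and the one following it] -/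
theorem hasDerivAt_Z {x : ℝ} (hx : x ∈ Ioo R₀ b) (hγ : 0 < S.γ x) :
    HasDerivAt S.Z ((8 * π * x * S.ρ x * (x * exp (S.μ x) - R₀ * exp (S.μ R₀)) +
      2 * R₀ * exp (S.μ R₀) * S.m x / x ^ 2) / √(S.w x)) x := by
  have hx' : x ∈ Icc R₀ b := Ioo_subset_Icc_self hx
  have hx0 := pos_of_mem hM₀ hM hx'
  have hnhds : Icc R₀ b ∈ 𝓝 x := Icc_mem_nhds hx.1 hx.2
  have hμ := (S.hasDerivWithinAt_μ' hx').hasDerivAt hnhds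
  have hm := (S.hasDerivWithinAt_m' hx').hasDerivAt hnhds
  have hw := (S.hasDerivWithinAt_w hM₀ hM hx').hasDerivAt hnhds
  have hp := S.hasDerivAt_p hM₀ hM hx hγ
  have hwpos := S.w_pos hM₀ hM hx'
  set sw := √(S.w x) with hsw
  have hsw0 : 0 < sw := Real.sqrt_pos.mpr hwpos
  have hsw2 : sw ^ 2 = S.w x := Real.sq_sqrt hwpos.le
  have hrel : x - 2 * S.m x = x * sw ^ 2 := by rw [hsw2]; exact S.sub_two_mul_m_eq hM₀ hM hx'
  have hE := hμ.exp
  have hN := hm.add (((hasDerivAt_pow 3 x).mul hp).const_mul (4 * π))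
  have hs : HasDerivAt (fun r => √(S.w r)) ((-(8 * π * x * S.ρ x) + 2 * S.m x / x ^ 2) / (2 * sw)) x := by
    have := hw.sqrt hwpos.ne'
    simpa [hsw] using this
  have hA := (hE.mul hN).div hs hsw0.ne'
  have hB := hs.const_mul (2 * R₀ * exp (S.μ R₀))
  have hZ' := hA.add hB
  have hfun : S.Z = fun r => (fun y => exp (S.μ y) * (S.m y + 4 * π * (y ^ 3 * S.p y))) r / √(S.w r) +
      2 * R₀ * exp (S.μ R₀) * √(S.w r) := by
    funext r; simp only [Z]; ring
  rw [hfun]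
  refine hZ'.congr_deriv ?_
  simp only [Pi.add_apply, Pi.mul_apply, ← hsw, Nat.cast_ofNat]
  rw [hrel]
  norm_num
  field_simp
  ring

/-- `Z' ≥ 0`. [folklore] -/
theorem Z_deriv_nonneg {x : ℝ} (hx : x ∈ Icc R₀ b) :
    0 ≤ (8 * π * x * S.ρ x * (x * exp (S.μ x) - R₀ * exp (S.μ R₀)) +
      2 * R₀ * exp (S.μ R₀) * S.m x / x ^ 2) / √(S.w x) := by
  have hR₀ : 0 < R₀ := by linarith
  have hx0 := pos_of_mem hM₀ hM hx
  have hρ := S.ρ_nonneg hM₀ hM hx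
  have hm := S.m_pos hM₀ hM hx
  have h1 : R₀ * exp (S.μ R₀) ≤ x * exp (S.μ x) :=
    mul_le_mul hx.1 (exp_le_exp.mpr (S.μ_R₀_le hM₀ hM hx)) (exp_pos _).le hx0.le
  have h2 : 0 ≤ x * exp (S.μ x) - R₀ * exp (S.μ R₀) := by linarith
  positivity

/-- `Z(R₀) ≤ Z(r₂)` provided `γ > 0` on `(R₀, r₂)`. [folklore] -/
theorem Z_R₀_le {r₂ : ℝ} (hr₂ : r₂ ∈ Icc R₀ b) (hpos : ∀ x ∈ Ioo R₀ r₂, 0 < S.γ x) :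
    S.Z R₀ ≤ S.Z r₂ := by
  have hsub : Icc R₀ r₂ ⊆ Icc R₀ b := Icc_subset_Icc le_rfl hr₂.2
  have hmono : MonotoneOn S.Z (Icc R₀ r₂) := by
    refine monotoneOn_of_hasDerivWithinAt_nonneg (convex_Icc R₀ r₂)
      (f' := fun x => (8 * π * x * S.ρ x * (x * exp (S.μ x) - R₀ * exp (S.μ R₀)) +
        2 * R₀ * exp (S.μ R₀) * S.m x / x ^ 2) / √(S.w x))
      ((S.continuousOn_Z hM₀ hM).mono hsub) (fun x hx => ?_) (fun x hx => ?_)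
    · rw [interior_Icc] at hx ⊢
      exact (S.hasDerivAt_Z hM₀ hM ⟨hx.1, hx.2.trans_le hr₂.2⟩ (hpos x hx)).hasDerivWithinAt
    · rw [interior_Icc] at hx
      exact S.Z_deriv_nonneg hM₀ hM (hsub (Ioo_subset_Icc_self hx))
  exact hmono (left_mem_Icc.mpr hr₂.1) (right_mem_Icc.mpr hr₂.1) hr₂.1

/-! ### Layer 4c: Lemma 4.4 — `m(r₂)/r₂ ≥ 2/5` -/

omit hM₀ hM in
/-- The real-arithmetic endgame of Lemma 4.4: the Buchdahl-type inequality
`2F(s₀ - z) ≤ ((1-z²)/2 + Π)/z` with `F ≈ 1`, `s₀ ≈ 1`, `Π ≈ 0` and `z² ≤ 0.34` forces `z² ≤ 0.13`. [folklore] -/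
theorem endgame {z Pp F s₀ : ℝ} (hz0 : 0 < z) (hz : z ^ 2 ≤ 34 / 100)
    (hP : Pp ≤ 1 / 100) (hF0 : 99 / 100 ≤ F) (hF1 : F ≤ 1) (hs₀ : 998 / 1000 ≤ s₀ ^ 2)
    (hs₀0 : 0 ≤ s₀) (hmain : 2 * F * (s₀ - z) ≤ ((1 - z ^ 2) / 2 + Pp) / z) :
    z ^ 2 ≤ 13 / 100 := by
  have hz1 : z ≤ 59 / 100 := by nlinarith
  have hs1 : 9989 / 10000 ≤ s₀ := by nlinarith
  have hsz : 0 < s₀ - z := by linarith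
  rw [le_div_iff₀ hz0] at hmain
  -- `2 F z s₀ - 2 F z² ≤ (1 - z²)/2 + Π`
  have h1 : 2 * (99 / 100) * (9989 / 10000) * z - 2 * z ^ 2 ≤ (1 - z ^ 2) / 2 + 1 / 100 := by
    have e1 : 2 * (99 / 100) * (9989 / 10000) * z ≤ 2 * F * s₀ * z := by
      have := mul_le_mul hF0 hs1 (by norm_num) (by linarith)
      nlinarith
    have e2 : 2 * F * z ^ 2 ≤ 2 * z ^ 2 := by nlinarith
    nlinarith
  by_contra hcon
  push Not at hcon
  have hz2 : 36 / 100 < z := by nlinarith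
  nlinarith [mul_pos (sub_pos.mpr hz2) (sub_pos.mpr (show z < 60 / 100 by linarith))]

/-- **Lemma 4.4** (Andréasson 2021): at the first return radius `r₂`, `m(r₂)/r₂ ≥ 2/5`. The proof
integrates `Z' ≥ 0` from `R₀` to `r₂` (the "fundamental equation" of [A0]) and uses
`e^{μ(R₀)-μ(r₂)} R₀/r₂ = e^{γ_*} (R₀/r₂)² ∈ [(R₀/r₂)², 1]`.
[cite: Andreasson2021, Lemma 4.4] -/
theorem L44 (hb : R₀ + 12 * shellDelta ≤ b)
    (hA : 4 * M₀ / R₀ + 14 / 15 * S.Lam * (b / R₀) ^ 3 ≤ 1)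
    (hC : S.Lam / 120 * ((R₀ + 12 * shellDelta) / (R₀ + shellDelta)) ^ 3 ≤ 1 / 100)
    (hφ : 99 / 100 ≤ (R₀ / (R₀ + 12 * shellDelta)) ^ 2) (hs : 998 / 1000 ≤ 1 - 2 * M₀ / R₀)
    {r₂ : ℝ} (hr₂ : r₂ ∈ Icc (R₀ + shellDelta) (R₀ + 12 * shellDelta))
    (hγr₂ : S.γ r₂ = gammaStar R₀) (hge : ∀ r ∈ Icc (R₀ + shellDelta) r₂, gammaStar R₀ ≤ S.γ r)
    (h1 : 1 ≤ 3 * S.m r₂ / r₂ + 4 * π * r₂ ^ 2 * S.p r₂) : 2 / 5 ≤ S.m r₂ / r₂ := by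
  have hR₀ : 0 < R₀ := by linarith
  have hδ := shellDelta_pos
  have hγs := gammaStar_pos hR₀
  have hr₂b : r₂ ∈ Icc R₀ b := ⟨by linarith [hr₂.1], hr₂.2.trans hb⟩
  have hR₀b : R₀ ∈ Icc R₀ b := left_mem_Icc.mpr (hr₂b.1.trans hr₂b.2)
  have hr0 := pos_of_mem hM₀ hM hr₂b
  have hΛ := S.Lam_pos hM₀ hM (hr₂b.1.trans hr₂b.2)
  -- positivity of `γ` on `(R₀, r₂)`
  have hpos : ∀ x ∈ Ioo R₀ r₂, 0 < S.γ x := by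
    intro x hx
    rcases le_or_gt x (R₀ + shellDelta) with h | h
    · have := S.γ_ge_on_I₁ hM₀ hM (by linarith) hA ⟨hx.1.le, h⟩
      have : 0 < (x - R₀) / (2 * (R₀ + shellDelta)) := by
        apply div_pos <;> linarith [hx.1]
      linarith
    · exact hγs.trans_le (hge x ⟨h.le, hx.2.le⟩)
  have hZ := S.Z_R₀_le hM₀ hM hr₂b hpos
  -- notation
  set Y := S.m r₂ / r₂ with hY
  set Pp := 4 * π * r₂ ^ 2 * S.p r₂ with hPp
  have hw₂ : S.w r₂ = 1 - 2 * Y := by rw [hY, w]; ring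
  have hw₂pos := S.w_pos hM₀ hM hr₂b
  have hw₀ : S.w R₀ = 1 - 2 * M₀ / R₀ := by simp [w, S.m_R₀]
  have hw₀pos := S.w_pos hM₀ hM hR₀b
  set z := √(S.w r₂) with hz
  set s₀ := √(S.w R₀) with hs₀
  have hz0 : 0 < z := Real.sqrt_pos.mpr hw₂pos
  have hz2 : z ^ 2 = 1 - 2 * Y := by rw [hz, Real.sq_sqrt hw₂pos.le, hw₂]
  have hs₀0 : 0 ≤ s₀ := Real.sqrt_nonneg _
  have hs₀2 : s₀ ^ 2 = 1 - 2 * M₀ / R₀ := by rw [hs₀, Real.sq_sqrt hw₀pos.le, hw₀]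
  have hs₀1 : s₀ ≤ 1 := by
    rw [hs₀, Real.sqrt_le_one]; exact (S.w_lt_one hM₀ hM hR₀b).le
  have hp₂ := S.p_nonneg hM₀ hM hr₂b
  have hP0 : 0 ≤ Pp := by positivity
  -- `Π ≤ 1/100`
  have hP : Pp ≤ 1 / 100 := by
    have h := S.p_le hM₀ hM hr₂b
    rw [← Lam_def, hγr₂, max_eq_left hγs.le] at h
    have e : (S.Lam * (π ^ 2 / 3 * r₂ * gammaStar R₀ ^ 3)) * (4 * π * r₂ ^ 2) =
        S.Lam / 120 * (r₂ / (R₀ + shellDelta)) ^ 3 * (20 * (π ^ 3 * shellDelta ^ 3)) := by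
      rw [gammaStar]; field_simp; ring
    rw [pi_pow_three_mul_shellDelta_pow_three] at e
    calc Pp = S.p r₂ * (4 * π * r₂ ^ 2) := by rw [hPp]; ring
      _ ≤ (S.Lam * (π ^ 2 / 3 * r₂ * gammaStar R₀ ^ 3)) * (4 * π * r₂ ^ 2) :=
          mul_le_mul_of_nonneg_right h (by positivity)
      _ = S.Lam / 120 * (r₂ / (R₀ + shellDelta)) ^ 3 := by rw [e]; ring
      _ ≤ S.Lam / 120 * ((R₀ + 12 * shellDelta) / (R₀ + shellDelta)) ^ 3 := by
          gcongr; exact hr₂.2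
      _ ≤ 1 / 100 := hC
  -- `z² ≤ 0.34`
  have hz34 : z ^ 2 ≤ 34 / 100 := by
    rw [hz2]
    have : 1 ≤ 3 * Y + Pp := by
      rw [hY]; linarith [h1, show 3 * S.m r₂ / r₂ = 3 * (S.m r₂ / r₂) by ring]
    linarith
  -- the factor `F`
  set F := R₀ * exp (S.μ R₀) / (r₂ * exp (S.μ r₂)) with hF
  have hF1 : F ≤ 1 := by
    rw [hF, div_le_one (by positivity)]
    exact mul_le_mul hr₂b.1 (exp_le_exp.mpr (S.μ_R₀_le hM₀ hM hr₂b)) (exp_pos _).le hr0.le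
  have hF0 : 99 / 100 ≤ F := by
    -- `e^{μ₀ - μ₂} = e^{γ_*} R₀/r₂ ≥ R₀/r₂`
    have e1 : exp (S.μ R₀) / exp (S.μ r₂) = exp (gammaStar R₀) * (R₀ / r₂) := by
      have hγ0 := S.γ_R₀
      rw [γ] at hγ0 hγr₂
      have hq := S.q_pos hM₀ hM
      rw [← exp_sub]
      have : S.μ R₀ - S.μ r₂ = gammaStar R₀ + (log (R₀ / S.q) - log (r₂ / S.q)) := by linarith
      rw [this, exp_add, ← log_div (div_pos hR₀ hq).ne' (div_pos hr0 hq).ne', exp_log (by positivity)]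
      congr 1
      field_simp
    have e2 : F = exp (gammaStar R₀) * (R₀ / r₂) ^ 2 := by
      rw [hF, mul_div_mul_comm, e1]; ring
    rw [e2]
    calc (99 : ℝ) / 100 ≤ (R₀ / (R₀ + 12 * shellDelta)) ^ 2 := hφ
      _ ≤ (R₀ / r₂) ^ 2 := by gcongr; exact hr₂.2
      _ ≤ exp (gammaStar R₀) * (R₀ / r₂) ^ 2 :=
          le_mul_of_one_le_left (by positivity) (one_le_exp hγs.le)
  -- the main inequality from `Z(R₀) ≤ Z(r₂)`
  have hmain : 2 * F * (s₀ - z) ≤ ((1 - z ^ 2) / 2 + Pp) / z := by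
    have hZR₀ : 2 * R₀ * exp (S.μ R₀) * s₀ ≤ S.Z R₀ := by
      rw [Z, ← hs₀]
      have : 0 ≤ exp (S.μ R₀) * (S.m R₀ + 4 * π * R₀ ^ 3 * S.p R₀) / s₀ := by
        have := S.p_nonneg hM₀ hM hR₀b
        have := S.m_pos hM₀ hM hR₀b
        positivity
      linarith
    have hZr₂ : S.Z r₂ = exp (S.μ r₂) * (r₂ * (Y + Pp)) / z + 2 * R₀ * exp (S.μ R₀) * z := by
      rw [Z, ← hz, hY, hPp]
      field_simp
    have h3 : 2 * R₀ * exp (S.μ R₀) * (s₀ - z) ≤ exp (S.μ r₂) * (r₂ * (Y + Pp)) / z := by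
      linarith [hZ]
    have h4 : 2 * F * (s₀ - z) = 2 * R₀ * exp (S.μ R₀) * (s₀ - z) / (r₂ * exp (S.μ r₂)) := by
      rw [hF]; ring
    rw [h4, div_le_iff₀ (by positivity)]
    calc 2 * R₀ * exp (S.μ R₀) * (s₀ - z) ≤ exp (S.μ r₂) * (r₂ * (Y + Pp)) / z := h3
      _ = ((1 - z ^ 2) / 2 + Pp) / z * (r₂ * exp (S.μ r₂)) := by
          rw [hz2]; field_simp; ring
  have hend := endgame hz0 hz34 hP hF0 hF1 (by rw [hs₀2]; exact hs) hs₀0 hmain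
  rw [hz2] at hend
  linarith

/-! ### Layer 5: the Makino step — `γ` vanishes shortly after `r₂` -/

/-- **The Makino step** (Andréasson 2021, end of §4, after T. Makino): once `m/r ≥ 3/8` and
`γ ≤ 1/8`, the quantity `u = rγ/m` has `u' ≤ -3/(4r)`, so `γ` must vanish within distance
`(4/3) b u(r₂)` of `r₂`.
[cite: Andreasson2021, §4, the Makino argument after Remark 4.5] -/
theorem makino (hb12 : R₀ + 12 * shellDelta ≤ b) (hγb : log (b / R₀) ≤ 1 / 8)
    (hJ1 : 5 / 3 * b * shellDelta / (R₀ + shellDelta) ≤ (R₀ + shellDelta) / 15)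
    (hJ2 : R₀ + 12 * shellDelta + 5 / 3 * b * shellDelta / (R₀ + shellDelta) ≤ b)
    {r₂ : ℝ} (hr₂ : r₂ ∈ Icc (R₀ + shellDelta) (R₀ + 12 * shellDelta))
    (hγr₂ : S.γ r₂ = gammaStar R₀) (hY : 2 / 5 ≤ S.m r₂ / r₂) :
    ∃ R₁ ∈ Ioc r₂ b, S.γ R₁ = 0 := by
  have hR₀ : 0 < R₀ := by linarith
  have hδ := shellDelta_pos
  have hγs := gammaStar_pos hR₀
  have hr₂b : r₂ ∈ Icc R₀ b := ⟨by linarith [hr₂.1], hr₂.2.trans hb12⟩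
  have hr0 := pos_of_mem hM₀ hM hr₂b
  have hb0 : 0 < b := hR₀.trans_le (hr₂b.1.trans hr₂b.2)
  have hm₂ := S.m_pos hM₀ hM hr₂b
  set u₂ := r₂ * gammaStar R₀ / S.m r₂ with hu₂
  have hu₂pos : 0 < u₂ := by positivity
  have hu₂le : u₂ ≤ 5 / 2 * gammaStar R₀ := by
    rw [hu₂, div_le_iff₀ hm₂]
    rw [le_div_iff₀ hr0] at hY
    nlinarith [hγs]
  set L := 4 / 3 * b * u₂ with hL
  have hL0 : 0 < L := by positivity
  have hLle : L ≤ 5 / 3 * b * shellDelta / (R₀ + shellDelta) := by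
    calc L ≤ 4 / 3 * b * (5 / 2 * gammaStar R₀) := by rw [hL]; gcongr
      _ = 5 / 3 * b * shellDelta / (R₀ + shellDelta) := by rw [gammaStar]; field_simp; ring
  set s₁ := r₂ + L with hs₁
  have hs₁b : s₁ ≤ b := by linarith [hr₂.2]
  have hs₁r : s₁ ≤ 16 / 15 * r₂ := by linarith [hr₂.1]
  have hJsub : Icc r₂ s₁ ⊆ Icc R₀ b := Icc_subset_Icc hr₂b.1 hs₁b
  -- suppose `γ > 0` on all of `[r₂, s₁]`
  by_contra hnone
  push Not at hnone
  have hposJ : ∀ r ∈ Icc r₂ s₁, 0 < S.γ r := by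
    intro r hr
    by_contra hle
    push Not at hle
    -- IVT gives a zero in `[r₂, r]`, contradiction with `hnone`
    have hcont : ContinuousOn S.γ (Icc r₂ r) := fun x hx =>
      ((S.hasDerivWithinAt_γ hM₀ hM (hJsub ⟨hx.1, hx.2.trans hr.2⟩)).continuousWithinAt).mono
        ((Icc_subset_Icc le_rfl hr.2).trans hJsub)
    have h0 : (0 : ℝ) ∈ Icc (S.γ r) (S.γ r₂) := ⟨hle, by rw [hγr₂]; exact hγs.le⟩
    obtain ⟨c, hc, hγc⟩ := intermediate_value_Icc' hr.1 hcont h0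
    have hcr₂ : c ≠ r₂ := fun h => by rw [h, hγr₂] at hγc; linarith
    exact hnone c ⟨lt_of_le_of_ne hc.1 hcr₂.symm, hc.2.trans (hr.2.trans hs₁b)⟩ hγc
  -- `m/r ≥ 3/8` and `γ ≤ 1/8` on `[r₂, s₁]`
  have hm38 : ∀ r ∈ Icc r₂ s₁, 3 * r ≤ 8 * S.m r := by
    intro r hr
    have hmono := S.monotoneOn_m hM₀ hM hr₂b (hJsub hr) hr.1
    rw [le_div_iff₀ hr0] at hY
    nlinarith [hr.2]
  have hγ8 : ∀ r ∈ Icc r₂ s₁, S.γ r ≤ 1 / 8 := by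
    intro r hr
    have hr' := hJsub hr
    refine (S.γ_le_log hM₀ hM hr').trans (le_trans ?_ hγb)
    exact log_le_log (div_pos (pos_of_mem hM₀ hM hr') hR₀)
      (div_le_div_of_nonneg_right hr'.2 hR₀.le)
  -- the quantity `K = rγ/m + (3/(4b)) r` is non-increasing on `[r₂, s₁]`
  set K : ℝ → ℝ := fun r => r * S.γ r / S.m r + 3 / (4 * b) * r with hK
  have hK' : ∀ r ∈ Icc r₂ s₁, HasDerivWithinAt K
      (((S.γ r + r * (1 / r - (S.m r + 4 * π * r ^ 3 * S.p r) / (r * (r - 2 * S.m r)))) * S.m r -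
        r * S.γ r * (4 * π * r ^ 2 * S.ρ r)) / S.m r ^ 2 + 3 / (4 * b)) (Icc r₂ s₁) r := by
    intro r hr
    have hr' := hJsub hr
    have hγd := (S.hasDerivWithinAt_γ hM₀ hM hr').mono hJsub
    have hmd := (S.hasDerivWithinAt_m' hr').mono hJsub
    have h1 := ((hasDerivWithinAt_id r (Icc r₂ s₁)).mul hγd).div hmd (S.m_pos hM₀ hM hr').ne'
    have h2 := h1.add ((hasDerivWithinAt_id r (Icc r₂ s₁)).const_mul (3 / (4 * b)))
    refine h2.congr_deriv ?_
    simp only [Pi.mul_apply, id_eq, one_mul, mul_one]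
  have hK'neg : ∀ r ∈ Icc r₂ s₁,
      ((S.γ r + r * (1 / r - (S.m r + 4 * π * r ^ 3 * S.p r) / (r * (r - 2 * S.m r)))) * S.m r -
        r * S.γ r * (4 * π * r ^ 2 * S.ρ r)) / S.m r ^ 2 + 3 / (4 * b) ≤ 0 := by
    intro r hr
    have hr' := hJsub hr
    have hrpos := pos_of_mem hM₀ hM hr'
    have hm := S.m_pos hM₀ hM hr'
    have hden := S.sub_two_mul_m_pos hr'
    have hp := S.p_nonneg hM₀ hM hr'
    have hρ := S.ρ_nonneg hM₀ hM hr'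
    have hγ := (hposJ r hr).le
    have h38 := hm38 r hr
    have h8 := hγ8 r hr
    have hlt := S.two_mul_m_lt r hr'
    -- `(m + 4πr³p)/(r - 2m) ≥ 3/2`
    have hp3 : 0 ≤ 4 * π * r ^ 3 * S.p r := by positivity
    have e1 : 3 / 2 ≤ (S.m r + 4 * π * r ^ 3 * S.p r) / (r - 2 * S.m r) := by
      rw [le_div_iff₀ hden]; linarith
    have e2 : r * (1 / r - (S.m r + 4 * π * r ^ 3 * S.p r) / (r * (r - 2 * S.m r))) =
        1 - (S.m r + 4 * π * r ^ 3 * S.p r) / (r - 2 * S.m r) := by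
      field_simp
    set A := S.γ r + r * (1 / r - (S.m r + 4 * π * r ^ 3 * S.p r) / (r * (r - 2 * S.m r))) with hA
    have e3 : A ≤ -(3 / 8) := by rw [hA, e2]; linarith
    have hB : 0 ≤ r * S.γ r * (4 * π * r ^ 2 * S.ρ r) := by positivity
    have e4 : A * S.m r - r * S.γ r * (4 * π * r ^ 2 * S.ρ r) ≤ -(3 / 8) * S.m r := by
      have := mul_le_mul_of_nonneg_right e3 hm.le
      linarith
    have e5 : (A * S.m r - r * S.γ r * (4 * π * r ^ 2 * S.ρ r)) / S.m r ^ 2 ≤ -(3 / 8) / S.m r := by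
      have := div_le_div_of_nonneg_right e4 (sq_nonneg (S.m r))
      refine this.trans (le_of_eq ?_)
      field_simp
    have e6 : -(3 / 8) / S.m r ≤ -(3 / (4 * b)) := by
      have h1 : 3 / (4 * b) ≤ 3 / (8 * S.m r) :=
        div_le_div_of_nonneg_left (by norm_num) (by positivity) (by linarith [hr'.2])
      have h2 : -(3 / 8) / S.m r = -(3 / (8 * S.m r)) := by
        field_simp
      rw [h2]
      linarith
    linarith
  have hanti := antitoneOn_of_hasDerivWithinAt_Icc_nonpos hK' hK'neg
  have hr₂J : r₂ ∈ Icc r₂ s₁ := left_mem_Icc.mpr (by linarith)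
  have hs₁J : s₁ ∈ Icc r₂ s₁ := right_mem_Icc.mpr (by linarith)
  have hKle := hanti hr₂J hs₁J (by linarith)
  -- `K(r₂) = u₂ + (3/(4b)) r₂`, `K(s₁) = s₁ γ(s₁)/m(s₁) + (3/(4b)) s₁ > (3/(4b)) s₁`
  have hKr₂ : K r₂ = u₂ + 3 / (4 * b) * r₂ := by simp only [hK, hu₂, hγr₂]
  have hpos₁ : 0 < s₁ * S.γ s₁ / S.m s₁ := by
    have := hposJ s₁ hs₁J
    have := S.m_pos hM₀ hM (hJsub hs₁J)
    have : 0 < s₁ := by linarith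
    positivity
  have hKs₁ : K s₁ = s₁ * S.γ s₁ / S.m s₁ + 3 / (4 * b) * s₁ := rfl
  rw [hKr₂, hKs₁] at hKle
  have e : 3 / (4 * b) * s₁ = 3 / (4 * b) * r₂ + u₂ := by
    rw [hs₁, hL]; field_simp
  rw [e] at hKle
  linarith

/-! ### Layer 6: combination, and the numerical smallness conditions for `b = R₀ + 16δ`,
`R₀ ≥ 10⁴ δ`, `R₀ ≥ 10⁴ M₀` -/

/-- Combination of Lemmas 4.1, 4.3, 4.4 and the Makino step under abstract smallness hypotheses.
[cite: Andreasson2021, Theorem 3.10 (proof, §4)] -/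
theorem exists_zero (hb12 : R₀ + 12 * shellDelta ≤ b)
    (hA : 4 * M₀ / R₀ + 14 / 15 * S.Lam * (b / R₀) ^ 3 ≤ 1)
    (hB : R₀ + 12 * shellDelta ≤ 11 / 10 * S.lam * (R₀ + shellDelta))
    (hC : S.Lam / 120 * ((R₀ + 12 * shellDelta) / (R₀ + shellDelta)) ^ 3 ≤ 1 / 100)
    (hφ : 99 / 100 ≤ (R₀ / (R₀ + 12 * shellDelta)) ^ 2) (hs : 998 / 1000 ≤ 1 - 2 * M₀ / R₀)
    (hγb : log (b / R₀) ≤ 1 / 8)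
    (hJ1 : 5 / 3 * b * shellDelta / (R₀ + shellDelta) ≤ (R₀ + shellDelta) / 15)
    (hJ2 : R₀ + 12 * shellDelta + 5 / 3 * b * shellDelta / (R₀ + shellDelta) ≤ b) :
    ∃ R₁ ∈ Ioc R₀ b, S.γ R₁ = 0 ∧ M₀ < S.m R₁ := by
  have hR₀ : 0 < R₀ := by linarith
  have hδ := shellDelta_pos
  obtain ⟨r₂, hr₂, hγr₂, hge, h1⟩ := S.L43 hM₀ hM hb12 hA hB
  have hY := S.L44 hM₀ hM hb12 hA hC hφ hs hr₂ hγr₂ hge h1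
  obtain ⟨R₁, hR₁, hγR₁⟩ := S.makino hM₀ hM hb12 hγb hJ1 hJ2 hr₂ hγr₂ hY
  have hr₂b : r₂ ∈ Icc R₀ b := ⟨by linarith [hr₂.1], hr₂.2.trans hb12⟩
  have hR₁b : R₁ ∈ Icc R₀ b := ⟨by linarith [hr₂.1, hR₁.1], hR₁.2⟩
  refine ⟨R₁, ⟨by linarith [hr₂.1, hR₁.1], hR₁.2⟩, hγR₁, ?_⟩
  have hm : S.m r₂ ≤ S.m R₁ := S.monotoneOn_m hM₀ hM hr₂b hR₁b hR₁.1.le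
  have hr0 : 0 < r₂ := pos_of_mem hM₀ hM hr₂b
  rw [le_div_iff₀ hr0] at hY
  have : 2 * M₀ / R₀ ≤ 2 / 1000 := by linarith
  rw [div_le_iff₀ hR₀] at this
  linarith [hr₂.1]

/-- `Λ ≤ 1.01` for `b = R₀ + 16δ`, `R₀ ≥ 10⁴ δ`, `R₀ ≥ 10⁴ M₀`. [folklore] -/
theorem Lam_le (S₁ : ReducedSolution M₀ R₀ (R₀ + 16 * shellDelta))
    (hx : 10 ^ 4 * shellDelta ≤ R₀) (hy : 10 ^ 4 * M₀ ≤ R₀) : S₁.Lam ≤ 101 / 100 := by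
  have hδ := shellDelta_pos
  have hR₀ : 0 < R₀ := by linarith
  have hq := shellQ_pos hM hR₀
  rw [Lam_def, q]
  have h1 : (shellQ M₀ R₀ / R₀) ^ 2 ≤ 10000 / 9998 := by
    rw [div_pow, shellQ_sq hM hR₀, div_div,
      div_le_div_iff₀ (mul_pos (by linarith) (pow_pos hR₀ 2)) (by norm_num)]
    nlinarith [mul_le_mul_of_nonneg_right hy (sq_nonneg R₀)]
  have h1' : 1 ≤ shellQ M₀ R₀ / R₀ := by
    rw [le_div_iff₀ hR₀, one_mul]
    have h2 : R₀ ^ 2 ≤ shellQ M₀ R₀ ^ 2 := by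
      rw [shellQ_sq hM hR₀, le_div_iff₀ (by linarith)]
      nlinarith [mul_pos hM₀ (pow_pos hR₀ 2)]
    exact (pow_le_pow_iff_left₀ hR₀.le hq.le two_ne_zero).mp h2
  have h2 : (shellQ M₀ R₀ / R₀) ^ 5 ≤ (10000 / 9998) ^ 3 := by
    calc (shellQ M₀ R₀ / R₀) ^ 5 ≤ (shellQ M₀ R₀ / R₀) ^ 6 := pow_le_pow_right₀ h1' (by norm_num)
      _ = ((shellQ M₀ R₀ / R₀) ^ 2) ^ 3 := by ring
      _ ≤ (10000 / 9998) ^ 3 := pow_le_pow_left₀ (by positivity) h1 3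
  have h3 : (R₀ + 16 * shellDelta) / R₀ ≤ 10016 / 10000 := by
    rw [div_le_div_iff₀ hR₀ (by norm_num)]; nlinarith
  have h4 : ((R₀ + 16 * shellDelta) / R₀) ^ 5 ≤ (10016 / 10000) ^ 5 :=
    pow_le_pow_left₀ (by positivity) h3 5
  calc (shellQ M₀ R₀ / R₀) ^ 5 * ((R₀ + 16 * shellDelta) / R₀) ^ 5
      ≤ (10000 / 9998) ^ 3 * (10016 / 10000) ^ 5 :=
        mul_le_mul h2 h4 (by positivity) (by positivity)
    _ ≤ 101 / 100 := by norm_num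

/-- All smallness conditions hold for `b = R₀ + 16δ`, `R₀ ≥ 10⁴ δ`, `R₀ ≥ 10⁴ M₀`: the reduced
solution has a radius `R₁ ∈ (R₀, R₀ + 16δ]` with `γ(R₁) = 0` and `m(R₁) > M₀`.
[cite: Andreasson2021, Theorem 3.10] -/
theorem exists_zero_of_large (S₁ : ReducedSolution M₀ R₀ (R₀ + 16 * shellDelta))
    (hx : 10 ^ 4 * shellDelta ≤ R₀) (hy : 10 ^ 4 * M₀ ≤ R₀) :
    ∃ R₁ ∈ Ioc R₀ (R₀ + 16 * shellDelta), S₁.γ R₁ = 0 ∧ M₀ < S₁.m R₁ := by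
  have hδ := shellDelta_pos
  have hR₀ : 0 < R₀ := by linarith
  have hΛ := S₁.Lam_le hM₀ hM hx hy
  have hΛ0 := S₁.Lam_pos hM₀ hM (by linarith)
  have hbR : (R₀ + 16 * shellDelta) / R₀ ≤ 10016 / 10000 := by
    rw [div_le_div_iff₀ hR₀ (by norm_num)]; nlinarith
  refine S₁.exists_zero hM₀ hM (by linarith) ?_ ?_ ?_ ?_ ?_ ?_ ?_ ?_
  · -- hA
    have h1 : 4 * M₀ / R₀ ≤ 4 / 10000 := by
      rw [div_le_div_iff₀ hR₀ (by norm_num)]; nlinarith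
    have h2 : ((R₀ + 16 * shellDelta) / R₀) ^ 3 ≤ (10016 / 10000) ^ 3 :=
      pow_le_pow_left₀ (by positivity) hbR 3
    have h3 : 14 / 15 * S₁.Lam * ((R₀ + 16 * shellDelta) / R₀) ^ 3 ≤
        14 / 15 * (101 / 100) * (10016 / 10000) ^ 3 := by
      gcongr
    nlinarith
  · -- hB
    have h1 : 10000 / 10016 ≤ R₀ / (R₀ + 16 * shellDelta) := by
      rw [div_le_div_iff₀ (by norm_num) (by positivity)]; nlinarith
    have h2 : (10000 / 10016 : ℝ) ^ 5 ≤ S₁.lam := by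
      rw [lam_def]; exact pow_le_pow_left₀ (by norm_num) h1 5
    have h3 : (11 / 10 * (10000 / 10016 : ℝ) ^ 5) * (R₀ + shellDelta) ≤
        11 / 10 * S₁.lam * (R₀ + shellDelta) := by
      have : 0 ≤ R₀ + shellDelta := by positivity
      nlinarith
    refine le_trans ?_ h3
    nlinarith
  · -- hC
    have h1 : (R₀ + 12 * shellDelta) / (R₀ + shellDelta) ≤ 10012 / 10000 := by
      rw [div_le_div_iff₀ (by positivity) (by norm_num)]; nlinarith
    have h2 : ((R₀ + 12 * shellDelta) / (R₀ + shellDelta)) ^ 3 ≤ (10012 / 10000) ^ 3 :=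
      pow_le_pow_left₀ (by positivity) h1 3
    calc S₁.Lam / 120 * ((R₀ + 12 * shellDelta) / (R₀ + shellDelta)) ^ 3
        ≤ (101 / 100) / 120 * (10012 / 10000) ^ 3 := by gcongr
      _ ≤ 1 / 100 := by norm_num
  · -- hφ
    have h1 : 10000 / 10012 ≤ R₀ / (R₀ + 12 * shellDelta) := by
      rw [div_le_div_iff₀ (by norm_num) (by positivity)]; nlinarith
    calc (99 : ℝ) / 100 ≤ (10000 / 10012) ^ 2 := by norm_num
      _ ≤ (R₀ / (R₀ + 12 * shellDelta)) ^ 2 := pow_le_pow_left₀ (by norm_num) h1 2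
  · -- hs
    have : 2 * M₀ / R₀ ≤ 2 / 10000 := by
      rw [div_le_div_iff₀ hR₀ (by norm_num)]; nlinarith
    linarith
  · -- hγb
    have h1 := log_le_sub_one_of_pos (show 0 < (R₀ + 16 * shellDelta) / R₀ by positivity)
    have h2 : (R₀ + 16 * shellDelta) / R₀ - 1 ≤ 16 / 10000 := by linarith
    linarith
  · -- hJ1
    have h1 : 5 / 3 * (R₀ + 16 * shellDelta) * shellDelta / (R₀ + shellDelta) ≤
        5 / 3 * (R₀ + 16 * shellDelta) * shellDelta / R₀ :=
      div_le_div_of_nonneg_left (by positivity) hR₀ (by linarith)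
    have h2 : 5 / 3 * (R₀ + 16 * shellDelta) * shellDelta / R₀ ≤ 2 * shellDelta := by
      rw [div_le_iff₀ hR₀]; nlinarith
    have h3 : 2 * shellDelta ≤ (R₀ + shellDelta) / 15 := by linarith
    linarith
  · -- hJ2
    have h1 : 5 / 3 * (R₀ + 16 * shellDelta) * shellDelta / (R₀ + shellDelta) ≤
        5 / 3 * (R₀ + 16 * shellDelta) * shellDelta / R₀ :=
      div_le_div_of_nonneg_left (by positivity) hR₀ (by linarith)
    have h2 : 5 / 3 * (R₀ + 16 * shellDelta) * shellDelta / R₀ ≤ 2 * shellDelta := by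
      rw [div_le_iff₀ hR₀]; nlinarith
    linarith

/-! ## Part IV: gluing the reduced solution into a `StaticMasslessVlasovShell` -/

section Assembly

/-- `μ(R₀) = ½ log(1 - 2M₀/R₀)`. [folklore] -/
theorem μ_R₀_eq : S.μ R₀ = 1 / 2 * log (1 - 2 * M₀ / R₀) := by
  have hR₀ : 0 < R₀ := by linarith
  rw [S.μ_R₀, ← sq_div_shellQ_sq hM hR₀, ← div_pow, Real.log_pow]
  push_cast
  ring

/-- Where `γ = 0` the matter functions vanish: `ρ̂(r, μ(r)) = 0`. [folklore] -/
theorem rhoHat_eq_zero_of_γ {r : ℝ} (hr : r ∈ Icc R₀ b) (hγ : S.γ r = 0) :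
    rhoHat S.q r (S.μ r) = 0 := by
  have h := S.exp_γ hM₀ hM hr
  rw [hγ, exp_zero] at h
  rw [rhoHat, ← h, rhoProfile_eq_zero_of_le_one le_rfl, mul_zero]

/-- Where `γ = 0` the radial pressure vanishes: `p̂(r, μ(r)) = 0`. [folklore] -/
theorem pHat_eq_zero_of_γ {r : ℝ} (hr : r ∈ Icc R₀ b) (hγ : S.γ r = 0) :
    pHat S.q r (S.μ r) = 0 := by
  have h := S.exp_γ hM₀ hM hr
  rw [hγ, exp_zero] at h
  rw [pHat, ← h, pProfile_eq_zero_of_le_one le_rfl, mul_zero]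

omit hM₀ hM in
/-- The Schwarzschild potential `½ log(1 - 2M/x)` has derivative `M/(x(x-2M))`. [folklore] -/
theorem hasDerivAt_half_log {M x : ℝ} (hx : 2 * M < x) (hx0 : 0 < x) :
    HasDerivAt (fun y => 1 / 2 * log (1 - 2 * M / y)) (M / (x * (x - 2 * M))) x := by
  have hy2 : x - 2 * M ≠ 0 := by linarith
  have hy1 : 1 - 2 * M / x ≠ 0 := by
    rw [sub_ne_zero, ne_comm, ne_eq, div_eq_one_iff_eq hx0.ne']; linarith
  have h1 : HasDerivAt (fun z => 1 - 2 * M / z) (-((0 * x - 2 * M * 1) / x ^ 2)) x :=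
    (((hasDerivAt_const x (2 * M)).div (hasDerivAt_id x) hx0.ne')).const_sub 1
  refine ((h1.log hy1).const_mul (1 / 2)).congr_deriv ?_
  field_simp
  ring

/-- The glued Hawking mass: `M₀` on the gap, the solution on the slab, constant beyond.
[cite: Andreasson2021, §3 (f = 0 on [2M₀, R₀]; Schwarzschild glued at R₁)] -/
def gluedM (R₁ r : ℝ) : ℝ := if r ≤ R₀ then M₀ else if r ≤ R₁ then S.m r else S.m R₁

/-- The glued metric exponent: Schwarzschild of mass `M₀` on the gap, the solution on the slab,
Schwarzschild of mass `m(R₁)` (continuously attached) beyond.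
[cite: Andreasson2021, §3 (e^{2μ} = 1 - 2M₀/r on the gap; Schwarzschild glued at R₁), Remark 3.6] -/
def gluedμ (R₁ r : ℝ) : ℝ :=
  if r ≤ R₀ then 1 / 2 * log (1 - 2 * M₀ / r)
  else if r ≤ R₁ then S.μ r
  else S.μ R₁ + 1 / 2 * (log (1 - 2 * S.m R₁ / r) - log (1 - 2 * S.m R₁ / R₁))

omit hM₀ hM in
/-- The glued mass is `M₀` on the gap `r ≤ R₀`. [folklore] -/
theorem gluedM_of_le {R₁ r : ℝ} (hr : r ≤ R₀) : S.gluedM R₁ r = M₀ := by simp [gluedM, hr]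

omit hM₀ hM in
/-- The glued mass is the solution on the slab `[R₀, R₁]`. [folklore] -/
theorem gluedM_of_Icc {R₁ r : ℝ} (hr : r ∈ Icc R₀ R₁) : S.gluedM R₁ r = S.m r := by
  unfold gluedM
  split_ifs with h1 h2
  · rw [le_antisymm h1 hr.1, S.m_R₀]
  · rfl
  · exact absurd hr.2 h2

omit hM₀ hM in
/-- The glued mass is constant `= m(R₁)` beyond `R₁`. [folklore] -/
theorem gluedM_of_ge {R₁ r : ℝ} (hR₁ : R₀ < R₁) (hr : R₁ ≤ r) : S.gluedM R₁ r = S.m R₁ := by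
  unfold gluedM
  split_ifs with h1 h2
  · linarith
  · rw [le_antisymm h2 hr]
  · rfl

omit hM₀ hM in
/-- The glued potential is Schwarzschild of mass `M₀` on the gap. [folklore] -/
theorem gluedμ_of_le {R₁ r : ℝ} (hr : r ≤ R₀) :
    S.gluedμ R₁ r = 1 / 2 * log (1 - 2 * M₀ / r) := by
  simp [gluedμ, hr]

/-- The glued potential is the solution on the slab `[R₀, R₁]`. [folklore] -/
theorem gluedμ_of_Icc {R₁ r : ℝ} (hr : r ∈ Icc R₀ R₁) : S.gluedμ R₁ r = S.μ r := by
  unfold gluedμ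
  split_ifs with h1 h2
  · rw [le_antisymm h1 hr.1, S.μ_R₀_eq hM₀ hM]
  · rfl
  · exact absurd hr.2 h2

omit hM₀ hM in
/-- The glued potential is Schwarzschild of mass `m(R₁)` (shifted to be continuous) beyond `R₁`. [folklore] -/
theorem gluedμ_of_ge {R₁ r : ℝ} (hR₁ : R₀ < R₁) (hr : R₁ ≤ r) :
    S.gluedμ R₁ r = S.μ R₁ + 1 / 2 * (log (1 - 2 * S.m R₁ / r) - log (1 - 2 * S.m R₁ / R₁)) := by
  unfold gluedμ
  split_ifs with h1 h2
  · linarith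
  · rw [le_antisymm h2 hr]; ring
  · rfl

variable {R₁ : ℝ} (hR₁ : R₁ ∈ Ioc R₀ b)
include hR₁

omit hM₀ hM in
/-- `2 · gluedM < r` on `r > 2M₀`. [folklore] -/
theorem two_mul_gluedM_lt {r : ℝ} (hr : 2 * M₀ < r) : 2 * S.gluedM R₁ r < r := by
  have hR₁b : R₁ ∈ Icc R₀ b := ⟨hR₁.1.le, hR₁.2⟩
  rcases le_or_gt r R₀ with h | h
  · rw [S.gluedM_of_le h]; exact hr
  rcases le_or_gt r R₁ with h' | h'
  · rw [S.gluedM_of_Icc ⟨h.le, h'⟩]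
    exact S.two_mul_m_lt r ⟨h.le, h'.trans hR₁.2⟩
  · rw [S.gluedM_of_ge hR₁.1 h'.le]
    linarith [S.two_mul_m_lt R₁ hR₁b]

/-- **The glued mass solves (2.1).**
[cite: Andreasson2021, §2 (2.1)] -/
theorem hasDerivAt_gluedM (hγR₁ : S.γ R₁ = 0) (r : ℝ) :
    HasDerivAt (S.gluedM R₁) (4 * π * r ^ 2 *
      (Icc R₀ R₁).indicator (fun x => rhoHat S.q x (S.gluedμ R₁ x)) r) r := by
  have hR₀ : 0 < R₀ := by linarith
  have hR₁b : R₁ ∈ Icc R₀ b := ⟨hR₁.1.le, hR₁.2⟩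
  have hR₀b : R₀ ∈ Icc R₀ b := left_mem_Icc.mpr (hR₁b.1.trans hR₁b.2)
  rcases lt_trichotomy r R₀ with h | h | h
  · -- gap: locally constant
    rw [indicator_of_notMem (fun hm => (not_le.mpr h) hm.1), mul_zero]
    refine (hasDerivAt_const r M₀).congr_of_eventuallyEq ?_
    filter_upwards [Iio_mem_nhds h] with x hx
    exact S.gluedM_of_le hx.le
  · -- at `R₀`: both one-sided derivatives vanish
    rw [h, indicator_of_mem (left_mem_Icc.mpr hR₁.1.le),
      S.gluedμ_of_Icc hM₀ hM (left_mem_Icc.mpr hR₁.1.le),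
      S.rhoHat_eq_zero_of_γ hM₀ hM hR₀b S.γ_R₀, mul_zero]
    have hl : HasDerivWithinAt (S.gluedM R₁) 0 (Iic R₀) R₀ :=
      (hasDerivWithinAt_const R₀ (Iic R₀) M₀).congr (fun x hx => S.gluedM_of_le hx)
        (S.gluedM_of_le le_rfl)
    have hr' : HasDerivWithinAt S.m (4 * π * R₀ ^ 2 * S.ρ R₀) (Ici R₀) R₀ :=
      (S.hasDerivWithinAt_m' hR₀b).mono_of_mem_nhdsWithin (Icc_mem_nhdsGE (hR₁.1.trans_le hR₁.2))
    rw [ρ, S.rhoHat_eq_zero_of_γ hM₀ hM hR₀b S.γ_R₀, mul_zero] at hr'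
    have hr'' : HasDerivWithinAt (S.gluedM R₁) 0 (Ici R₀) R₀ := by
      refine hr'.congr_of_eventuallyEq ?_ (by rw [S.gluedM_of_le le_rfl, S.m_R₀])
      filter_upwards [Icc_mem_nhdsGE hR₁.1] with x hx
      exact S.gluedM_of_Icc hx
    have := hl.union hr''
    rwa [Iic_union_Ici, hasDerivWithinAt_univ] at this
  rcases lt_trichotomy r R₁ with h' | h' | h'
  · -- slab interior
    rw [indicator_of_mem (show r ∈ Icc R₀ R₁ from ⟨h.le, h'.le⟩),
      S.gluedμ_of_Icc hM₀ hM ⟨h.le, h'.le⟩]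
    have hd := (S.hasDerivWithinAt_m' ⟨h.le, h'.le.trans hR₁.2⟩).hasDerivAt
      (Icc_mem_nhds h (h'.trans_le hR₁.2))
    refine hd.congr_of_eventuallyEq ?_
    filter_upwards [Ioo_mem_nhds h h'] with x hx
    exact S.gluedM_of_Icc ⟨hx.1.le, hx.2.le⟩
  · -- at `R₁`: both one-sided derivatives vanish
    rw [h', indicator_of_mem (right_mem_Icc.mpr hR₁.1.le),
      S.gluedμ_of_Icc hM₀ hM (right_mem_Icc.mpr hR₁.1.le),
      S.rhoHat_eq_zero_of_γ hM₀ hM hR₁b hγR₁, mul_zero]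
    have hl : HasDerivWithinAt S.m (4 * π * R₁ ^ 2 * S.ρ R₁) (Iic R₁) R₁ :=
      ((S.hasDerivWithinAt_m' hR₁b).mono (Icc_subset_Icc le_rfl hR₁.2 : Icc R₀ R₁ ⊆ Icc R₀ b)
        ).mono_of_mem_nhdsWithin (Icc_mem_nhdsLE hR₁.1)
    rw [ρ, S.rhoHat_eq_zero_of_γ hM₀ hM hR₁b hγR₁, mul_zero] at hl
    have hl' : HasDerivWithinAt (S.gluedM R₁) 0 (Iic R₁) R₁ := by
      refine hl.congr_of_eventuallyEq ?_ (S.gluedM_of_Icc (right_mem_Icc.mpr hR₁.1.le))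
      filter_upwards [Ioc_mem_nhdsLE hR₁.1] with x hx
      exact S.gluedM_of_Icc ⟨hx.1.le, hx.2⟩
    have hr' : HasDerivWithinAt (S.gluedM R₁) 0 (Ici R₁) R₁ :=
      (hasDerivWithinAt_const R₁ (Ici R₁) (S.m R₁)).congr (fun x hx => S.gluedM_of_ge hR₁.1 hx)
        (S.gluedM_of_ge hR₁.1 le_rfl)
    have := hl'.union hr'
    rwa [Iic_union_Ici, hasDerivWithinAt_univ] at this
  · -- exterior: locally constant
    rw [indicator_of_notMem (fun hm => (not_le.mpr h') hm.2), mul_zero]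
    refine (hasDerivAt_const r (S.m R₁)).congr_of_eventuallyEq ?_
    filter_upwards [Ioi_mem_nhds h'] with x hx
    exact S.gluedM_of_ge hR₁.1 hx.le

/-- **The glued potential solves (2.2).**
[cite: Andreasson2021, §2 (2.2)] -/
theorem hasDerivAt_gluedμ (hγR₁ : S.γ R₁ = 0) {r : ℝ} (hr : 2 * M₀ < r) :
    HasDerivAt (S.gluedμ R₁) ((S.gluedM R₁ r + 4 * π * r ^ 3 *
      (Icc R₀ R₁).indicator (fun x => pHat S.q x (S.gluedμ R₁ x)) r) /
        (r * (r - 2 * S.gluedM R₁ r))) r := by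
  have hR₀ : 0 < R₀ := by linarith
  have hr0 : 0 < r := by linarith
  have hR₁b : R₁ ∈ Icc R₀ b := ⟨hR₁.1.le, hR₁.2⟩
  have hR₀b : R₀ ∈ Icc R₀ b := left_mem_Icc.mpr (hR₁b.1.trans hR₁b.2)
  have hM₁ := S.two_mul_m_lt R₁ hR₁b
  rcases lt_trichotomy r R₀ with h | h | h
  · -- gap: Schwarzschild of mass `M₀`
    rw [indicator_of_notMem (fun hm => (not_le.mpr h) hm.1), mul_zero, add_zero, S.gluedM_of_le h.le]
    refine (hasDerivAt_half_log hr hr0).congr_of_eventuallyEq ?_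
    filter_upwards [Iio_mem_nhds h] with x hx
    exact S.gluedμ_of_le hx.le
  · -- at `R₀`
    rw [h, indicator_of_mem (left_mem_Icc.mpr hR₁.1.le), S.gluedμ_of_Icc hM₀ hM (left_mem_Icc.mpr hR₁.1.le),
      S.pHat_eq_zero_of_γ hM₀ hM hR₀b S.γ_R₀, mul_zero, add_zero, S.gluedM_of_le le_rfl]
    have hl : HasDerivWithinAt (S.gluedμ R₁) (M₀ / (R₀ * (R₀ - 2 * M₀))) (Iic R₀) R₀ :=
      (hasDerivAt_half_log hM hR₀).hasDerivWithinAt.congr (fun x hx => S.gluedμ_of_le hx)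
        (S.gluedμ_of_le le_rfl)
    have hr' : HasDerivWithinAt S.μ ((S.m R₀ + 4 * π * R₀ ^ 3 * S.p R₀) / (R₀ * (R₀ - 2 * S.m R₀)))
        (Ici R₀) R₀ :=
      (S.hasDerivWithinAt_μ' hR₀b).mono_of_mem_nhdsWithin (Icc_mem_nhdsGE (hR₁.1.trans_le hR₁.2))
    rw [p, S.pHat_eq_zero_of_γ hM₀ hM hR₀b S.γ_R₀, mul_zero, add_zero, S.m_R₀] at hr'
    have hr'' : HasDerivWithinAt (S.gluedμ R₁) (M₀ / (R₀ * (R₀ - 2 * M₀))) (Ici R₀) R₀ := by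
      refine hr'.congr_of_eventuallyEq ?_ (S.gluedμ_of_Icc hM₀ hM (left_mem_Icc.mpr hR₁.1.le))
      filter_upwards [Icc_mem_nhdsGE hR₁.1] with x hx
      exact S.gluedμ_of_Icc hM₀ hM hx
    have := hl.union hr''
    rwa [Iic_union_Ici, hasDerivWithinAt_univ] at this
  rcases lt_trichotomy r R₁ with h' | h' | h'
  · -- slab interior
    rw [indicator_of_mem (show r ∈ Icc R₀ R₁ from ⟨h.le, h'.le⟩),
      S.gluedμ_of_Icc hM₀ hM ⟨h.le, h'.le⟩, S.gluedM_of_Icc ⟨h.le, h'.le⟩]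
    have hd := (S.hasDerivWithinAt_μ' ⟨h.le, h'.le.trans hR₁.2⟩).hasDerivAt
      (Icc_mem_nhds h (h'.trans_le hR₁.2))
    refine hd.congr_of_eventuallyEq ?_
    filter_upwards [Ioo_mem_nhds h h'] with x hx
    exact S.gluedμ_of_Icc hM₀ hM ⟨hx.1.le, hx.2.le⟩
  · -- at `R₁`
    rw [h', indicator_of_mem (right_mem_Icc.mpr hR₁.1.le),
      S.gluedμ_of_Icc hM₀ hM (right_mem_Icc.mpr hR₁.1.le),
      S.pHat_eq_zero_of_γ hM₀ hM hR₁b hγR₁, mul_zero, add_zero,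
      S.gluedM_of_Icc (right_mem_Icc.mpr hR₁.1.le)]
    have hl : HasDerivWithinAt S.μ ((S.m R₁ + 4 * π * R₁ ^ 3 * S.p R₁) / (R₁ * (R₁ - 2 * S.m R₁)))
        (Iic R₁) R₁ :=
      ((S.hasDerivWithinAt_μ' hR₁b).mono (Icc_subset_Icc le_rfl hR₁.2 : Icc R₀ R₁ ⊆ Icc R₀ b)
        ).mono_of_mem_nhdsWithin (Icc_mem_nhdsLE hR₁.1)
    rw [p, S.pHat_eq_zero_of_γ hM₀ hM hR₁b hγR₁, mul_zero, add_zero] at hl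
    have hl' : HasDerivWithinAt (S.gluedμ R₁) (S.m R₁ / (R₁ * (R₁ - 2 * S.m R₁))) (Iic R₁) R₁ := by
      refine hl.congr_of_eventuallyEq ?_ (S.gluedμ_of_Icc hM₀ hM (right_mem_Icc.mpr hR₁.1.le))
      filter_upwards [Ioc_mem_nhdsLE hR₁.1] with x hx
      exact S.gluedμ_of_Icc hM₀ hM ⟨hx.1.le, hx.2⟩
    have hR₁0 : 0 < R₁ := hR₀.trans hR₁.1
    have hext : HasDerivAt (fun y => S.μ R₁ + (1 / 2 * log (1 - 2 * S.m R₁ / y) -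
        1 / 2 * log (1 - 2 * S.m R₁ / R₁))) (S.m R₁ / (R₁ * (R₁ - 2 * S.m R₁))) R₁ := by
      have := ((hasDerivAt_half_log hM₁ hR₁0).sub_const (1 / 2 * log (1 - 2 * S.m R₁ / R₁))).const_add
        (S.μ R₁)
      simpa using this
    have hr' : HasDerivWithinAt (S.gluedμ R₁) (S.m R₁ / (R₁ * (R₁ - 2 * S.m R₁))) (Ici R₁) R₁ := by
      refine hext.hasDerivWithinAt.congr (fun x hx => ?_) ?_
      · rw [S.gluedμ_of_ge hR₁.1 hx]; ring
      · rw [S.gluedμ_of_ge hR₁.1 le_rfl]; ring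
    have := hl'.union hr'
    rwa [Iic_union_Ici, hasDerivWithinAt_univ] at this
  · -- exterior: Schwarzschild of mass `m(R₁)`
    rw [indicator_of_notMem (fun hm => (not_le.mpr h') hm.2), mul_zero, add_zero,
      S.gluedM_of_ge hR₁.1 h'.le]
    have hext : HasDerivAt (fun y => S.μ R₁ + (1 / 2 * log (1 - 2 * S.m R₁ / y) -
        1 / 2 * log (1 - 2 * S.m R₁ / R₁))) (S.m R₁ / (r * (r - 2 * S.m R₁))) r := by
      have := ((hasDerivAt_half_log (hM₁.trans h') hr0).sub_const
        (1 / 2 * log (1 - 2 * S.m R₁ / R₁))).const_add (S.μ R₁)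
      simpa using this
    refine hext.congr_of_eventuallyEq ?_
    filter_upwards [Ioi_mem_nhds h'] with x hx
    rw [S.gluedμ_of_ge hR₁.1 hx.le]; ring

/-- **The shell.** The glued functions form a `StaticMasslessVlasovShell M₀` with `E₀ = 1`,
`L₀ = q²`, `k = 0`, `l = 1/2`, `Rin = R₀`, `Rout = R₁`, given the closed-form identification
of the matter integrals (Part I).
[cite: Andreasson2021, Theorem 3.5 and §3] -/
def toShell (h3 : 3 * M₀ < R₀) (hγR₁ : S.γ R₁ = 0)
    (hρcf : ∀ (μ : ℝ → ℝ) (r : ℝ), 0 < r →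
      energyDensity (polytropicAnsatz 1 (S.q ^ 2) 0 (1 / 2)) μ r = rhoHat S.q r (μ r))
    (hpcf : ∀ (μ : ℝ → ℝ) (r : ℝ), 0 < r →
      radialPressure (polytropicAnsatz 1 (S.q ^ 2) 0 (1 / 2)) μ r = pHat S.q r (μ r)) :
    StaticMasslessVlasovShell M₀ where
  E₀ := 1
  L₀ := S.q ^ 2
  k := 0
  l := 1 / 2
  Rin := R₀
  Rout := R₁
  μ := S.gluedμ R₁
  m := S.gluedM R₁
  M₀_pos := hM₀
  E₀_pos := one_pos
  L₀_pos := pow_pos (S.q_pos hM₀ hM) 2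
  k_nonneg := le_rfl
  half_le_l := le_rfl
  three_mul_lt_Rin := h3
  Rin_lt_Rout := hR₁.1
  m_eq_of_le_Rin := fun r _ hr => S.gluedM_of_le hr
  two_mul_m_lt := fun r hr => S.two_mul_gluedM_lt hR₁ hr
  hasDerivAt_m := fun r hr => by
    have h := S.hasDerivAt_gluedM hM₀ hM hR₁ hγR₁ r
    have e : (Icc R₀ R₁).indicator (energyDensity (polytropicAnsatz 1 (S.q ^ 2) 0 (1 / 2))
        (S.gluedμ R₁)) r = (Icc R₀ R₁).indicator (fun x => rhoHat S.q x (S.gluedμ R₁ x)) r := by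
      by_cases hm : r ∈ Icc R₀ R₁
      · rw [indicator_of_mem hm, indicator_of_mem hm, hρcf _ _ (by linarith)]
      · rw [indicator_of_notMem hm, indicator_of_notMem hm]
    rw [e]; exact h
  hasDerivAt_μ := fun r hr => by
    have h := S.hasDerivAt_gluedμ hM₀ hM hR₁ hγR₁ hr
    have e : (Icc R₀ R₁).indicator (radialPressure (polytropicAnsatz 1 (S.q ^ 2) 0 (1 / 2))
        (S.gluedμ R₁)) r = (Icc R₀ R₁).indicator (fun x => pHat S.q x (S.gluedμ R₁ x)) r := by
      by_cases hm : r ∈ Icc R₀ R₁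
      · rw [indicator_of_mem hm, indicator_of_mem hm, hpcf _ _ (by linarith)]
      · rw [indicator_of_notMem hm, indicator_of_notMem hm]
    rw [e]; exact h
  ansatz_Rin := fun w L hL => by
    have hR₀ : 0 < R₀ := by linarith
    have hq := shellQ_pos hM hR₀
    refine polytropicAnsatz_energy_eq_zero (exp_pos _).le hR₀ ?_ w hL
    rw [S.gluedμ_of_Icc hM₀ hM (left_mem_Icc.mpr hR₁.1.le), S.μ_R₀, exp_log (div_pos hR₀ hq)]
    simp only [q]
    rw [Real.sqrt_sq hq.le, one_mul, div_mul_cancel₀ _ hq.ne']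
  ansatz_Rout := fun w L hL => by
    have hR₀ : 0 < R₀ := by linarith
    have hq := shellQ_pos hM hR₀
    have hR₁0 : 0 < R₁ := hR₀.trans hR₁.1
    refine polytropicAnsatz_energy_eq_zero (exp_pos _).le hR₁0 ?_ w hL
    rw [S.gluedμ_of_Icc hM₀ hM (right_mem_Icc.mpr hR₁.1.le)]
    have h := hγR₁
    rw [γ] at h
    have : S.μ R₁ = log (R₁ / S.q) := by linarith
    rw [this]
    simp only [q]
    rw [exp_log (div_pos hR₁0 hq), Real.sqrt_sq hq.le, one_mul, div_mul_cancel₀ _ hq.ne']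
  exp_two_mul_μ_Rin := by
    have hR₀ : 0 < R₀ := by linarith
    have h10 : 0 < 1 - 2 * M₀ / R₀ := by rw [sub_pos, div_lt_one hR₀]; exact hM
    rw [S.gluedμ_of_le le_rfl, ← mul_assoc, show (2 : ℝ) * (1 / 2) = 1 by norm_num, one_mul,
      exp_log h10]

/-- The ADM mass of the glued shell is `m(R₁)`. [folklore] -/
theorem toShell_admMass (h3 : 3 * M₀ < R₀) (hγR₁ : S.γ R₁ = 0)
    (hρcf : ∀ (μ : ℝ → ℝ) (r : ℝ), 0 < r →
      energyDensity (polytropicAnsatz 1 (S.q ^ 2) 0 (1 / 2)) μ r = rhoHat S.q r (μ r))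
    (hpcf : ∀ (μ : ℝ → ℝ) (r : ℝ), 0 < r →
      radialPressure (polytropicAnsatz 1 (S.q ^ 2) 0 (1 / 2)) μ r = pHat S.q r (μ r)) :
    (S.toShell hM₀ hM hR₁ h3 hγR₁ hρcf hpcf).admMass = S.m R₁ :=
  S.gluedM_of_Icc (right_mem_Icc.mpr hR₁.1.le)

/-- The glued shell has `k = 0`, `l = 1/2`. [folklore] -/
theorem toShell_k (h3 : 3 * M₀ < R₀) (hγR₁ : S.γ R₁ = 0)
    (hρcf : ∀ (μ : ℝ → ℝ) (r : ℝ), 0 < r →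
      energyDensity (polytropicAnsatz 1 (S.q ^ 2) 0 (1 / 2)) μ r = rhoHat S.q r (μ r))
    (hpcf : ∀ (μ : ℝ → ℝ) (r : ℝ), 0 < r →
      radialPressure (polytropicAnsatz 1 (S.q ^ 2) 0 (1 / 2)) μ r = pHat S.q r (μ r)) :
    (S.toShell hM₀ hM hR₁ h3 hγR₁ hρcf hpcf).k = 0 ∧ (S.toShell hM₀ hM hR₁ h3 hγR₁ hρcf hpcf).l = 1 / 2 :=
  ⟨rfl, rfl⟩

end Assembly

end ReducedSolution


end MasslessVlasov

open MasslessVlasov MasslessVlasov.ReducedSolution in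
/-- **Andréasson's existence theorem for static massless Vlasov shells around a Schwarzschild black
hole** (Theorems 3.5/3.10 of the paper, in the vocabulary of `StaticMasslessVlasovShell`): for every
`M₀ > 0` there is a `StaticMasslessVlasovShell M₀` with `k = 0`, `l = 1/2` carrying matter
(`M₀ < admMass`). Proof: with `δ = (20π³)^{-1/3}` take `R₀ := 10⁴(δ + M₀)` and
`L₀ := R₀³/(R₀ - 2M₀)` (so that `R₀` is a root of `(1 - 2M₀/r)L₀/r² = 1`); solve the reduced
system (closed forms of `ρ`, `p` for `k = 0`, `l = 1/2`) on `[R₀, R₀ + 16δ]` from Schwarzschild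
data at `R₀` (Peano + the a priori bound `2m/r < 1 - η₀`); the estimates of §4 (Lemmas 4.1, 4.3,
4.4 and the Makino step, with `2m/r < 1` in place of the bound `8/9` of [A2]) give a radius
`R₁ ≤ R₀ + 16δ` with `γ(R₁) = 0` and `m(R₁) > M₀`; glue Schwarzschild of mass `M₀` inside and of
mass `m(R₁)` outside. [cite: Andreasson2021, Theorem 3.5 and Theorem 3.10] -/
theorem Andreasson2021_shellExistence_holds : Andreasson2021_shellExistence := by
  intro M₀ hM₀
  have hδ := shellDelta_pos
  set R₀ : ℝ := 10 ^ 4 * (shellDelta + M₀) with hR₀def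
  have hx : 10 ^ 4 * shellDelta ≤ R₀ := by rw [hR₀def]; nlinarith
  have hy : 10 ^ 4 * M₀ ≤ R₀ := by rw [hR₀def]; nlinarith
  have hM : 2 * M₀ < R₀ := by rw [hR₀def]; nlinarith
  have h3 : 3 * M₀ < R₀ := by rw [hR₀def]; nlinarith
  obtain ⟨S⟩ := exists_reducedSolution hM₀ hM (T := 16 * shellDelta) (by positivity)
  obtain ⟨R₁, hR₁, hγ, hm⟩ := S.exists_zero_of_large hM₀ hM hx hy
  have hq : 0 < S.q := S.q_pos hM₀ hM
  have hρcf : ∀ (μ : ℝ → ℝ) (r : ℝ), 0 < r →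
      energyDensity (polytropicAnsatz 1 (S.q ^ 2) 0 (1 / 2)) μ r = rhoHat S.q r (μ r) := by
    intro μ r hr
    rw [energyDensity_zero_half (pow_pos hq 2) hr, Real.sqrt_sq hq.le]
  have hpcf : ∀ (μ : ℝ → ℝ) (r : ℝ), 0 < r →
      radialPressure (polytropicAnsatz 1 (S.q ^ 2) 0 (1 / 2)) μ r = pHat S.q r (μ r) := by
    intro μ r hr
    rw [radialPressure_zero_half (pow_pos hq 2) hr, Real.sqrt_sq hq.le]
  refine ⟨S.toShell hM₀ hM hR₁ h3 hγ hρcf hpcf, rfl, rfl, ?_⟩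
  rw [toShell_admMass]
  exact hm

end Literature.Geometry.Lorentzian
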